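/-
Copyright: h21 hsemireg venture — plan-lens-HodgeAV-anomaly g9–g10 (workfile; kernel-checked, sorry-free).

# LawSpan — span induction for an admissible cell law; the bi-anchored ∕ core ∕ saturation factorisation; the RULE-D engines in `◇_h`

NARRATIVE, VERSION HISTORY, INSTRUMENT TABLES, LONG DOCSTRINGS: `PROOF-SKETCH-FLOORTOP-LAW.md` (same directory; v2.5 shortened the docstrings here).
§1–§6 span induction for any admissible law (`confined_of_step(s)`, `confined_lcLaw_iff`); §7–§9 the laws `lawSS ⊇ lawS2 ⊇ lawSP`, `BiAnchoredStep`,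
`Transport`, `CoreStep`, `Saturation`; §10–§12 ceiling ∕ floor ENGINES of RULE D (PROVED, h-uniform); §28 fully-charged half of saturation (PROVED ∀ h);
§29 two-charged half = corner cells, programme law `L*₂ = lawS2` (PROVED ∀ h); §30–§31 no corner cell ⇒ **`saturation_lawS2` ∀ h > 0**; §32 the killers
`not_upper_unit_top(_depth)` ∕ `not_lower_unit_origin`, **`noThree_two`, `confined_lawS2_two`**, assembly **`coneLineConfinement_of_core_lawS2' :
(∀ k ≥ 2, NoThree (2k)) → (∀ k ≥ 2, Transport lawS2 (2k)) → ConeLineConfinement`**; §33 (v2.5) `G₁` as an engine: phase uniqueness at a unit ceiling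
letter, `δ`-rotated siblings, four three-charged families killed ∀ h (first `NoThree` rungs).
NOT PROVED HERE: HC ∕ HC_AV ∕ HC_CM ∕ BlochSeedDiscOne (18881); `NoThree (2k)`, `Transport lawS2 (2k)` for `k ≥ 2`; no `LineConfinement h` for `h ≥ 4`.
HYGIENE: `chargedCount`, `ThinCell`, `SingleLine`, `LineConfinement`, `CeilingAnchored` restated byte-for-byte from `LineConfinementSpan.lean` (workfiles
cannot import each other).
-/
import Summits.Ventures.HSemireg.Pad4TowerB1OddBoostBlind

namespace Summit.Ventures.HSemireg.Pad4Tower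

namespace AnomalyLens

namespace LawSpan

open Finset

/-! ## §1 Restated cell predicates and the statement of record -/

/-- number of charged letters (`β ≠ 0`) of a cell. -/
abbrev chargedCount (Z : MCell) : ℕ := (univ.filter fun f : Fin 4 => (Z f).2 ≠ (0, 0)).card

/-- a cell is THIN: at most one charged letter. -/
abbrev ThinCell (Z : MCell) : Prop := chargedCount Z ≤ 1

/-- a cell is SINGLE-LINE: all four letters have the same causal height `α + c`. -/
abbrev SingleLine (Z : MCell) : Prop := ∀ f, (Z f).1 + absCharge (Z f) = (Z 0).1 + absCharge (Z 0)

/-- **`LineConfinement h`** (verbatim `LineConfinementSpan` §1). -/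
def LineConfinement (h : ℤ) : Prop :=
  ∀ C : MConfig, C.InDiamond h → C.G1Closed → C.StaticH1 →
    (∀ Z ∈ C.lower, ¬ ThinCell Z → SingleLine Z) ∧ ∀ P ∈ C.upper, ¬ ThinCell P → SingleLine P

/-- a support is CEILING-ANCHORED at height `h` (verbatim `LineConfinementSpan` §2). -/
abbrev CeilingAnchored (h : ℤ) (C : MConfig) : Prop :=
  (∃ Z ∈ C.lower, ∃ f, OnCeiling h (Z f)) ∨ ∃ P ∈ C.upper, ∃ f, OnCeiling h (P f)

/-! ## §2 Cell laws, confinement to a law, the full-span step, admissibility -/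

/-- a CELL LAW: `A h b Z` = "a static `G₁`-closed support in `◇_h` may contain the cell `Z` at level `b`" (`b = false`: lower ∕ N-cells,
`b = true`: upper ∕ P-cells).  Laws are upper bounds on the alive set; the exact alive law of the instrument is the least one. -/
abbrev CellLaw := ℤ → Bool → MCell → Prop

/-- **`Confined A h`**: every static `G₁`-closed support in `◇_h` obeys the law `A h`. -/
def Confined (A : CellLaw) (h : ℤ) : Prop :=
  ∀ C : MConfig, C.InDiamond h → C.G1Closed → C.StaticH1 → (∀ Z ∈ C.lower, A h false Z) ∧ ∀ P ∈ C.upper, A h true P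

/-- **`ConfinedStep A h`**: the law for FULL-SPAN supports only (touching the floor line AND the ceiling line `h`). -/
def ConfinedStep (A : CellLaw) (h : ℤ) : Prop :=
  ∀ C : MConfig, C.InDiamond h → C.G1Closed → C.StaticH1 → C.FloorAnchored → CeilingAnchored h C →
    (∀ Z ∈ C.lower, A h false Z) ∧ ∀ P ∈ C.upper, A h true P

/-- ADMISSIBLE laws: closed under raising the ceiling (mono) and under the boost by `+2` (boost).  Every h-independent boost-blind law is
admissible; so is every law of the form "charged letters at node level ≥ k" (levels only grow under the boost). -/
structure Admissible (A : CellLaw) : Prop where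
  mono : ∀ h b Z, A (h - 2) b Z → A h b Z
  boost : ∀ h b Z, A (h - 2) b (Z.boost (-2)) → A h b Z

/-- the step is a special case of confinement. -/
theorem step_of_confined {A : CellLaw} {h : ℤ} (H : Confined A h) : ConfinedStep A h :=
  fun C hU hG hS _ _ => H C hU hG hS

/-- a weaker law is implied support-wise. -/
theorem confined_mono_law {A B : CellLaw} {h : ℤ} (hAB : ∀ b Z, A h b Z → B h b Z) (H : Confined A h) : Confined B h :=
  fun C hU hG hS => ⟨fun Z hZ => hAB false Z ((H C hU hG hS).1 Z hZ), fun P hP => hAB true P ((H C hU hG hS).2 P hP)⟩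

/-! ## §3 The span induction for admissible laws -/

/-- **THE STEP LEMMA (general).** For even `h` and an admissible law: confinement at `h - 2` and the full-span step at `h` give confinement at `h`
((a) not ceiling-anchored ⇒ in `◇_{h-2}`; (b) ceiling- not floor-anchored ⇒ boost by `-2`; (c) full-span ⇒ the step). -/
theorem confined_of_step {A : CellLaw} (hA : Admissible A) {h : ℤ} (hh : h % 2 = 0) (ih : Confined A (h - 2))
    (step : ConfinedStep A h) : Confined A h := by
  intro C hU hG hS
  have hdia : ∀ Z, (Z ∈ C.lower ∨ Z ∈ C.upper) → ∀ f, InDiamond h (Z f) := by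
    intro Z hZ f
    rcases hZ with hZ | hZ
    · exact hU.1 Z hZ f
    · exact hU.2 Z hZ f
  by_cases hc : CeilingAnchored h C
  · by_cases hf : C.FloorAnchored
    · exact step C hU hG hS hf hc
    · -- case (b): boost down by 2
      have hlev : ∀ Z, (Z ∈ C.lower ∨ Z ∈ C.upper) → ∀ f, absCharge (Z f) + 2 ≤ (Z f).1 := by
        intro Z hZ f
        have hx := hdia Z hZ f
        have hnf : ¬ OnFloor (Z f) := by
          intro hfl
          rcases hZ with hZ | hZ
          · exact hf (Or.inl ⟨Z, hZ, f, hfl⟩)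
          · exact hf (Or.inr ⟨Z, hZ, f, hfl⟩)
        have h1 := hx.2.1
        have h2 := hx.2.2.1
        have h3 : (Z f).1 ≠ absCharge (Z f) := hnf
        omega
      have hU' : (C.boostImage (-2)).InDiamond (h - 2) := by
        constructor
        · intro W hW f
          obtain ⟨Z, hZ, rfl⟩ := Finset.mem_image.mp hW
          have hx := hdia Z (Or.inl hZ) f
          have hle := hlev Z (Or.inl hZ) f
          show InDiamond (h - 2) (boostPt (-2) (Z f))
          exact inDiamond_boostPt hx (by decide) (by omega) (by have := hx.2.2.2; omega)
        · intro W hW f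
          obtain ⟨Z, hZ, rfl⟩ := Finset.mem_image.mp hW
          have hx := hdia Z (Or.inr hZ) f
          have hle := hlev Z (Or.inr hZ) f
          show InDiamond (h - 2) (boostPt (-2) (Z f))
          exact inDiamond_boostPt hx (by decide) (by omega) (by have := hx.2.2.2; omega)
      obtain ⟨hSi, hGi, -⟩ :=
        staticH1BoostInvariant_holds (-2) C (inCone_of_inDiamond' hU) (inCone_of_inDiamond' hU')
      have H := ih _ hU' (hGi.mp hG) (hSi.mp hS)
      constructor
      · intro Z hZ
        exact hA.boost h false Z (H.1 (Z.boost (-2)) (Finset.mem_image_of_mem _ hZ))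
      · intro P hP
        exact hA.boost h true P (H.2 (P.boost (-2)) (Finset.mem_image_of_mem _ hP))
  · -- case (a): the support lies in ◇_{h-2}
    have hU2 : C.InDiamond (h - 2) := by
      have key : ∀ Z, (Z ∈ C.lower ∨ Z ∈ C.upper) → ∀ f, InDiamond (h - 2) (Z f) := by
        intro Z hZ f
        have hx := hdia Z hZ f
        have hnc : ¬ OnCeiling h (Z f) := by
          intro hcl
          rcases hZ with hZ | hZ
          · exact hc (Or.inl ⟨Z, hZ, f, hcl⟩)
          · exact hc (Or.inr ⟨Z, hZ, f, hcl⟩)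
        have h3 : (Z f).1 + absCharge (Z f) ≠ h := hnc
        refine ⟨hx.1, hx.2.1, hx.2.2.1, ?_⟩
        have h2 := hx.2.2.1
        have h4 := hx.2.2.2
        omega
      exact ⟨fun Z hZ f => key Z (Or.inl hZ) f, fun P hP f => key P (Or.inr hP) f⟩
    have H := ih C hU2 hG hS
    exact ⟨fun Z hZ => hA.mono h false Z (H.1 Z hZ), fun P hP => hA.mono h true P (H.2 P hP)⟩

/-- for even `h` and a law that is also DOWNWARD monotone in the height (true for every h-independent law), confinement at `h` is exactly
confinement at `h - 2` plus the full-span step. -/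
theorem confined_iff_step {A : CellLaw} (hA : Admissible A) {h : ℤ} (hdown : ∀ b Z, A h b Z → A (h - 2) b Z)
    (hh : h % 2 = 0) : Confined A h ↔ Confined A (h - 2) ∧ ConfinedStep A h := by
  refine ⟨fun H => ⟨?_, step_of_confined H⟩, fun H => confined_of_step hA hh H.1 H.2⟩
  intro C hU hG hS
  have hU' : C.InDiamond h :=
    ⟨fun Z hZ f => inDiamond_mono (by omega) (hU.1 Z hZ f), fun P hP f => inDiamond_mono (by omega) (hU.2 P hP f)⟩
  exact ⟨fun Z hZ => hdown false Z ((H C hU' hG hS).1 Z hZ), fun P hP => hdown true P ((H C hU' hG hS).2 P hP)⟩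

/-- **THE SPAN INDUCTION (general)**: base at height `2` and the full-span steps at `4, 6, …, 2n` give confinement at `2n`. -/
theorem confined_of_steps {A : CellLaw} (hA : Admissible A) (base : Confined A 2)
    (steps : ∀ k : ℕ, 2 ≤ k → ConfinedStep A (2 * (k : ℤ))) : ∀ n : ℕ, 1 ≤ n → Confined A (2 * (n : ℤ)) := by
  intro n
  induction n with
  | zero => intro h; omega
  | succ m ihm =>
    intro _
    rcases Nat.eq_zero_or_pos m with hm | hm
    · subst hm
      simpa using base
    · have ih2 : Confined A (2 * ((m + 1 : ℕ) : ℤ) - 2) := by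
        have e : 2 * ((m + 1 : ℕ) : ℤ) - 2 = 2 * (m : ℤ) := by push_cast; ring
        rw [e]; exact ihm hm
      exact confined_of_step hA (by omega) ih2 (steps (m + 1) (by omega))

/-- the rung-by-rung form: the base and the steps at `4, …, 2n` ONLY give confinement at `2n`. -/
theorem confined_of_steps_le {A : CellLaw} (hA : Admissible A) (base : Confined A 2) (n : ℕ)
    (steps : ∀ k : ℕ, 2 ≤ k → k ≤ n → ConfinedStep A (2 * (k : ℤ))) : 1 ≤ n → Confined A (2 * (n : ℤ)) := by
  induction n with
  | zero => intro h; omega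
  | succ m ihm =>
    intro _
    rcases Nat.eq_zero_or_pos m with hm | hm
    · subst hm
      simpa using base
    · have ih2 : Confined A (2 * ((m + 1 : ℕ) : ℤ) - 2) := by
        have e : 2 * ((m + 1 : ℕ) : ℤ) - 2 = 2 * (m : ℤ) := by push_cast; ring
        rw [e]; exact ihm (fun k hk hkm => steps k hk (by omega)) hm
      exact confined_of_step hA (by omega) ih2 (steps (m + 1) (by omega) le_rfl)

/-! ## §4 Instance 1: the law of record (`LineConfinement`) -/

/-- the line-confinement law: thick ⇒ single-line (h-independent, level-independent). -/
def lcLaw : CellLaw := fun _ _ Z => ¬ ThinCell Z → SingleLine Z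

/-- single-line-ness is boost-blind (all causal heights shift by `s`). -/
theorem singleLine_boost_iff (s : ℤ) (Z : MCell) : SingleLine (Z.boost s) ↔ SingleLine Z := by
  constructor
  · intro H f
    have e := H f
    simp only [MCell.boost, boostPt, absCharge_boostPt] at e
    change (Z f).1 + s + absCharge (Z f) = (Z 0).1 + s + absCharge (Z 0) at e
    omega
  · intro H f
    have e := H f
    show (Z f).1 + s + absCharge (boostPt s (Z f)) = (Z 0).1 + s + absCharge (boostPt s (Z 0))
    rw [absCharge_boostPt, absCharge_boostPt]; omega

/-- thinness is boost-blind (the boost keeps `β`). -/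
theorem thinCell_boost_iff (s : ℤ) (Z : MCell) : ThinCell (Z.boost s) ↔ ThinCell Z := Iff.rfl

theorem lcLaw_admissible : Admissible lcLaw where
  mono := fun _ _ _ H => H
  boost := fun _ _ Z H hth => (singleLine_boost_iff (-2) Z).mp (H ((thinCell_boost_iff (-2) Z).not.mpr hth))

/-- `Confined lcLaw h` is `LineConfinement h` on the nose. -/
theorem confined_lcLaw_iff (h : ℤ) : Confined lcLaw h ↔ LineConfinement h := Iff.rfl

/-- so v1.1's step lemma is the instance `A = lcLaw` of `confined_of_step`. -/
theorem lineConfinement_of_step' {h : ℤ} (hh : h % 2 = 0) (ih : LineConfinement (h - 2)) (step : ConfinedStep lcLaw h) :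
    LineConfinement h :=
  (confined_lcLaw_iff h).mp (confined_of_step lcLaw_admissible hh ((confined_lcLaw_iff (h - 2)).mpr ih) step)

/-! ## §5 Instance 2: the strong (bi-anchored) law — typed, not asserted -/

/-- all CHARGED letters of `Z` sit at node level `≥ k` (`α - c ≥ k`). -/
def ChargeLevelGe (k : ℤ) (Z : MCell) : Prop := ∀ f : Fin 4, (Z f).2 ≠ (0, 0) → absCharge (Z f) + k ≤ (Z f).1

/-- **the strong law** `strongLaw kP kN`: thick ⇒ single-line, AND a thick P-cell has its charged letters at node level `≥ kP`, a thick N-cell at node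
level `≥ kN` (instrument: the alive tables satisfy `strongLaw 2 4` at `h = 2, 4, 6`; NOT asserted). -/
def strongLaw (kP kN : ℤ) : CellLaw := fun _ b Z =>
  (¬ ThinCell Z → SingleLine Z) ∧ (¬ ThinCell Z → ChargeLevelGe (if b then kP else kN) Z)

/-- node levels grow by `2` under the boost by `+2`, so a level bound on the boosted-down cell gives the bound (indeed `+2`) on the cell. -/
theorem chargeLevelGe_of_boost {k : ℤ} {Z : MCell} (H : ChargeLevelGe k (Z.boost (-2))) : ChargeLevelGe k Z := by
  intro f hf
  have e := H f hf
  simp only [MCell.boost, boostPt, absCharge_boostPt] at e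
  change absCharge (Z f) + k ≤ (Z f).1 + (-2) at e
  omega

theorem strongLaw_admissible (kP kN : ℤ) : Admissible (strongLaw kP kN) where
  mono := fun _ _ _ H => H
  boost := fun _ _ Z H =>
    ⟨fun hth => (singleLine_boost_iff (-2) Z).mp (H.1 ((thinCell_boost_iff (-2) Z).not.mpr hth)),
      fun hth => chargeLevelGe_of_boost (H.2 ((thinCell_boost_iff (-2) Z).not.mpr hth))⟩

/-- the strong law projects onto the law of record. -/
theorem lineConfinement_of_confined_strong {kP kN h : ℤ} (H : Confined (strongLaw kP kN) h) : LineConfinement h :=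
  (confined_lcLaw_iff h).mp (confined_mono_law (fun _ _ hZ => hZ.1) H)

/-- **the strengthened tower**: the strong base at `2` and the strong FULL-SPAN steps at `4, …, 2n` give `LineConfinement (2n)` — the inductive
hypothesis available inside each step is now the strong law on every sub-span support, not merely line confinement. -/
theorem lineConfinement_of_strong_steps {kP kN : ℤ} (base : Confined (strongLaw kP kN) 2) (n : ℕ) (hn : 1 ≤ n)
    (steps : ∀ k : ℕ, 2 ≤ k → k ≤ n → ConfinedStep (strongLaw kP kN) (2 * (k : ℤ))) : LineConfinement (2 * (n : ℤ)) :=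
  lineConfinement_of_confined_strong (confined_of_steps_le (strongLaw_admissible kP kN) base n steps hn)

/-- conjunction of admissible laws is admissible (laws can be strengthened piecemeal). -/
theorem admissible_and {A B : CellLaw} (hA : Admissible A) (hB : Admissible B) :
    Admissible (fun h b Z => A h b Z ∧ B h b Z) where
  mono := fun h b Z H => ⟨hA.mono h b Z H.1, hB.mono h b Z H.2⟩
  boost := fun h b Z H => ⟨hA.boost h b Z H.1, hB.boost h b Z H.2⟩

/-- a CEILING-RELATIVE law is admissible when it only RELAXES as the ceiling recedes: `A` given as a predicate of the ceiling offset `h - (α+c)`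
of the letters that is monotone in `h` on each cell and boost-compatible.  (Template for tower ∕ apex laws; instances are filed with their steps.) -/
theorem admissible_of_mono_boost {A : CellLaw} (hmono : ∀ h b Z, A (h - 2) b Z → A h b Z)
    (hboost : ∀ h b Z, A (h - 2) b (Z.boost (-2)) → A h b Z) : Admissible A := ⟨hmono, hboost⟩

/-! ## §6 The world is the cone: h-independent laws hold at every height iff they hold for supports in the open cone -/

/-- **`ConeConfined A`** for an h-INDEPENDENT law `A`: every finite static `G₁`-closed support in the OPEN CONE (floor, no ceiling; `MConfig.InCone`)
obeys `A` — the whole tower `∀ h, Confined (fun _ => A) h` as ONE ceiling-free statement (sketch v1 §7). -/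
def ConeConfined (A : Bool → MCell → Prop) : Prop :=
  ∀ C : MConfig, C.InCone → C.G1Closed → C.StaticH1 → (∀ Z ∈ C.lower, A false Z) ∧ ∀ P ∈ C.upper, A true P

/-- **cone ↔ all heights** for h-independent laws. -/
theorem coneConfined_iff_all (A : Bool → MCell → Prop) : ConeConfined A ↔ ∀ h, Confined (fun _ => A) h := by
  constructor
  · intro H h C hU hG hS
    exact H C (inCone_of_inDiamond' hU) hG hS
  · intro H C hC hG hS
    by_cases hne : C.letters.Nonempty
    · obtain ⟨x₁, hx₁, hmax⟩ := Finset.exists_max_image C.letters (fun x => x.1 + absCharge x) hne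
      have hcone : ∀ x ∈ C.letters, InCone x := by
        intro x hx
        obtain ⟨Z, hZ, f, rfl⟩ := exists_of_mem_letters hx
        rcases hZ with hZ | hZ
        · exact hC.1 Z hZ f
        · exact hC.2 Z hZ f
      have hU : C.InDiamond (x₁.1 + absCharge x₁) := by
        constructor
        · intro Z hZ f
          have hx := hcone (Z f) (mem_letters (Or.inl hZ) f)
          have hle := hmax (Z f) (mem_letters (Or.inl hZ) f)
          exact ⟨hx.1, hx.2.1, hx.2.2, hle⟩
        · intro Z hZ f
          have hx := hcone (Z f) (mem_letters (Or.inr hZ) f)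
          have hle := hmax (Z f) (mem_letters (Or.inr hZ) f)
          exact ⟨hx.1, hx.2.1, hx.2.2, hle⟩
      exact H _ C hU hG hS
    · exact ⟨fun Z hZ => absurd ⟨Z 0, mem_letters (Or.inl hZ) 0⟩ hne, fun P hP => absurd ⟨P 0, mem_letters (Or.inr hP) 0⟩ hne⟩

/-- **`ConeLineConfinement`**: line confinement with NO ceiling — every finite static `G₁`-closed support in the open cone has its thick cells
single-line.  This is the h-uniform content of the law of record. -/
def ConeLineConfinement : Prop :=
  ∀ C : MConfig, C.InCone → C.G1Closed → C.StaticH1 →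
    (∀ Z ∈ C.lower, ¬ ThinCell Z → SingleLine Z) ∧ ∀ P ∈ C.upper, ¬ ThinCell P → SingleLine P

/-- `(∀ h, LineConfinement h) ↔ ConeLineConfinement`. -/
theorem lineConfinement_all_iff_cone : (∀ h, LineConfinement h) ↔ ConeLineConfinement := by
  have e : ConeLineConfinement ↔ ConeConfined (fun _ Z => ¬ ThinCell Z → SingleLine Z) := Iff.rfl
  rw [e, coneConfined_iff_all]
  exact forall_congr' fun h => (confined_lcLaw_iff h).symm

/-- so the strengthened tower proves the ceiling-free statement: strong base + ALL strong full-span steps ⇒ `ConeLineConfinement`. -/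
theorem coneLineConfinement_of_strong_steps {kP kN : ℤ} (base : Confined (strongLaw kP kN) 2)
    (steps : ∀ k : ℕ, 2 ≤ k → ConfinedStep (strongLaw kP kN) (2 * (k : ℤ))) : ConeLineConfinement := by
  rw [← lineConfinement_all_iff_cone]
  intro h
  -- a large even height 2n ≥ h, then antitonicity of the (h-independent) law of record
  obtain ⟨n, hn1, hn⟩ : ∃ n : ℕ, 1 ≤ n ∧ h ≤ 2 * (n : ℤ) := by
    refine ⟨(Int.toNat h) + 1, by omega, ?_⟩
    have := Int.self_le_toNat h
    push_cast; omega
  have H2n : LineConfinement (2 * (n : ℤ)) :=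
    lineConfinement_of_confined_strong (confined_of_steps (strongLaw_admissible kP kN) base steps n hn1)
  exact fun C hU hG hS => H2n C ⟨fun Z hZ f => inDiamond_mono hn (hU.1 Z hZ f), fun P hP f => inDiamond_mono hn (hU.2 P hP f)⟩ hG hS

/-! ## §7 Instance 3: the charge-ladder law `L**` of sketch v1 §9 — typed, admissible, NOT asserted -/

/-- **charge-ladder level law**: a thick cell with `q` charged letters has EVERY charged letter at node level `≥ 2(q-1)` if upper (P), `≥ 2q` if lower
(N).  Instrument: 0 violations on the alive tables of ◇₂–◇₈. -/
def chargeLadderLaw : CellLaw := fun _ b Z =>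
  ¬ ThinCell Z → ∀ f : Fin 4, (Z f).2 ≠ (0, 0) → absCharge (Z f) + (2 * (chargedCount Z : ℤ) - (if b then 2 else 0)) ≤ (Z f).1

/-- **thin apex law**: a thin cell on two or more lines has three letters equal to one apex letter `(t, 0, 0)`.  Instrument: every alive thin
multi-line cell at `h ≤ 8` has the shape `[tI tI tI | x]` (0 violations). -/
def thinApexLaw : CellLaw := fun _ _ Z =>
  ThinCell Z → ¬ SingleLine Z → ∃ t : ℤ, 3 ≤ (univ.filter fun f : Fin 4 => Z f = ((t, (0, 0)) : BPoint)).card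

/-- **`L**`** = line confinement ∧ charge-ladder level law ∧ thin apex law. -/
def lawSS : CellLaw := fun h b Z => lcLaw h b Z ∧ (chargeLadderLaw h b Z ∧ thinApexLaw h b Z)

/-- the boost keeps `β`, hence the charged count. -/
theorem chargedCount_boost (s : ℤ) (Z : MCell) : chargedCount (Z.boost s) = chargedCount Z := rfl

theorem chargeLadderLaw_admissible : Admissible chargeLadderLaw where
  mono := fun _ _ _ H => H
  boost := fun _ b Z H hth f hf => by
    have e := H ((thinCell_boost_iff (-2) Z).not.mpr hth) f hf
    rw [chargedCount_boost] at e
    simp only [MCell.boost, boostPt, absCharge_boostPt] at e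
    change absCharge (Z f) + (2 * (chargedCount Z : ℤ) - (if b then 2 else 0)) ≤ (Z f).1 + (-2) at e
    omega

/-- a boosted letter is the apex `(t,0,0)` iff the letter is the apex `(t+2,0,0)`. -/
theorem boostPt_eq_apex_iff (x : BPoint) (t : ℤ) : boostPt (-2) x = ((t, (0, 0)) : BPoint) ↔ x = ((t + 2, (0, 0)) : BPoint) := by
  obtain ⟨a, b⟩ := x
  simp only [boostPt, Prod.mk.injEq]
  constructor
  · rintro ⟨h1, h2⟩; exact ⟨by omega, h2⟩
  · rintro ⟨h1, h2⟩; exact ⟨by omega, h2⟩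

theorem thinApexLaw_admissible : Admissible thinApexLaw where
  mono := fun _ _ _ H => H
  boost := fun _ _ Z H hth hsl => by
    obtain ⟨t, ht⟩ := H ((thinCell_boost_iff (-2) Z).mpr hth) (fun h => hsl ((singleLine_boost_iff (-2) Z).mp h))
    refine ⟨t + 2, ?_⟩
    have e : (univ.filter fun f : Fin 4 => (Z.boost (-2)) f = ((t, (0, 0)) : BPoint)) =
        univ.filter fun f : Fin 4 => Z f = ((t + 2, (0, 0)) : BPoint) := by
      apply Finset.filter_congr
      intro f _
      exact boostPt_eq_apex_iff (Z f) t
    rw [e] at ht; exact ht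

theorem lawSS_admissible : Admissible lawSS :=
  admissible_and lcLaw_admissible (admissible_and chargeLadderLaw_admissible thinApexLaw_admissible)

/-- `L**` projects onto the law of record. -/
theorem lineConfinement_of_confined_lawSS {h : ℤ} (H : Confined lawSS h) : LineConfinement h :=
  (confined_lcLaw_iff h).mp (confined_mono_law (fun _ _ hZ => hZ.1) H)

/-- **the `L**` tower**: the base at `2` and the FULL-SPAN steps at `4, …, 2n` give `LineConfinement (2n)`; all steps give `ConeLineConfinement`
(instrument, sketch v1 §9 (D5): the `L**`-violators of ◇₄ ∕ ◇₆ all die under sound forcing, residual 0 ∕ 0; not asserted). -/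
theorem lineConfinement_of_lawSS_steps (base : Confined lawSS 2) (n : ℕ) (hn : 1 ≤ n)
    (steps : ∀ k : ℕ, 2 ≤ k → k ≤ n → ConfinedStep lawSS (2 * (k : ℤ))) : LineConfinement (2 * (n : ℤ)) :=
  lineConfinement_of_confined_lawSS (confined_of_steps_le lawSS_admissible base n steps hn)

theorem coneLineConfinement_of_lawSS_steps (base : Confined lawSS 2)
    (steps : ∀ k : ℕ, 2 ≤ k → ConfinedStep lawSS (2 * (k : ℤ))) : ConeLineConfinement := by
  rw [← lineConfinement_all_iff_cone]
  intro h
  obtain ⟨n, hn1, hn⟩ : ∃ n : ℕ, 1 ≤ n ∧ h ≤ 2 * (n : ℤ) := by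
    refine ⟨(Int.toNat h) + 1, by omega, ?_⟩
    have := Int.self_le_toNat h
    push_cast; omega
  have H2n : LineConfinement (2 * (n : ℤ)) :=
    lineConfinement_of_confined_lawSS (confined_of_steps lawSS_admissible base steps n hn1)
  exact fun C hU hG hS => H2n C ⟨fun Z hZ f => inDiamond_mono hn (hU.1 Z hZ f), fun P hP f => inDiamond_mono hn (hU.2 P hP f)⟩ hG hS

/-! ## §8 (v1.2) The load-bearing law `L*₂ = (i)+(ii)` and the BI-ANCHORED form of the step (sketch v1.1 (D6)(D7), §10′) — typed, NOT asserted

Instrument (machine ≠ kernel): at ◇₆ the sound forcing layering closes for the goal «(i) thick ⇒ single-line or (ii) the charge ladder violated» and the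
step is SELF-SIMILAR — the BI-ANCHORED violators (a floor letter AND a top-line letter) die using only each other, the rest of `◇_h` is two translated
copies of `◇_{h-2}`.  Targets: `BiAnchoredStep lawS2 h` and `Transport lawS2 h`. -/

/-- **`L*₂`** = line confinement ∧ charge-ladder level law (no thin clause). -/
def lawS2 : CellLaw := fun h b Z => lcLaw h b Z ∧ chargeLadderLaw h b Z

theorem lawS2_admissible : Admissible lawS2 := admissible_and lcLaw_admissible chargeLadderLaw_admissible

theorem lineConfinement_of_confined_lawS2 {h : ℤ} (H : Confined lawS2 h) : LineConfinement h :=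
  (confined_lcLaw_iff h).mp (confined_mono_law (fun _ _ hZ => hZ.1) H)

theorem coneLineConfinement_of_lawS2_steps (base : Confined lawS2 2)
    (steps : ∀ k : ℕ, 2 ≤ k → ConfinedStep lawS2 (2 * (k : ℤ))) : ConeLineConfinement := by
  rw [← lineConfinement_all_iff_cone]
  intro h
  obtain ⟨n, hn1, hn⟩ : ∃ n : ℕ, 1 ≤ n ∧ h ≤ 2 * (n : ℤ) := by
    refine ⟨(Int.toNat h) + 1, by omega, ?_⟩
    have := Int.self_le_toNat h
    push_cast; omega
  have H2n : LineConfinement (2 * (n : ℤ)) :=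
    lineConfinement_of_confined_lawS2 (confined_of_steps lawS2_admissible base steps n hn1)
  exact fun C hU hG hS => H2n C ⟨fun Z hZ f => inDiamond_mono hn (hU.1 Z hZ f), fun P hP f => inDiamond_mono hn (hU.2 P hP f)⟩ hG hS

/-- a cell is BI-ANCHORED at height `h`: one of its letters lies on the floor (`α = c`, node level 0) and one on the top line (`α + c = h`).
Instrument name: range `[0,h]`. -/
def BiAnchored (h : ℤ) (Z : MCell) : Prop := (∃ f, OnFloor (Z f)) ∧ ∃ f, OnCeiling h (Z f)

/-- **`BiAnchoredStep A h`** — the new content of the step at height `h` (sketch (D7)(F)): in every static `G₁`-closed support in `◇_h` every BI-ANCHORED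
cell obeys the law (instrument: the bi-anchored `L**`-violators die using ONLY each other, ◇₄ 1420∕1420, ◇₆ 12778∕12778). -/
def BiAnchoredStep (A : CellLaw) (h : ℤ) : Prop :=
  ∀ C : MConfig, C.InDiamond h → C.G1Closed → C.StaticH1 →
    (∀ Z ∈ C.lower, BiAnchored h Z → A h false Z) ∧ ∀ P ∈ C.upper, BiAnchored h P → A h true P

/-- **`Transport A h`** — the lifting half (sketch (D7)(U), §10′ (T2), §13 (M4)): confinement below `h` plus the bi-anchored law at `h` give confinement at
`h`.  NOT restriction (sub-supports are not rule-D closed) but relativised engines; open. -/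
def Transport (A : CellLaw) (h : ℤ) : Prop := Confined A (h - 2) → BiAnchoredStep A h → Confined A h

/-- the full-span step implies the bi-anchored step (a bi-anchored cell makes the support full-span). -/
theorem biAnchoredStep_of_step {A : CellLaw} {h : ℤ} (H : ConfinedStep A h) : BiAnchoredStep A h := by
  intro C hU hG hS
  refine ⟨fun Z hZ hB => ?_, fun P hP hB => ?_⟩
  · obtain ⟨⟨f, hf⟩, g, hg⟩ := hB
    exact (H C hU hG hS (Or.inl ⟨Z, hZ, f, hf⟩) (Or.inl ⟨Z, hZ, g, hg⟩)).1 Z hZ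
  · obtain ⟨⟨f, hf⟩, g, hg⟩ := hB
    exact (H C hU hG hS (Or.inr ⟨P, hP, f, hf⟩) (Or.inr ⟨P, hP, g, hg⟩)).2 P hP

/-- confinement at `h` gives the bi-anchored step at `h` trivially. -/
theorem biAnchoredStep_of_confined {A : CellLaw} {h : ℤ} (H : Confined A h) : BiAnchoredStep A h :=
  biAnchoredStep_of_step (step_of_confined H)

/-- **bi-anchored induction**: base at `2`, and for every even `h ≥ 4` the bi-anchored step together with transport, give confinement at every
even height — for ANY law (admissibility is not even needed here: it is hidden inside whoever proves `Transport`). -/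
theorem confined_of_biAnchored {A : CellLaw} (base : Confined A 2)
    (bi : ∀ k : ℕ, 2 ≤ k → BiAnchoredStep A (2 * (k : ℤ))) (tr : ∀ k : ℕ, 2 ≤ k → Transport A (2 * (k : ℤ))) :
    ∀ n : ℕ, 1 ≤ n → Confined A (2 * (n : ℤ)) := by
  intro n hn
  induction n with
  | zero => omega
  | succ m ih =>
    rcases Nat.lt_or_ge m 1 with hm | hm
    · have hm0 : m = 0 := by omega
      subst hm0; simpa using base
    · have e : (2 * ((m + 1 : ℕ) : ℤ)) - 2 = 2 * (m : ℤ) := by push_cast; ring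
      have ihm : Confined A (2 * ((m + 1 : ℕ) : ℤ) - 2) := by rw [e]; exact ih hm
      exact tr (m + 1) (by omega) ihm (bi (m + 1) (by omega))

/-- … and hence, for `L*₂`, line confinement at every height and the ceiling-free cone statement. -/
theorem coneLineConfinement_of_biAnchored (base : Confined lawS2 2)
    (bi : ∀ k : ℕ, 2 ≤ k → BiAnchoredStep lawS2 (2 * (k : ℤ))) (tr : ∀ k : ℕ, 2 ≤ k → Transport lawS2 (2 * (k : ℤ))) :
    ConeLineConfinement := by
  rw [← lineConfinement_all_iff_cone]
  intro h
  obtain ⟨n, hn1, hn⟩ : ∃ n : ℕ, 1 ≤ n ∧ h ≤ 2 * (n : ℤ) := by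
    refine ⟨(Int.toNat h) + 1, by omega, ?_⟩
    have := Int.self_le_toNat h
    push_cast; omega
  have H2n : LineConfinement (2 * (n : ℤ)) := lineConfinement_of_confined_lawS2 (confined_of_biAnchored base bi tr n hn1)
  exact fun C hU hG hS => H2n C ⟨fun Z hZ f => inDiamond_mono hn (hU.1 Z hZ f), fun P hP f => inDiamond_mono hn (hU.2 P hP f)⟩ hG hS

/-- **`L*_P`** — the minimal load-bearing law found by the instrument (sketch (D6)): line confinement ∧ the charge ladder on P-cells only («a thick P-cell
with `q` charged letters has every charged letter at node level `≥ 2(q-1)`»).  NOT asserted. -/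
def lawSP : CellLaw := fun h b Z => lcLaw h b Z ∧ (b = true → chargeLadderLaw h b Z)

theorem lawSP_admissible : Admissible lawSP where
  mono := fun _ _ _ H => H
  boost := fun h b Z H => ⟨lcLaw_admissible.boost h b Z H.1, fun hb => chargeLadderLaw_admissible.boost h b Z (H.2 hb)⟩

theorem lineConfinement_of_confined_lawSP {h : ℤ} (H : Confined lawSP h) : LineConfinement h :=
  (confined_lcLaw_iff h).mp (confined_mono_law (fun _ _ hZ => hZ.1) H)

/-- the bi-anchored induction for `L*_P`: base, bi-anchored steps and transport at every even `h ≥ 4` ⇒ `ConeLineConfinement`. -/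
theorem coneLineConfinement_of_biAnchored_lawSP (base : Confined lawSP 2)
    (bi : ∀ k : ℕ, 2 ≤ k → BiAnchoredStep lawSP (2 * (k : ℤ))) (tr : ∀ k : ℕ, 2 ≤ k → Transport lawSP (2 * (k : ℤ))) :
    ConeLineConfinement := by
  rw [← lineConfinement_all_iff_cone]
  intro h
  obtain ⟨n, hn1, hn⟩ : ∃ n : ℕ, 1 ≤ n ∧ h ≤ 2 * (n : ℤ) := by
    refine ⟨(Int.toNat h) + 1, by omega, ?_⟩
    have := Int.self_le_toNat h
    push_cast; omega
  have H2n : LineConfinement (2 * (n : ℤ)) := lineConfinement_of_confined_lawSP (confined_of_biAnchored base bi tr n hn1)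
  exact fun C hU hG hS => H2n C ⟨fun Z hZ f => inDiamond_mono hn (hU.1 Z hZ f), fun P hP f => inDiamond_mono hn (hU.2 P hP f)⟩ hG hS

/-- … or, with full-span steps instead (the v1 architecture) for `L*_P`. -/
theorem coneLineConfinement_of_lawSP_steps (base : Confined lawSP 2)
    (steps : ∀ k : ℕ, 2 ≤ k → ConfinedStep lawSP (2 * (k : ℤ))) : ConeLineConfinement := by
  rw [← lineConfinement_all_iff_cone]
  intro h
  obtain ⟨n, hn1, hn⟩ : ∃ n : ℕ, 1 ≤ n ∧ h ≤ 2 * (n : ℤ) := by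
    refine ⟨(Int.toNat h) + 1, by omega, ?_⟩
    have := Int.self_le_toNat h
    push_cast; omega
  have H2n : LineConfinement (2 * (n : ℤ)) :=
    lineConfinement_of_confined_lawSP (confined_of_steps lawSP_admissible base steps n hn1)
  exact fun C hU hG hS => H2n C ⟨fun Z hZ f => inDiamond_mono hn (hU.1 Z hZ f), fun P hP f => inDiamond_mono hn (hU.2 P hP f)⟩ hG hS

/-! ## §9 (v1.3) The THREE-CHARGE CORE of the bi-anchored step (sketch (D9)) — typed, NOT asserted

Instrument: the three-charged bi-anchored violators `F₃(h)` die using ONLY each other (◇₄ 506∕506 rounds [97, 251, 140, 18]; ◇₆ 4128∕4128) and GIVEN `F₃`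
absent every other bi-anchored violator dies in ROUND ONE: `BiAnchoredStep ↔ CoreStep ∧ Saturation` (`biAnchoredStep_iff_core`). -/

/-- a THREE-CHARGED cell: exactly three charged letters (one apex letter). -/
abbrev ThreeCharged (Z : MCell) : Prop := chargedCount Z = 3

/-- **`CoreStep A h`** (T1-core): in every static `G₁`-closed support in `◇_h`, every bi-anchored THREE-CHARGED cell obeys the law.  NOT asserted. -/
def CoreStep (A : CellLaw) (h : ℤ) : Prop :=
  ∀ C : MConfig, C.InDiamond h → C.G1Closed → C.StaticH1 →
    (∀ Z ∈ C.lower, BiAnchored h Z → ThreeCharged Z → A h false Z) ∧ ∀ P ∈ C.upper, BiAnchored h P → ThreeCharged P → A h true P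

/-- **`Saturation A h`** (T1-sat): in a static `G₁`-closed support in `◇_h`, if every bi-anchored three-charged cell obeys the law then every
bi-anchored cell does.  (Instrument: one round of rule-D unit propagation from «no `F₃(h)`», see the section docstring.)  NOT asserted. -/
def Saturation (A : CellLaw) (h : ℤ) : Prop :=
  ∀ C : MConfig, C.InDiamond h → C.G1Closed → C.StaticH1 →
    ((∀ Z ∈ C.lower, BiAnchored h Z → ThreeCharged Z → A h false Z) ∧ ∀ P ∈ C.upper, BiAnchored h P → ThreeCharged P → A h true P) →
    (∀ Z ∈ C.lower, BiAnchored h Z → A h false Z) ∧ ∀ P ∈ C.upper, BiAnchored h P → A h true P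

/-- core + saturation ⇒ the bi-anchored step. -/
theorem biAnchoredStep_of_core {A : CellLaw} {h : ℤ} (core : CoreStep A h) (sat : Saturation A h) : BiAnchoredStep A h :=
  fun C hU hG hS => sat C hU hG hS (core C hU hG hS)

/-- … and conversely the bi-anchored step gives both (so the factorisation loses nothing). -/
theorem biAnchoredStep_iff_core {A : CellLaw} {h : ℤ} : BiAnchoredStep A h ↔ CoreStep A h ∧ Saturation A h :=
  ⟨fun H => ⟨fun C hU hG hS => ⟨fun Z hZ hB _ => (H C hU hG hS).1 Z hZ hB, fun P hP hB _ => (H C hU hG hS).2 P hP hB⟩,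
    fun C hU hG hS _ => H C hU hG hS⟩, fun H => biAnchoredStep_of_core H.1 H.2⟩

/-- the induction of §8 with the core factorisation: base + (core, saturation, transport at every even `h ≥ 4`) ⇒ confinement at every even height. -/
theorem confined_of_core {A : CellLaw} (base : Confined A 2)
    (core : ∀ k : ℕ, 2 ≤ k → CoreStep A (2 * (k : ℤ))) (sat : ∀ k : ℕ, 2 ≤ k → Saturation A (2 * (k : ℤ)))
    (tr : ∀ k : ℕ, 2 ≤ k → Transport A (2 * (k : ℤ))) : ∀ n : ℕ, 1 ≤ n → Confined A (2 * (n : ℤ)) :=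
  confined_of_biAnchored base (fun k hk => biAnchoredStep_of_core (core k hk) (sat k hk)) tr

/-- for `L*_P`: base + core + saturation + transport ⇒ `ConeLineConfinement`. -/
theorem coneLineConfinement_of_core_lawSP (base : Confined lawSP 2)
    (core : ∀ k : ℕ, 2 ≤ k → CoreStep lawSP (2 * (k : ℤ))) (sat : ∀ k : ℕ, 2 ≤ k → Saturation lawSP (2 * (k : ℤ)))
    (tr : ∀ k : ℕ, 2 ≤ k → Transport lawSP (2 * (k : ℤ))) : ConeLineConfinement :=
  coneLineConfinement_of_biAnchored_lawSP base (fun k hk => biAnchoredStep_of_core (core k hk) (sat k hk)) tr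

/-- (v1.7) the same for `L**` = `lawSS` (the law the factorisation numbers were measured for). -/
theorem coneLineConfinement_of_biAnchored_lawSS (base : Confined lawSS 2)
    (bi : ∀ k : ℕ, 2 ≤ k → BiAnchoredStep lawSS (2 * (k : ℤ))) (tr : ∀ k : ℕ, 2 ≤ k → Transport lawSS (2 * (k : ℤ))) :
    ConeLineConfinement := by
  rw [← lineConfinement_all_iff_cone]
  intro h
  obtain ⟨n, hn1, hn⟩ : ∃ n : ℕ, 1 ≤ n ∧ h ≤ 2 * (n : ℤ) := by
    refine ⟨(Int.toNat h) + 1, by omega, ?_⟩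
    have := Int.self_le_toNat h
    push_cast; omega
  have H2n : LineConfinement (2 * (n : ℤ)) := lineConfinement_of_confined_lawSS (confined_of_biAnchored base bi tr n hn1)
  exact fun C hU hG hS => H2n C ⟨fun Z hZ f => inDiamond_mono hn (hU.1 Z hZ f), fun P hP f => inDiamond_mono hn (hU.2 P hP f)⟩ hG hS

theorem coneLineConfinement_of_core_lawSS (base : Confined lawSS 2)
    (core : ∀ k : ℕ, 2 ≤ k → CoreStep lawSS (2 * (k : ℤ))) (sat : ∀ k : ℕ, 2 ≤ k → Saturation lawSS (2 * (k : ℤ)))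
    (tr : ∀ k : ℕ, 2 ≤ k → Transport lawSS (2 * (k : ℤ))) : ConeLineConfinement :=
  coneLineConfinement_of_biAnchored_lawSS base (fun k hk => biAnchoredStep_of_core (core k hk) (sat k hk)) tr

/-- the LC-CORE: the part of the core hypothesis of `Saturation A h` that the class theorems of §12 consume — for `A = lawSS` and `A = lawSP` alike
(`lawSS h b Z → lcLaw h b Z`, `lawSP h b Z → lcLaw h b Z`). -/
theorem lcCore_of_lawSS {h : ℤ} {C : MConfig}
    (H : (∀ Z ∈ C.lower, BiAnchored h Z → ThreeCharged Z → lawSS h false Z) ∧ ∀ P ∈ C.upper, BiAnchored h P → ThreeCharged P → lawSS h true P) :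
    (∀ Z ∈ C.lower, BiAnchored h Z → ThreeCharged Z → lcLaw h false Z) ∧ ∀ P ∈ C.upper, BiAnchored h P → ThreeCharged P → lcLaw h true P :=
  ⟨fun Z hZ hB h3 => (H.1 Z hZ hB h3).1, fun P hP hB h3 => (H.2 P hP hB h3).1⟩

theorem lcCore_of_lawSP {h : ℤ} {C : MConfig}
    (H : (∀ Z ∈ C.lower, BiAnchored h Z → ThreeCharged Z → lawSP h false Z) ∧ ∀ P ∈ C.upper, BiAnchored h P → ThreeCharged P → lawSP h true P) :
    (∀ Z ∈ C.lower, BiAnchored h Z → ThreeCharged Z → lcLaw h false Z) ∧ ∀ P ∈ C.upper, BiAnchored h P → ThreeCharged P → lcLaw h true P :=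
  ⟨fun Z hZ hB h3 => (H.1 Z hZ hB h3).1, fun P hP hB h3 => (H.2 P hP hB h3).1⟩


/-! ## §10 (v1.4) The CEILING and FLOOR SERVICE LEMMAS (PROVED, h-uniform)

Inside `◇_h` a CEILING letter can only be DISCHARGED along its own ray (staying on the ceiling; an apex on the ceiling has no service above), a FLOOR
letter is reached only from the smaller floor letters of its ray. -/

/-- signed-charge shift of a ray move: directions `0, 1` raise `chargeOf` by `e`, directions `2, 3` lower it by `e`. -/
theorem chargeOf_ray (x : BPoint) (k : Fin 4) (e : ℤ) :
    chargeOf (ray x k e) = chargeOf x + (![1, 1, -1, -1] k) * e := by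
  fin_cases k <;> simp [chargeOf] <;> ring

theorem ray_fst (x : BPoint) (k : Fin 4) (e : ℤ) : (ray x k e).1 = x.1 + e := rfl

/-- the arithmetic core: on the ceiling, a forward ray move that stays under the ceiling must LOWER the charge by exactly `e`. -/
theorem abs_ceiling_core {A q s e h : ℤ} (he : 0 < e) (hs : s = 1 ∨ s = -1) (hc : A + |q| = h)
    (hle : A + e + |q + s * e| ≤ h) : e ≤ |q| ∧ A + e + |q + s * e| = h ∧ |q + s * e| = |q| - e := by
  rcases abs_cases q with ⟨h1, h2⟩ | ⟨h1, h2⟩ <;> rcases abs_cases (q + s * e) with ⟨h3, h4⟩ | ⟨h3, h4⟩ <;>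
    rcases hs with rfl | rfl <;> omega

/-- **CEILING SERVICE LEMMA (h-uniform)**: a ceiling letter `x` moved forward along a null ray (`ray x k e`, `e > 0`) stays in `◇_h` only if `x` has charge
`c ≥ e` and the move is a discharge by `e`, landing on the ceiling again. -/
theorem ceiling_service {h : ℤ} {x : BPoint} (hc : OnCeiling h x) {k : Fin 4} {e : ℤ} (he : 0 < e)
    (hy : InDiamond h (ray x k e)) :
    e ≤ absCharge x ∧ OnCeiling h (ray x k e) ∧ absCharge (ray x k e) = absCharge x - e := by
  have hle := hy.2.2.2
  simp only [OnCeiling, absCharge, chargeOf_ray] at *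
  have hs : (![1, 1, -1, -1] : Fin 4 → ℤ) k = 1 ∨ (![1, 1, -1, -1] : Fin 4 → ℤ) k = -1 := by
    fin_cases k <;> simp
  exact abs_ceiling_core he hs hc hle

/-- the arithmetic core at the floor. -/
theorem abs_floor_core {Y q s e : ℤ} (he : 0 < e) (hs : s = 1 ∨ s = -1) (hf : Y + e = |q + s * e|) (hle : |q| ≤ Y) :
    e ≤ |q + s * e| ∧ Y = |q| ∧ |q| = |q + s * e| - e := by
  rcases abs_cases q with ⟨h1, h2⟩ | ⟨h1, h2⟩ <;> rcases abs_cases (q + s * e) with ⟨h3, h4⟩ | ⟨h3, h4⟩ <;>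
    rcases hs with rfl | rfl <;> omega

/-- the same at the FLOOR: if `x = ray y k e` (`e > 0`) is a floor letter and `y ∈ ◇_h`, then `y` is the floor letter of charge `c - e` on the same
ray (the origin has no service below). -/
theorem floor_service {h : ℤ} {x y : BPoint} (hf : OnFloor x) {k : Fin 4} {e : ℤ} (he : 0 < e) (hxy : x = ray y k e)
    (hy : InDiamond h y) :
    e ≤ absCharge x ∧ OnFloor y ∧ absCharge y = absCharge x - e := by
  subst hxy
  simp only [OnFloor, absCharge, chargeOf_ray] at *
  have hs : (![1, 1, -1, -1] : Fin 4 → ℤ) k = 1 ∨ (![1, 1, -1, -1] : Fin 4 → ℤ) k = -1 := by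
    fin_cases k <;> simp
  exact abs_floor_core he hs hf hy.2.1


/-! ## §11 (v1.5) THE CEILING ∕ FLOOR ENGINES of RULE D inside `◇_h` (PROVED, h-uniform)

`ceiling(_unit)_move` ∕ `floor(_unit)_move`; `settledAbove_of_ceiling`: the own coordinate of a charged ceiling letter of a `P`-cell is STUCK, so every adapted
coordinate `≠ h` elsewhere is SettledAbove; dually `settledBelow_of_floor`; chain steps `lower_mem_of_two_ceiling'` ∕ `upper_mem_of_two_floor'`. -/

/-- a charge-1 CEILING letter of phase `k`: `(h-2)·I + ℓ_{i^k}` = `ray (h-2, 0, 0) k 1`. Any forward ray move of it that stays in `◇_h`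
is the unit discharge in the antipodal direction, landing on the ceiling apex `h·I`. -/
theorem ceiling_unit_move {h : ℤ} {k r : Fin 4} {e : ℤ} (he : 0 < e)
    (hy : InDiamond h (ray (ray ((h - 2, 0, 0) : BPoint) k 1) r e)) :
    r = k + 2 ∧ e = 1 ∧ ray (ray ((h - 2, 0, 0) : BPoint) k 1) r e = (h, 0, 0) := by
  have hc : OnCeiling h (ray ((h - 2, 0, 0) : BPoint) k 1) := by
    fin_cases k <;> simp [OnCeiling, absCharge, chargeOf] <;> omega
  obtain ⟨hle, -, hdis⟩ := ceiling_service hc he hy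
  have h1 : absCharge (ray ((h - 2, 0, 0) : BPoint) k 1) = 1 := by
    fin_cases k <;> simp [absCharge, chargeOf]
  have he1 : e = 1 := by omega
  subst he1
  rw [h1] at hdis
  have hax := hy.1
  fin_cases k <;> fin_cases r <;> simp [AxisPt, absCharge, chargeOf, Prod.ext_iff] at hax hdis ⊢ <;> omega

/-- a charge-1 FLOOR letter `ℓ_{i^k} = ray O k 1`: the only point of `◇_h` from which a forward ray move reaches it is the origin `O`, along
its own direction, in one step. -/
theorem floor_unit_move {h : ℤ} {k r : Fin 4} {e : ℤ} {y : BPoint} (he : 0 < e)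
    (hxy : ray ((0, 0, 0) : BPoint) k 1 = ray y r e) (hy : InDiamond h y) :
    y = (0, 0, 0) ∧ e = 1 ∧ r = k := by
  have hf : OnFloor (ray ((0, 0, 0) : BPoint) k 1) := by
    fin_cases k <;> simp [OnFloor, absCharge, chargeOf]
  obtain ⟨hle, hfl, hdis⟩ := floor_service hf he hxy hy
  have h1 : absCharge (ray ((0, 0, 0) : BPoint) k 1) = 1 := by
    fin_cases k <;> simp [absCharge, chargeOf]
  have he1 : e = 1 := by omega
  subst he1
  rw [h1] at hdis
  have hax := hy.1
  obtain ⟨a, b1, b2⟩ := y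
  simp only [OnFloor, absCharge, chargeOf, AxisPt] at hfl hdis hax
  have h12 : b1 - b2 = 0 := abs_eq_zero.mp (by simpa using hdis)
  have hb : b1 = 0 ∧ b2 = 0 := by
    rcases hax with h0 | h0 <;> simp [Prod.ext_iff] at h0 <;> omega
  obtain ⟨rfl, rfl⟩ := hb
  have ha : a = 0 := by simpa using hfl
  subst ha
  refine ⟨rfl, rfl, ?_⟩
  fin_cases k <;> fin_cases r <;> simp [Prod.ext_iff] at hxy ⊢

/-- charge of a letter `t·I + c·ℓ_{i^k}`. -/
theorem absCharge_ray_apex (t c : ℤ) (k : Fin 4) (hc : 0 ≤ c) : absCharge (ray ((t, 0, 0) : BPoint) k c) = c := by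
  fin_cases k <;> simp [absCharge, chargeOf, abs_of_nonneg hc]

/-- **forward moves of a CEILING letter inside `◇_h`** (general charge): a letter `t·I + c·ℓ_u` on the ceiling (`t + 2c = h`, `c ≥ 1`) moved forward
`e ≥ 1` steps along a null ray stays in `◇_h` only for the ANTIPODAL direction and `e ≤ c`, landing on the ceiling letter `(t+2e)·I + (c-e)·ℓ_u`. -/
theorem ceiling_move {h t c e : ℤ} {k r : Fin 4} (hc : 1 ≤ c) (hh : t + 2 * c = h) (he : 0 < e)
    (hy : InDiamond h (ray (ray ((t, 0, 0) : BPoint) k c) r e)) :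
    r = k + 2 ∧ e ≤ c ∧ ray (ray ((t, 0, 0) : BPoint) k c) r e = ray ((t + 2 * e, 0, 0) : BPoint) k (c - e) := by
  have hx : absCharge (ray ((t, 0, 0) : BPoint) k c) = c := absCharge_ray_apex t c k (by omega)
  have hceil : OnCeiling h (ray ((t, 0, 0) : BPoint) k c) := by
    show (ray ((t, 0, 0) : BPoint) k c).1 + absCharge (ray ((t, 0, 0) : BPoint) k c) = h
    rw [hx, ray_fst]; simp only; omega
  obtain ⟨hle, -, hdis⟩ := ceiling_service hceil he hy
  rw [hx] at hle hdis
  have hax := hy.1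
  simp only [absCharge] at hdis
  rw [abs_eq (by omega : (0 : ℤ) ≤ c - e)] at hdis
  refine ⟨?_, hle, ?_⟩
  · fin_cases k <;> fin_cases r <;> simp [chargeOf, AxisPt, Prod.ext_iff] at hdis hax ⊢ <;> omega
  · have hr : r = k + 2 := by
      fin_cases k <;> fin_cases r <;> simp [chargeOf, AxisPt, Prod.ext_iff] at hdis hax ⊢ <;> omega
    subst hr
    fin_cases k <;> simp [Prod.ext_iff] <;> ring_nf <;> trivial


/-- the own coordinate of the letter `t·I + c·ℓ_{i^k}` is `t + 2c` (its LINE) … -/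
theorem coord_ray_apex_self (t c : ℤ) (k : Fin 4) : coord (ray ((t, 0, 0) : BPoint) k c) k = t + 2 * c := by
  fin_cases k <;> simp [coord] <;> ring

/-- … and its antipodal coordinate is `t` (its NODE LEVEL). -/
theorem coord_ray_apex_antip (t c : ℤ) (k : Fin 4) : coord (ray ((t, 0, 0) : BPoint) k c) (k + 2) = t := by
  fin_cases k <;> simp [coord]

theorem adapted_ray_apex_self (t c : ℤ) (k : Fin 4) : Adapted (ray ((t, 0, 0) : BPoint) k c) k := by
  fin_cases k <;> simp [Adapted]

theorem adapted_ray_apex_antip (t c : ℤ) (k : Fin 4) : Adapted (ray ((t, 0, 0) : BPoint) k c) (k + 2) := by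
  fin_cases k <;> simp [Adapted]

/-- **THE CEILING ENGINE (PROVED, h-uniform)**: at a rule-D `P`-cell in `◇_h` a CHARGED CEILING letter on `f₀` has its own coordinate STUCK, so every
adapted coordinate of value `≠ h` on every other factor is SETTLED ABOVE. -/
theorem settledAbove_of_ceiling {h : ℤ} {C : MConfig} (hU : C.InDiamond h) {P : MCell} (hD : RuleDMu4P C P)
    {f₀ k₀ : Fin 4} {t c : ℤ} (hc : 1 ≤ c) (hh : t + 2 * c = h) (h0 : P f₀ = ray ((t, 0, 0) : BPoint) k₀ c)
    {g k : Fin 4} (hg : g ≠ f₀) (hadk : Adapted (P g) k) (hne : coord (P g) k ≠ h) : SettledAbove C P g k := by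
  have hstuck : ¬ SettledAbove C P f₀ k₀ := by
    rintro ⟨r, hr, N, hN, -, hlt, hray⟩
    have hy : InDiamond h (ray (P f₀) r ((N f₀).1 - (P f₀).1)) := by rw [← hray]; exact hU.1 N hN f₀
    rw [h0] at hy hlt
    exact hr (ceiling_move hc hh (by rw [h0] at hray; simp at hlt ⊢; omega) hy).1
  have hnocov : ∀ j k', ¬ CoveredAbove C P f₀ k₀ j k' := by
    rintro j k' ⟨a, b, hdir, -, N, hN, -, hlt, hra, -⟩
    have hy : InDiamond h (ray (P f₀) a ((N f₀).1 - (P f₀).1)) := by rw [← hra]; exact hU.1 N hN f₀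
    rw [h0] at hy hlt
    have ha := (ceiling_move hc hh (by rw [h0] at hra; simp at hlt ⊢; omega) hy).1
    rcases hdir with hak | ⟨hapex, -⟩
    · rw [hak] at ha; exact absurd ha (by fin_cases k₀ <;> decide)
    · rw [h0] at hapex
      fin_cases k₀ <;> simp [isApex] at hapex <;> omega
  refine settledAbove_of_stuck hD (by rw [h0]; exact adapted_ray_apex_self t c k₀) hstuck hnocov hg hadk ?_
  rw [h0, coord_ray_apex_self]; rwa [← hh] at hne

/-- **moves INTO a FLOOR letter inside `◇_h`** (general charge): if the floor letter `c·ℓ_u` (`c ≥ 1`) is `e ≥ 1` forward steps along a null ray from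
a point `y ∈ ◇_h`, then the ray is the letter's OWN direction, `e ≤ c`, and `y = (c-e)·ℓ_u` (toward the origin). -/
theorem floor_move {h c e : ℤ} {k r : Fin 4} {y : BPoint} (hc : 1 ≤ c) (he : 0 < e)
    (hxy : ray ((0, 0, 0) : BPoint) k c = ray y r e) (hy : InDiamond h y) :
    r = k ∧ e ≤ c ∧ y = ray ((0, 0, 0) : BPoint) k (c - e) := by
  have hx : absCharge (ray ((0, 0, 0) : BPoint) k c) = c := absCharge_ray_apex 0 c k (by omega)
  have hf : OnFloor (ray ((0, 0, 0) : BPoint) k c) := by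
    show (ray ((0, 0, 0) : BPoint) k c).1 = absCharge (ray ((0, 0, 0) : BPoint) k c)
    rw [hx, ray_fst]; simp
  obtain ⟨hle, hfl, hdis⟩ := floor_service hf he hxy hy
  rw [hx] at hle hdis
  have hax := hy.1
  obtain ⟨a, b1, b2⟩ := y
  simp only [OnFloor, absCharge, chargeOf] at hfl hdis hax
  rw [hdis] at hfl
  rw [abs_eq (by omega : (0 : ℤ) ≤ c - e)] at hdis
  refine ⟨?_, hle, ?_⟩
  · fin_cases k <;> fin_cases r <;> simp [AxisPt, Prod.ext_iff] at hdis hax hxy ⊢ <;> omega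
  · have hr : r = k := by
      fin_cases k <;> fin_cases r <;> simp [AxisPt, Prod.ext_iff] at hdis hax hxy ⊢ <;> omega
    subst hr
    fin_cases r <;> simp [Prod.ext_iff] at hxy ⊢ <;> omega

/-- **THE FLOOR ENGINE (PROVED, h-uniform)** — dual of `settledAbove_of_ceiling`: at an `N`-cell with a CHARGED FLOOR letter on `f₀` every adapted
coordinate of value `≠ 0` on every other factor is SETTLED BELOW. -/
theorem settledBelow_of_floor {h : ℤ} {C : MConfig} (hU : C.InDiamond h) {Z : MCell} (hD : RuleDMu4N C Z)
    {f₀ k₀ : Fin 4} {c : ℤ} (hc : 1 ≤ c) (h0 : Z f₀ = ray ((0, 0, 0) : BPoint) k₀ c)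
    {g k : Fin 4} (hg : g ≠ f₀) (hadk : Adapted (Z g) k) (hne : coord (Z g) k ≠ 0) : SettledBelow C Z g k := by
  have hstuck : ¬ SettledBelow C Z f₀ (k₀ + 2) := by
    rintro ⟨r, hr, P, hP, -, hlt, hray⟩
    rw [h0] at hray hlt
    have := (floor_move hc (by simp at hlt ⊢; omega) hray (hU.2 P hP f₀)).1
    subst this
    exact hr (by fin_cases r <;> decide)
  have hnocov : ∀ j k', ¬ CoveredBelow C Z f₀ (k₀ + 2) j k' := by
    rintro j k' ⟨a, b, hdir, -, P, hP, -, hlt, hra, -⟩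
    rw [h0] at hra hlt
    have ha := (floor_move hc (by simp at hlt ⊢; omega) hra (hU.2 P hP f₀)).1
    rcases hdir with hak | ⟨hapex, -⟩
    · rw [hak] at ha; exact absurd ha (by fin_cases k₀ <;> decide)
    · rw [h0] at hapex
      fin_cases k₀ <;> simp [isApex] at hapex <;> omega
  refine settledBelow_of_stuck hD (by rw [h0]; exact adapted_ray_apex_antip 0 c k₀) hstuck hnocov hg hadk ?_
  rw [h0, coord_ray_apex_antip]; exact hne


/-- **chain step above (PROVED, h-uniform)**: two charged CEILING letters (f₀, f₁) of a `P`-cell force an `N`-cell equal to `P` with the SECOND letter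
discharged by some `1 ≤ e ≤ c₁`. -/
theorem lower_mem_of_two_ceiling' {h : ℤ} {C : MConfig} (hU : C.InDiamond h) {P : MCell} (hD : RuleDMu4P C P)
    {f₀ f₁ k₀ k₁ : Fin 4} (hf : f₀ ≠ f₁) {t₀ c₀ t₁ c₁ : ℤ} (hc₀ : 1 ≤ c₀) (hh₀ : t₀ + 2 * c₀ = h) (hc₁ : 1 ≤ c₁) (hh₁ : t₁ + 2 * c₁ = h)
    (h0 : P f₀ = ray ((t₀, 0, 0) : BPoint) k₀ c₀) (h1 : P f₁ = ray ((t₁, 0, 0) : BPoint) k₁ c₁) :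
    ∃ e, 1 ≤ e ∧ e ≤ c₁ ∧ Function.update P f₁ (ray ((t₁ + 2 * e, 0, 0) : BPoint) k₁ (c₁ - e)) ∈ C.lower := by
  have hne : coord (P f₁) (k₁ + 2) ≠ h := by rw [h1, coord_ray_apex_antip]; omega
  obtain ⟨r, -, N, hN, hagree, hlt, hray⟩ :=
    settledAbove_of_ceiling hU hD hc₀ hh₀ h0 (Ne.symm hf) (by rw [h1]; exact adapted_ray_apex_antip t₁ c₁ k₁) hne
  have hy : InDiamond h (ray (P f₁) r ((N f₁).1 - (P f₁).1)) := by rw [← hray]; exact hU.1 N hN f₁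
  rw [h1] at hy hlt
  have he : 0 < (N f₁).1 - (ray ((t₁, 0, 0) : BPoint) k₁ c₁).1 := by simp at hlt ⊢; omega
  obtain ⟨-, hle, hpt⟩ := ceiling_move hc₁ hh₁ he hy
  refine ⟨(N f₁).1 - (ray ((t₁, 0, 0) : BPoint) k₁ c₁).1, by omega, hle, ?_⟩
  have hNeq : N = Function.update P f₁ (ray ((t₁ + 2 * ((N f₁).1 - (ray ((t₁, 0, 0) : BPoint) k₁ c₁).1), 0, 0) : BPoint) k₁
      (c₁ - ((N f₁).1 - (ray ((t₁, 0, 0) : BPoint) k₁ c₁).1))) := by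
    funext g
    by_cases hg : g = f₁
    · subst hg; rw [Function.update_self, ← hpt, ← h1]; nth_rewrite 1 [hray]; rw [h1]
    · rw [Function.update_of_ne hg]; exact (hagree g hg).symm
  rw [← hNeq]; exact hN

/-- **chain step below (PROVED, h-uniform)**: two charged FLOOR letters `c₀·ℓ_u` (f₀), `c₁·ℓ_v` (f₁ ≠ f₀) of an `N`-cell force a `P`-cell equal to `Z`
with the SECOND letter moved toward the origin by some `1 ≤ e ≤ c₁`. -/
theorem upper_mem_of_two_floor' {h : ℤ} {C : MConfig} (hU : C.InDiamond h) {Z : MCell} (hD : RuleDMu4N C Z)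
    {f₀ f₁ k₀ k₁ : Fin 4} (hf : f₀ ≠ f₁) {c₀ c₁ : ℤ} (hc₀ : 1 ≤ c₀) (hc₁ : 1 ≤ c₁)
    (h0 : Z f₀ = ray ((0, 0, 0) : BPoint) k₀ c₀) (h1 : Z f₁ = ray ((0, 0, 0) : BPoint) k₁ c₁) :
    ∃ e, 1 ≤ e ∧ e ≤ c₁ ∧ Function.update Z f₁ (ray ((0, 0, 0) : BPoint) k₁ (c₁ - e)) ∈ C.upper := by
  have hne : coord (Z f₁) k₁ ≠ 0 := by rw [h1, coord_ray_apex_self]; omega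
  obtain ⟨r, -, P, hP, hagree, hlt, hray⟩ :=
    settledBelow_of_floor hU hD hc₀ h0 (Ne.symm hf) (by rw [h1]; exact adapted_ray_apex_self 0 c₁ k₁) hne
  rw [h1] at hray hlt
  have he : 0 < (ray ((0, 0, 0) : BPoint) k₁ c₁).1 - (P f₁).1 := by simp at hlt ⊢; omega
  obtain ⟨-, hle, hpt⟩ := floor_move hc₁ he hray (hU.2 P hP f₁)
  refine ⟨(ray ((0, 0, 0) : BPoint) k₁ c₁).1 - (P f₁).1, by omega, hle, ?_⟩
  have hPeq : P = Function.update Z f₁ (ray ((0, 0, 0) : BPoint) k₁ (c₁ - ((ray ((0, 0, 0) : BPoint) k₁ c₁).1 - (P f₁).1))) := by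
    funext g
    by_cases hg : g = f₁
    · subst hg; rw [Function.update_self]; exact hpt
    · rw [Function.update_of_ne hg]; exact hagree g hg
  rw [← hPeq]; exact hP


/-! ## §12 (v1.5) One-clause anchor classes (PROVED, h-uniform)

A UNIT ceiling letter next to a charged ceiling letter (P), dually a unit floor letter next to a charged floor letter (N), forces the three-charged discharge
(`lower_mem_of_unit_ceiling` ∕ `upper_mem_of_unit_floor`); an APEX next to a charged anchor letter must be served and every service charges it
(`lower_mem_of_ceiling_apex` ∕ `upper_mem_of_floor_apex`). -/

/-- **forcing at a UNIT ceiling letter (PROVED, h-uniform)**: a charged CEILING letter (f₀) and a UNIT ceiling letter `(h-2)·I + ℓ_v` (f₁) of a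
`P`-cell force the `N`-cell with the unit letter discharged to `h·I`. -/
theorem lower_mem_of_unit_ceiling {h : ℤ} {C : MConfig} (hU : C.InDiamond h) {P : MCell} (hD : RuleDMu4P C P)
    {f₀ f₁ k₀ k₁ : Fin 4} (hf : f₀ ≠ f₁) {t₀ c₀ : ℤ} (hc₀ : 1 ≤ c₀) (hh₀ : t₀ + 2 * c₀ = h)
    (h0 : P f₀ = ray ((t₀, 0, 0) : BPoint) k₀ c₀) (h1 : P f₁ = ray ((h - 2, 0, 0) : BPoint) k₁ 1) :
    Function.update P f₁ ((h, 0, 0) : BPoint) ∈ C.lower := by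
  have hne : coord (P f₁) (k₁ + 2) ≠ h := by rw [h1, coord_ray_apex_antip]; omega
  obtain ⟨r, -, N, hN, hagree, hlt, hray⟩ :=
    settledAbove_of_ceiling hU hD hc₀ hh₀ h0 (Ne.symm hf) (by rw [h1]; exact adapted_ray_apex_antip (h - 2) 1 k₁) hne
  have hy : InDiamond h (ray (P f₁) r ((N f₁).1 - (P f₁).1)) := by rw [← hray]; exact hU.1 N hN f₁
  rw [h1] at hy hlt
  obtain ⟨-, -, hpt⟩ := ceiling_unit_move (by rw [h1] at hray; simp at hlt ⊢; omega) hy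
  have hNf : N f₁ = (h, 0, 0) := by rw [hray, h1]; exact hpt
  have hNeq : N = Function.update P f₁ ((h, 0, 0) : BPoint) := by
    funext g
    by_cases hg : g = f₁
    · subst hg; simp [hNf]
    · rw [Function.update_of_ne hg]; exact (hagree g hg).symm
  rw [← hNeq]; exact hN

/-- **forcing at a UNIT floor letter (PROVED, h-uniform)**: a charged FLOOR letter `c₀·ℓ_u` (f₀) and a UNIT floor letter `ℓ_v` (f₁ ≠ f₀) of an `N`-cell
force the `P`-cell with the unit letter replaced by the origin `O`. -/
theorem upper_mem_of_unit_floor {h : ℤ} {C : MConfig} (hU : C.InDiamond h) {Z : MCell} (hD : RuleDMu4N C Z)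
    {f₀ f₁ k₀ k₁ : Fin 4} (hf : f₀ ≠ f₁) {c₀ : ℤ} (hc₀ : 1 ≤ c₀)
    (h0 : Z f₀ = ray ((0, 0, 0) : BPoint) k₀ c₀) (h1 : Z f₁ = ray ((0, 0, 0) : BPoint) k₁ 1) :
    Function.update Z f₁ ((0, 0, 0) : BPoint) ∈ C.upper := by
  have hne : coord (Z f₁) k₁ ≠ 0 := by rw [h1, coord_ray_apex_self]; omega
  obtain ⟨r, -, P, hP, hagree, hlt, hray⟩ :=
    settledBelow_of_floor hU hD hc₀ h0 (Ne.symm hf) (by rw [h1]; exact adapted_ray_apex_self 0 1 k₁) hne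
  rw [h1] at hray hlt
  obtain ⟨hpt, -, -⟩ := floor_unit_move (by simp at hlt ⊢; omega) hray (hU.2 P hP f₁)
  have hPeq : P = Function.update Z f₁ ((0, 0, 0) : BPoint) := by
    funext g
    by_cases hg : g = f₁
    · subst hg; simp [hpt]
    · rw [Function.update_of_ne hg]; exact hagree g hg
  rw [← hPeq]; exact hP

/-- replacing one letter of a fully charged cell by an apex leaves exactly three charged letters. -/
theorem threeCharged_update_apex {P : MCell} (hch : ∀ f, (P f).2 ≠ (0, 0)) (f₁ : Fin 4) (t : ℤ) :
    ThreeCharged (Function.update P f₁ ((t, 0, 0) : BPoint)) := by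
  dsimp only [ThreeCharged, chargedCount]
  have hs : (univ.filter fun f : Fin 4 => (Function.update P f₁ ((t, 0, 0) : BPoint) f).2 ≠ (0, 0)) = univ.erase f₁ := by
    ext g
    by_cases hg : g = f₁
    · subst hg; simp
    · simp [hch g, hg]
  rw [hs, card_erase_of_mem (mem_univ _)]; simp

/-- **CLASS «a unit ceiling letter next to a charged ceiling letter» (PROVED ∀ h)**: under the `N`-core (`lawSP` on bi-anchored three-charged `N`-cells) no
fully charged `P`-cell has a charged ceiling letter, a unit ceiling letter and a floor letter below the ceiling line. -/
theorem saturation_unit_ceiling {h : ℤ} {C : MConfig} (hU : C.InDiamond h) (hS : C.StaticH1)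
    (core : ∀ Z ∈ C.lower, BiAnchored h Z → ThreeCharged Z → lcLaw h false Z)
    {P : MCell} (hP : P ∈ C.upper) (hch : ∀ f, (P f).2 ≠ (0, 0))
    {f₀ f₁ f₂ k₀ k₁ : Fin 4} (hf : f₀ ≠ f₁) (hf₂ : f₂ ≠ f₁) {t₀ c₀ : ℤ} (hc₀ : 1 ≤ c₀) (hh₀ : t₀ + 2 * c₀ = h)
    (h0 : P f₀ = ray ((t₀, 0, 0) : BPoint) k₀ c₀) (h1 : P f₁ = ray ((h - 2, 0, 0) : BPoint) k₁ 1)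
    (hfl : OnFloor (P f₂)) (hlow : (P f₂).1 + absCharge (P f₂) < h) : False := by
  have hmem : Function.update P f₁ ((h, 0, 0) : BPoint) ∈ C.lower := lower_mem_of_unit_ceiling hU (hS.1.2 P hP) hf hc₀ hh₀ h0 h1
  have hB : BiAnchored h (Function.update P f₁ ((h, 0, 0) : BPoint)) :=
    ⟨⟨f₂, by rw [Function.update_of_ne hf₂]; exact hfl⟩, ⟨f₁, by simp [OnCeiling, absCharge, chargeOf]⟩⟩
  have h3 : ThreeCharged (Function.update P f₁ ((h, 0, 0) : BPoint)) := threeCharged_update_apex hch f₁ h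
  have hl : lcLaw h false (Function.update P f₁ ((h, 0, 0) : BPoint)) := core _ hmem hB h3
  have hthin : ¬ ThinCell (Function.update P f₁ ((h, 0, 0) : BPoint)) := by
    dsimp only [ThinCell]; rw [h3]; decide
  have e := ((hl hthin) f₁).trans ((hl hthin) f₂).symm
  simp [Function.update_of_ne hf₂, absCharge, chargeOf] at e
  simp only [absCharge, chargeOf] at hlow
  omega

/-- **`Saturation A h` (lc-core), dual CLASS «a unit floor letter next to a charged floor letter» — PROVED for every `h > 0`.** -/
theorem saturation_unit_floor {h : ℤ} {C : MConfig} (hU : C.InDiamond h) (hS : C.StaticH1) (hpos : 0 < h)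
    (core : ∀ P ∈ C.upper, BiAnchored h P → ThreeCharged P → lcLaw h true P)
    {Z : MCell} (hZ : Z ∈ C.lower) (hch : ∀ f, (Z f).2 ≠ (0, 0))
    {f₀ f₁ f₂ k₀ k₁ : Fin 4} (hf : f₀ ≠ f₁) (hf₂ : f₂ ≠ f₁) {c₀ : ℤ} (hc₀ : 1 ≤ c₀)
    (h0 : Z f₀ = ray ((0, 0, 0) : BPoint) k₀ c₀) (h1 : Z f₁ = ray ((0, 0, 0) : BPoint) k₁ 1)
    (hcl : OnCeiling h (Z f₂)) : False := by
  have hmem : Function.update Z f₁ ((0, 0, 0) : BPoint) ∈ C.upper := upper_mem_of_unit_floor hU (hS.1.1 Z hZ) hf hc₀ h0 h1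
  have hB : BiAnchored h (Function.update Z f₁ ((0, 0, 0) : BPoint)) :=
    ⟨⟨f₁, by simp [OnFloor, absCharge, chargeOf]⟩, ⟨f₂, by rw [Function.update_of_ne hf₂]; exact hcl⟩⟩
  have h3 : ThreeCharged (Function.update Z f₁ ((0, 0, 0) : BPoint)) := threeCharged_update_apex hch f₁ 0
  have hl : lcLaw h true (Function.update Z f₁ ((0, 0, 0) : BPoint)) := core _ hmem hB h3
  have hthin : ¬ ThinCell (Function.update Z f₁ ((0, 0, 0) : BPoint)) := by
    dsimp only [ThinCell]; rw [h3]; decide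
  have e := ((hl hthin) f₁).trans ((hl hthin) f₂).symm
  simp [Function.update_of_ne hf₂, absCharge, chargeOf] at e
  simp only [OnCeiling, absCharge, chargeOf] at hcl
  omega


/-- charging an apex letter raises the charged count by one. -/
theorem chargedCount_update_charged {P : MCell} {f₁ : Fin 4} (hap : (P f₁).2 = (0, 0)) {x : BPoint} (hx : x.2 ≠ (0, 0)) :
    chargedCount (Function.update P f₁ x) = chargedCount P + 1 := by
  dsimp only [chargedCount]
  have hs : (univ.filter fun f : Fin 4 => (Function.update P f₁ x f).2 ≠ (0, 0)) =
      insert f₁ (univ.filter fun f : Fin 4 => (P f).2 ≠ (0, 0)) := by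
    ext g
    by_cases hg : g = f₁
    · subst hg; simp [hx]
    · simp [hg]
  rw [hs, card_insert_of_notMem (by simp [hap])]

/-- **forcing at an APEX next to a charged ceiling letter (PROVED, h-uniform)**: a charged CEILING letter (f₀) and an APEX `t·I`, `t ≠ h` (f₁) of a
`P`-cell force an `N`-cell equal to `P` with the apex CHARGED (every service of an apex charges it). -/
theorem lower_mem_of_ceiling_apex {h : ℤ} {C : MConfig} (hU : C.InDiamond h) {P : MCell} (hD : RuleDMu4P C P)
    {f₀ f₁ k₀ : Fin 4} (hf : f₀ ≠ f₁) {t₀ c₀ t : ℤ} (hc₀ : 1 ≤ c₀) (hh₀ : t₀ + 2 * c₀ = h)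
    (h0 : P f₀ = ray ((t₀, 0, 0) : BPoint) k₀ c₀) (h1 : P f₁ = (t, 0, 0)) (ht : t ≠ h) :
    ∃ r : Fin 4, ∃ e : ℤ, 1 ≤ e ∧ Function.update P f₁ (ray ((t, 0, 0) : BPoint) r e) ∈ C.lower := by
  obtain ⟨r, -, N, hN, hagree, hlt, hray⟩ := settledAbove_of_ceiling hU hD hc₀ hh₀ h0 (Ne.symm hf)
    (show Adapted (P f₁) 0 by rw [h1]; simp [Adapted]) (by rw [h1]; simpa [coord] using ht)
  rw [h1] at hray hlt
  refine ⟨r, (N f₁).1 - t, by simp at hlt; omega, ?_⟩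
  have hNeq : N = Function.update P f₁ (ray ((t, 0, 0) : BPoint) r ((N f₁).1 - t)) := by
    funext g
    by_cases hg : g = f₁
    · subst hg; rw [Function.update_self]; simpa using hray
    · rw [Function.update_of_ne hg]; exact (hagree g hg).symm
  rw [← hNeq]; exact hN

/-- **CLASS «q = 2 with a charged ceiling letter» (PROVED ∀ h)**: under the core, no `P`-cell with exactly two charged letters (one on the ceiling), an
apex `t·I` (`t ≠ h`), a floor anchor and a further letter off the ceiling line. -/
theorem upper_mem_of_floor_apex {h : ℤ} {C : MConfig} (hU : C.InDiamond h) {Z : MCell} (hD : RuleDMu4N C Z)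
    {f₀ f₁ k₀ : Fin 4} (hf : f₀ ≠ f₁) {c₀ t : ℤ} (hc₀ : 1 ≤ c₀)
    (h0 : Z f₀ = ray ((0, 0, 0) : BPoint) k₀ c₀) (h1 : Z f₁ = (t, 0, 0)) (ht : t ≠ 0) :
    ∃ P ∈ C.upper, ∃ r : Fin 4, ∃ d : ℤ, 1 ≤ d ∧ (∀ g, g ≠ f₁ → P g = Z g) ∧ ray (P f₁) r d = (t, 0, 0) ∧ (P f₁).1 + d = t := by
  obtain ⟨r, -, P, hP, hagree, hlt, hray⟩ := settledBelow_of_floor hU hD hc₀ h0 (Ne.symm hf)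
    (show Adapted (Z f₁) 0 by rw [h1]; simp [Adapted]) (by rw [h1]; simpa [coord] using ht)
  rw [h1] at hray hlt
  refine ⟨P, hP, r, t - (P f₁).1, by simp at hlt; omega, hagree, ?_, by omega⟩
  simpa using hray.symm

/-- the letter `d ≥ 1` null steps below an apex `t·I` is charged with `|charge| = d`. -/
theorem absCharge_of_ray_eq_apex {z : BPoint} {r : Fin 4} {d t : ℤ} (hd : 0 ≤ d) (hz : ray z r d = (t, 0, 0)) : absCharge z = d := by
  obtain ⟨a, b1, b2⟩ := z
  fin_cases r <;> simp [Prod.ext_iff] at hz <;> simp [absCharge, chargeOf] <;>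
    first | (rw [abs_of_nonpos (by omega)]; omega) | (rw [abs_of_nonneg (by omega)]; omega)

/-- **`Saturation A h` (lc-core), dual CLASS «q = 2 with a charged floor letter» — PROVED for every `h`.** -/
theorem ray_ray_self (x : BPoint) (k : Fin 4) (c e : ℤ) : ray (ray x k c) k e = ray x k (c + e) := by
  obtain ⟨a, b1, b2⟩ := x
  fin_cases k <;> refine Prod.ext ?_ (Prod.ext ?_ ?_) <;> simp <;> ring

/-- a forward move of the charged FLOOR letter `c·ℓ_{i^k}` inside `◇_h` in a direction other than the antipode `k + 2` goes along `k` itself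
(off-frame moves leave the axis letters) and keeps the causal height `2(c+e) ≤ h`. -/
theorem floor_charge_move {h c e : ℤ} {k r : Fin 4} (hc : 1 ≤ c) (he : 0 < e) (hr : r ≠ k + 2)
    (hy : InDiamond h (ray (ray ((0, 0, 0) : BPoint) k c) r e)) : r = k ∧ 2 * (c + e) ≤ h := by
  have hax := hy.1
  have hl := hy.2.2.2
  have h1 := le_abs_self (chargeOf (ray (ray ((0, 0, 0) : BPoint) k c) r e))
  have h2 := neg_abs_le (chargeOf (ray (ray ((0, 0, 0) : BPoint) k c) r e))
  simp only [absCharge] at hl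
  fin_cases k <;> fin_cases r <;> simp [AxisPt, chargeOf, Prod.ext_iff] at hax hr hl h1 h2 ⊢ <;> omega

/-- **floor letter charged upward (P side)**: with a charged CEILING letter on `f₀` and a non-corner charged FLOOR letter `c₁·ℓ_v` on `f₁`, the cell
with `f₁ ↦ (c₁+e)·ℓ_v` lies in `C.lower` for some `e ≥ 1`, `2(c₁+e) ≤ h`. -/
theorem lower_mem_of_ceiling_floor {h : ℤ} {C : MConfig} (hU : C.InDiamond h) {P : MCell} (hD : RuleDMu4P C P)
    {f₀ f₁ k₀ k₁ : Fin 4} (hf : f₀ ≠ f₁) {t₀ c₀ c₁ : ℤ} (hc₀ : 1 ≤ c₀) (hh₀ : t₀ + 2 * c₀ = h) (hc₁ : 1 ≤ c₁) (hnc : 2 * c₁ ≠ h)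
    (h0 : P f₀ = ray ((t₀, 0, 0) : BPoint) k₀ c₀) (h1 : P f₁ = ray ((0, 0, 0) : BPoint) k₁ c₁) :
    ∃ e, 1 ≤ e ∧ 2 * (c₁ + e) ≤ h ∧ Function.update P f₁ (ray ((0, 0, 0) : BPoint) k₁ (c₁ + e)) ∈ C.lower := by
  have hne : coord (P f₁) k₁ ≠ h := by rw [h1, coord_ray_apex_self]; omega
  obtain ⟨r, hr, N, hN, hagree, hlt, hray⟩ :=
    settledAbove_of_ceiling hU hD hc₀ hh₀ h0 (Ne.symm hf) (by rw [h1]; exact adapted_ray_apex_self 0 c₁ k₁) hne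
  rw [h1] at hray hlt
  have he : 0 < (N f₁).1 - (ray ((0, 0, 0) : BPoint) k₁ c₁).1 := by simp at hlt ⊢; omega
  have hy : InDiamond h (ray (ray ((0, 0, 0) : BPoint) k₁ c₁) r ((N f₁).1 - (ray ((0, 0, 0) : BPoint) k₁ c₁).1)) := by
    rw [← hray]; exact hU.1 N hN f₁
  obtain ⟨hrk, hline⟩ := floor_charge_move hc₁ he hr hy
  subst hrk
  rw [ray_ray_self] at hray
  refine ⟨(N f₁).1 - (ray ((0, 0, 0) : BPoint) r c₁).1, by omega, hline, ?_⟩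
  have hNeq : N = Function.update P f₁ (ray ((0, 0, 0) : BPoint) r (c₁ + ((N f₁).1 - (ray ((0, 0, 0) : BPoint) r c₁).1))) := by
    funext g
    by_cases hg : g = f₁
    · subst hg; simp only [Function.update_self]; exact hray
    · rw [Function.update_of_ne hg]; exact (hagree g hg).symm
  rw [← hNeq]; exact hN

/-- **CLASS «a charged ceiling letter and two unit floor letters» (P side, PROVED ∀ h > 2)**: clause 1 `lower_mem_of_ceiling_floor` on the first unit
floor letter, clause 2 `saturation_unit_floor`. -/
theorem ceiling_charge_premove {h t c d : ℤ} {k r : Fin 4} {y : BPoint} (hc : 1 ≤ c) (hd : 0 < d) (hr : r ≠ k)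
    (hxy : ray ((t, 0, 0) : BPoint) k c = ray y r d) (hy : InDiamond h y) :
    r = k + 2 ∧ 2 * d ≤ t ∧ y = ray ((t - 2 * d, 0, 0) : BPoint) k (c + d) := by
  obtain ⟨a, b1, b2⟩ := y
  have hax := hy.1
  have hle := abs_le.mp hy.2.1
  simp only [chargeOf] at hle
  fin_cases k <;> fin_cases r <;> simp [AxisPt, Prod.ext_iff] at hxy hax hr hle ⊢ <;> omega

/-- **ceiling letter charged downward (N side)**: with a charged FLOOR letter on `f₀` and a charged CEILING letter `t₁·I + c₁·ℓ_v`, `t₁ > 0`, on `f₁`,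
the cell with `f₁ ↦ (t₁-2d)·I + (c₁+d)·ℓ_v` lies in `C.upper` for some `d ≥ 1`, `2d ≤ t₁`. -/
theorem upper_mem_of_floor_ceiling {h : ℤ} {C : MConfig} (hU : C.InDiamond h) {Z : MCell} (hD : RuleDMu4N C Z)
    {f₀ f₁ k₀ k₁ : Fin 4} (hf : f₀ ≠ f₁) {c₀ t₁ c₁ : ℤ} (hc₀ : 1 ≤ c₀) (hc₁ : 1 ≤ c₁) (ht₁ : 0 < t₁)
    (h0 : Z f₀ = ray ((0, 0, 0) : BPoint) k₀ c₀) (h1 : Z f₁ = ray ((t₁, 0, 0) : BPoint) k₁ c₁) :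
    ∃ d, 1 ≤ d ∧ 2 * d ≤ t₁ ∧ Function.update Z f₁ (ray ((t₁ - 2 * d, 0, 0) : BPoint) k₁ (c₁ + d)) ∈ C.upper := by
  have hne : coord (Z f₁) (k₁ + 2) ≠ 0 := by rw [h1, coord_ray_apex_antip]; omega
  obtain ⟨r, hr, P, hP, hagree, hlt, hray⟩ :=
    settledBelow_of_floor hU hD hc₀ h0 (Ne.symm hf) (by rw [h1]; exact adapted_ray_apex_antip t₁ c₁ k₁) hne
  rw [h1] at hray hlt
  have hd : 0 < (ray ((t₁, 0, 0) : BPoint) k₁ c₁).1 - (P f₁).1 := by simp at hlt ⊢; omega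
  have hrk : r ≠ k₁ := by
    intro hrk; apply hr; rw [hrk]; fin_cases k₁ <;> decide
  obtain ⟨-, hdt, hpt⟩ := ceiling_charge_premove hc₁ hd hrk hray (hU.2 P hP f₁)
  refine ⟨(ray ((t₁, 0, 0) : BPoint) k₁ c₁).1 - (P f₁).1, by omega, hdt, ?_⟩
  have hPeq : P = Function.update Z f₁ (ray ((t₁ - 2 * ((ray ((t₁, 0, 0) : BPoint) k₁ c₁).1 - (P f₁).1), 0, 0) : BPoint) k₁
      (c₁ + ((ray ((t₁, 0, 0) : BPoint) k₁ c₁).1 - (P f₁).1))) := by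
    funext g
    by_cases hg : g = f₁
    · subst hg; simp only [Function.update_self]; exact hpt
    · rw [Function.update_of_ne hg]; exact hagree g hg
  rw [← hPeq]; exact hP

/-- **`Saturation A h` (lc-core), dual CLASS «a charged floor letter below the ceiling and two unit ceiling letters» (N side) — PROVED for every `h > 2`.**
Clause 1 = `upper_mem_of_floor_ceiling` on the first unit ceiling letter (charged down to `(h-2-2d)·I + (1+d)·ℓ_v`, a fully charged `P`-cell); clause 2 =
`saturation_unit_ceiling` on it. -/
theorem settledAbove_of_top {h : ℤ} {C : MConfig} (hU : C.InDiamond h) {P : MCell} (hD : RuleDMu4P C P)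
    {f₀ : Fin 4} (h0 : P f₀ = (h, 0, 0)) {g k : Fin 4} (hg : g ≠ f₀) (hadk : Adapted (P g) k) (hne : coord (P g) k ≠ h) :
    SettledAbove C P g k := by
  have hstuck : ¬ SettledAbove C P f₀ 0 := by
    rintro ⟨r, -, N, hN, -, hlt, -⟩
    have h1 := (hU.1 N hN f₀).2.2.2
    have h2 := abs_nonneg (chargeOf (N f₀))
    rw [h0] at hlt; simp at hlt; simp only [absCharge] at h1; omega
  have hnocov : ∀ j k', ¬ CoveredAbove C P f₀ 0 j k' := by
    rintro j k' ⟨a, b, -, -, N, hN, -, hlt, -, -⟩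
    have h1 := (hU.1 N hN f₀).2.2.2
    have h2 := abs_nonneg (chargeOf (N f₀))
    rw [h0] at hlt; simp at hlt; simp only [absCharge] at h1; omega
  refine settledAbove_of_stuck hD (by rw [h0]; simp [Adapted]) hstuck hnocov hg hadk ?_
  rw [h0]; simpa [coord] using hne

/-- **the origin is stuck below**: no `P`-letter of `◇_h` lies strictly below `O`; hence every adapted non-zero coordinate of every other factor of an
`N`-cell with an `O` letter is settled below.  (The tree's `settledBelow_of_O` with the effectivity hypothesis discharged by `C.InDiamond h`.) -/
theorem settledBelow_of_origin {h : ℤ} {C : MConfig} (hU : C.InDiamond h) {Z : MCell} (hD : RuleDMu4N C Z)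
    {f₀ : Fin 4} (h0 : Z f₀ = (0, 0, 0)) {g k : Fin 4} (hg : g ≠ f₀) (hadk : Adapted (Z g) k) (hne : coord (Z g) k ≠ 0) :
    SettledBelow C Z g k := by
  have hfloor : ∀ P ∈ C.upper, ¬ (P f₀).1 < (Z f₀).1 := fun P hP hlt => by
    have h1 := (hU.2 P hP f₀).2.1
    have h2 := abs_nonneg (chargeOf (P f₀))
    rw [h0] at hlt; simp at hlt; simp only [absCharge] at h1; omega
  obtain ⟨hstuck, hnocov⟩ := stuck_of_floor hfloor (0 : Fin 4)
  refine settledBelow_of_stuck hD (by rw [h0]; decide) hstuck hnocov hg hadk ?_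
  rw [h0]; simpa [coord] using hne

/-- below an `N`-cell with the ORIGIN on `f₀` and an apex `t·I`, `t ≠ 0`, on `f₁`: a `P`-cell equal to `Z` off `f₁` with a CHARGED letter strictly below `t·I`. -/
theorem upper_mem_of_origin_apex {h : ℤ} {C : MConfig} (hU : C.InDiamond h) {Z : MCell} (hD : RuleDMu4N C Z)
    {f₀ f₁ : Fin 4} (hf : f₀ ≠ f₁) {t : ℤ} (h0 : Z f₀ = (0, 0, 0)) (h1 : Z f₁ = (t, 0, 0)) (ht : t ≠ 0) :
    ∃ P ∈ C.upper, ∃ r : Fin 4, ∃ d : ℤ, 1 ≤ d ∧ (∀ g, g ≠ f₁ → P g = Z g) ∧ ray (P f₁) r d = (t, 0, 0) ∧ (P f₁).1 + d = t := by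
  obtain ⟨r, -, P, hP, hagree, hlt, hray⟩ := settledBelow_of_origin hU hD h0 (Ne.symm hf)
    (show Adapted (Z f₁) 0 by rw [h1]; simp [Adapted]) (by rw [h1]; simpa [coord] using ht)
  rw [h1] at hray hlt
  refine ⟨P, hP, r, t - (P f₁).1, by simp at hlt; omega, hagree, ?_, by omega⟩
  simpa using hray.symm

/-- above a `P`-cell with the TOP APEX `hI` on `f₀` and an apex `t·I`, `t ≠ h`, on `f₁`: an `N`-cell `update P f₁ (t·I + e·ℓ_r)`, `e ≥ 1`, is present. -/
theorem lower_mem_of_top_apex {h : ℤ} {C : MConfig} (hU : C.InDiamond h) {P : MCell} (hD : RuleDMu4P C P)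
    {f₀ f₁ : Fin 4} (hf : f₀ ≠ f₁) {t : ℤ} (h0 : P f₀ = (h, 0, 0)) (h1 : P f₁ = (t, 0, 0)) (ht : t ≠ h) :
    ∃ r : Fin 4, ∃ e : ℤ, 1 ≤ e ∧ Function.update P f₁ (ray ((t, 0, 0) : BPoint) r e) ∈ C.lower := by
  obtain ⟨r, -, N, hN, hagree, hlt, hray⟩ := settledAbove_of_top hU hD h0 (Ne.symm hf)
    (show Adapted (P f₁) 0 by rw [h1]; simp [Adapted]) (by rw [h1]; simpa [coord] using ht)
  rw [h1] at hray hlt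
  refine ⟨r, (N f₁).1 - t, by simp at hlt; omega, ?_⟩
  have hNeq : N = Function.update P f₁ (ray ((t, 0, 0) : BPoint) r ((N f₁).1 - t)) := by
    funext g
    by_cases hg : g = f₁
    · subst hg; rw [Function.update_self]; simpa using hray
    · rw [Function.update_of_ne hg]; exact (hagree g hg).symm
  rw [← hNeq]; exact hN

/-- **`Saturation A h` (lc-core), CLASS «q = 2 with the top apex `hI` and another apex» (P side) — PROVED for every `h > 0`.**  `f₂` is a floor anchor (it
may be the apex factor `f₁` itself when `t = 0`), `f₃ ≠ f₁` a letter off the ceiling line.  Instrument: `P[O|ℓ|ℓ|6I]` at `◇₆` (used `N[eℓ|ℓ|ℓ|6I]`, all `e`). -/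
theorem exists_ray_of_charged {h : ℤ} {x : BPoint} (hx : InDiamond h x) (hch : x.2 ≠ (0, 0)) :
    ∃ (t c : ℤ) (k : Fin 4), 1 ≤ c ∧ 0 ≤ t ∧ t + 2 * c ≤ h ∧ x = ray ((t, 0, 0) : BPoint) k c := by
  obtain ⟨a, b1, b2⟩ := x
  obtain ⟨hax, hle, -, hh⟩ := hx
  rcases hax with h0 | ⟨hb1, hb2⟩ | ⟨hb1, hb2⟩
  · exact absurd h0 hch
  · simp only at hb1 hb2
    subst hb2
    simp only [absCharge, chargeOf, sub_zero] at hle hh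
    rcases lt_or_gt_of_ne hb1 with hneg | hpos
    · rw [abs_of_neg hneg] at hle hh
      exact ⟨a + b1, -b1, 2, by omega, by omega, by omega, by simp [Prod.ext_iff]⟩
    · rw [abs_of_pos hpos] at hle hh
      exact ⟨a - b1, b1, 0, by omega, by omega, by omega, by simp [Prod.ext_iff]⟩
  · simp only at hb1 hb2
    subst hb1
    simp only [absCharge, chargeOf, zero_sub, abs_neg] at hle hh
    rcases lt_or_gt_of_ne hb2 with hneg | hpos
    · rw [abs_of_neg hneg] at hle hh
      exact ⟨a + b2, -b2, 1, by omega, by omega, by omega, by simp [Prod.ext_iff]⟩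
    · rw [abs_of_pos hpos] at hle hh
      exact ⟨a - b2, b2, 3, by omega, by omega, by omega, by simp [Prod.ext_iff]⟩

theorem onFloor_ray_iff {t c : ℤ} (k : Fin 4) (hc : 0 ≤ c) : OnFloor (ray ((t, 0, 0) : BPoint) k c) ↔ t = 0 := by
  have hx := absCharge_ray_apex t c k hc
  dsimp only [OnFloor] at hx ⊢; rw [hx]; constructor <;> intro e <;> omega

theorem onCeiling_ray_iff {h t c : ℤ} (k : Fin 4) (hc : 0 ≤ c) : OnCeiling h (ray ((t, 0, 0) : BPoint) k c) ↔ t + 2 * c = h := by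
  have hx := absCharge_ray_apex t c k hc
  dsimp only [OnCeiling] at hx ⊢; rw [hx]; constructor <;> intro e <;> omega

/-- term-mode forms (no metavariables left to tactic blocks): node∕line of a letter GIVEN BY AN EQUATION `Z f = t·I + c·ℓ`. -/
theorem node_zero_of_onFloor {Z : MCell} {f k : Fin 4} {t c : ℤ} (hc : 0 ≤ c) (hZ : Z f = ray ((t, 0, 0) : BPoint) k c)
    (hf : OnFloor (Z f)) : t = 0 := (onFloor_ray_iff k hc).1 (hZ ▸ hf)

theorem line_eq_of_onCeiling {h : ℤ} {Z : MCell} {f k : Fin 4} {t c : ℤ} (hc : 0 ≤ c) (hZ : Z f = ray ((t, 0, 0) : BPoint) k c)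
    (hf : OnCeiling h (Z f)) : t + 2 * c = h := (onCeiling_ray_iff k hc).1 (hZ ▸ hf)

theorem onFloor_of_eq {Z : MCell} {f k : Fin 4} {c : ℤ} (hc : 0 ≤ c) (hZ : Z f = ray ((0, 0, 0) : BPoint) k c) : OnFloor (Z f) := by
  rw [hZ]; exact (onFloor_ray_iff k hc).2 rfl

theorem onCeiling_of_eq {h : ℤ} {Z : MCell} {f k : Fin 4} {t c : ℤ} (hc : 0 ≤ c) (hh : t + 2 * c = h)
    (hZ : Z f = ray ((t, 0, 0) : BPoint) k c) : OnCeiling h (Z f) := by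
  rw [hZ]; exact (onCeiling_ray_iff k hc).2 hh

theorem onCeiling_update_of_ne {h : ℤ} {Z : MCell} {f₁ g : Fin 4} (hg : g ≠ f₁) (x : BPoint) (hc : OnCeiling h (Z g)) :
    OnCeiling h (Function.update Z f₁ x g) := by rw [Function.update_of_ne hg]; exact hc

theorem onFloor_update_of_ne {Z : MCell} {f₁ g : Fin 4} (hg : g ≠ f₁) (x : BPoint) (hf : OnFloor (Z g)) :
    OnFloor (Function.update Z f₁ x g) := by rw [Function.update_of_ne hg]; exact hf

theorem update_apply_of_ne_eq {Z : MCell} {f₁ g : Fin 4} (hg : g ≠ f₁) (x : BPoint) {y : BPoint} (he : Z g = y) :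
    Function.update Z f₁ x g = y := by rw [Function.update_of_ne hg]; exact he

theorem line_le_of_ray_inDiamond {h t c : ℤ} {k : Fin 4} (hc : 0 ≤ c) (hx : InDiamond h (ray ((t, 0, 0) : BPoint) k c)) : t + 2 * c ≤ h := by
  have hl := hx.2.2.2
  rw [absCharge_ray_apex t c k hc, ray_fst] at hl
  simp only at hl; omega

theorem node_nonneg_of_ray_inDiamond {h t c : ℤ} {k : Fin 4} (hc : 0 ≤ c) (hx : InDiamond h (ray ((t, 0, 0) : BPoint) k c)) : 0 ≤ t := by
  have hl := hx.2.1
  rw [absCharge_ray_apex t c k hc, ray_fst] at hl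
  simp only at hl; omega

theorem line_le_of_eq {h : ℤ} {Z : MCell} {f k : Fin 4} {t c : ℤ} (hc : 0 ≤ c) (hZ : Z f = ray ((t, 0, 0) : BPoint) k c)
    (hD : InDiamond h (Z f)) : t + 2 * c ≤ h := line_le_of_ray_inDiamond hc (hZ ▸ hD)

theorem node_nonneg_of_eq {h : ℤ} {Z : MCell} {f k : Fin 4} {t c : ℤ} (hc : 0 ≤ c) (hZ : Z f = ray ((t, 0, 0) : BPoint) k c)
    (hD : InDiamond h (Z f)) : 0 ≤ t := node_nonneg_of_ray_inDiamond hc (hZ ▸ hD)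

theorem ray_charged (t : ℤ) (k : Fin 4) {c : ℤ} (hc : 1 ≤ c) : (ray ((t, 0, 0) : BPoint) k c).2 ≠ (0, 0) := by
  fin_cases k <;> simp [Prod.ext_iff] <;> omega

/-- replacing a letter of a fully charged cell by a charged letter keeps it fully charged. -/
theorem allCharged_update {P : MCell} (hch : ∀ f, (P f).2 ≠ (0, 0)) (f₁ : Fin 4) {x : BPoint} (hx : x.2 ≠ (0, 0)) :
    ∀ f, (Function.update P f₁ x f).2 ≠ (0, 0) := by
  intro f
  by_cases hf : f = f₁
  · subst hf; rwa [Function.update_self]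
  · rw [Function.update_of_ne hf]; exact hch f

theorem allCharged_iff_count_four (Z : MCell) : (∀ f, (Z f).2 ≠ (0, 0)) ↔ chargedCount Z = 4 := by
  dsimp only [chargedCount]
  constructor
  · intro h
    rw [Finset.filter_true_of_mem (fun f _ => h f)]; simp
  · intro h f hf
    have hsub : (univ.filter fun f : Fin 4 => (Z f).2 ≠ (0, 0)) ⊆ univ.erase f := by
      intro g hg
      simp only [mem_filter] at hg
      exact mem_erase.2 ⟨fun e => hg.2 (e ▸ hf), mem_univ _⟩
    have hle := card_le_card hsub
    rw [card_erase_of_mem (mem_univ _), h] at hle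
    simp at hle

theorem exists_ne_ne (a b : Fin 4) : ∃ y : Fin 4, y ≠ a ∧ y ≠ b := by
  revert a b; decide

/-- a forward move of a charged letter `t·I + c·ℓ_{i^k}` (`c ≥ 1`) inside `◇_h` in a direction other than the antipode `k + 2` goes along `k` (charge UP at
fixed node; off-frame moves leave the axis letters) and keeps the causal height `t + 2(c+e) ≤ h`.  (`floor_charge_move` is the case `t = 0`.) -/
theorem charge_move {h t c e : ℤ} {k r : Fin 4} (hc : 1 ≤ c) (he : 0 < e) (hr : r ≠ k + 2)
    (hy : InDiamond h (ray (ray ((t, 0, 0) : BPoint) k c) r e)) : r = k ∧ t + 2 * (c + e) ≤ h := by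
  have hax := hy.1
  have hl := hy.2.2.2
  have h1 := le_abs_self (chargeOf (ray (ray ((t, 0, 0) : BPoint) k c) r e))
  have h2 := neg_abs_le (chargeOf (ray (ray ((t, 0, 0) : BPoint) k c) r e))
  simp only [absCharge] at hl
  fin_cases k <;> fin_cases r <;> simp [AxisPt, chargeOf, Prod.ext_iff] at hax hr hl h1 h2 ⊢ <;> omega

/-- **line service upward (P side, PROVED, h-uniform)**: at a rule-D `P`-cell with a charged CEILING letter on `f₀`, a charged letter `t·I + c·ℓ_v` below
the ceiling on `y ≠ f₀` is served along `v`: `y ↦ t·I + (c+e)·ℓ_v` lies in `C.lower` for some `e ≥ 1`, `t + 2(c+e) ≤ h`. -/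
theorem lower_mem_of_ceiling_line {h : ℤ} {C : MConfig} (hU : C.InDiamond h) {P : MCell} (hD : RuleDMu4P C P)
    {f₀ y k₀ v : Fin 4} (hf : f₀ ≠ y) {t₀ c₀ t c : ℤ} (hc₀ : 1 ≤ c₀) (hh₀ : t₀ + 2 * c₀ = h) (hc : 1 ≤ c) (hlow : t + 2 * c < h)
    (h0 : P f₀ = ray ((t₀, 0, 0) : BPoint) k₀ c₀) (h1 : P y = ray ((t, 0, 0) : BPoint) v c) :
    ∃ e, 1 ≤ e ∧ t + 2 * (c + e) ≤ h ∧ Function.update P y (ray ((t, 0, 0) : BPoint) v (c + e)) ∈ C.lower := by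
  have hne : coord (P y) v ≠ h := by rw [h1, coord_ray_apex_self]; omega
  obtain ⟨r, hr, N, hN, hagree, hlt, hray⟩ :=
    settledAbove_of_ceiling hU hD hc₀ hh₀ h0 (Ne.symm hf) (by rw [h1]; exact adapted_ray_apex_self t c v) hne
  rw [h1] at hray hlt
  have he : 0 < (N y).1 - (ray ((t, 0, 0) : BPoint) v c).1 := by simp at hlt ⊢; omega
  have hyD : InDiamond h (ray (ray ((t, 0, 0) : BPoint) v c) r ((N y).1 - (ray ((t, 0, 0) : BPoint) v c).1)) := by
    rw [← hray]; exact hU.1 N hN y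
  obtain ⟨hrk, hline⟩ := charge_move hc he hr hyD
  subst hrk
  rw [ray_ray_self] at hray
  refine ⟨(N y).1 - (ray ((t, 0, 0) : BPoint) r c).1, by omega, hline, ?_⟩
  have hNeq : N = Function.update P y (ray ((t, 0, 0) : BPoint) r (c + ((N y).1 - (ray ((t, 0, 0) : BPoint) r c).1))) := by
    funext g
    by_cases hg : g = y
    · subst hg; simp only [Function.update_self]; exact hray
    · rw [Function.update_of_ne hg]; exact (hagree g hg).symm
  rw [← hNeq]; exact hN

/-- **the `lawSS` core in CONTRADICTION form** (`h > 0`): a bi-anchored THREE-charged cell never obeys `lawSS` — its floor anchor is either a charged floor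
letter (node `0`, against the ladder's `≥ 4` ∕ `≥ 6`) or the origin (line `0`, against line confinement with the ceiling anchor on line `h`). -/
theorem false_of_lawSS_three {h : ℤ} (hpos : 0 < h) {b : Bool} {Z : MCell} (hB : BiAnchored h Z) (h3 : ThreeCharged Z)
    (hl : lawSS h b Z) : False := by
  obtain ⟨⟨a, ha⟩, ⟨g, hg⟩⟩ := hB
  obtain ⟨hlc, hlad, -⟩ := hl
  have hthin : ¬ ThinCell Z := by dsimp only [ThinCell]; rw [h3]; decide
  have ha' : (Z a).1 = absCharge (Z a) := ha
  have hg' : (Z g).1 + absCharge (Z g) = h := hg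
  by_cases hch : (Z a).2 = (0, 0)
  · have h0 : absCharge (Z a) = 0 := by
      simp only [Prod.ext_iff] at hch
      simp only [absCharge, chargeOf, hch.1, hch.2, sub_zero, abs_zero]
    have e1 := ((hlc hthin) a).trans ((hlc hthin) g).symm
    omega
  · have hq := hlad hthin a hch
    have h3' : chargedCount Z = 3 := h3
    rw [h3'] at hq
    cases b <;> simp at hq <;> omega

/-- `NoThree h` (= T1-core for `lawSS`, typed): no static `G₁`-closed support in `◇_h` contains a bi-anchored three-charged cell. -/
def NoThree (h : ℤ) : Prop :=
  ∀ C : MConfig, C.InDiamond h → C.G1Closed → C.StaticH1 →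
    (∀ Z ∈ C.lower, BiAnchored h Z → ThreeCharged Z → False) ∧ ∀ P ∈ C.upper, BiAnchored h P → ThreeCharged P → False

/-- `CoreStep lawSS h` IS `NoThree h` (`h > 0`). -/
theorem coreStep_lawSS_iff_noThree {h : ℤ} (hpos : 0 < h) : CoreStep lawSS h ↔ NoThree h := by
  constructor
  · intro H C hU hG hS
    exact ⟨fun Z hZ hB h3 => false_of_lawSS_three hpos hB h3 ((H C hU hG hS).1 Z hZ hB h3),
      fun P hP hB h3 => false_of_lawSS_three hpos hB h3 ((H C hU hG hS).2 P hP hB h3)⟩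
  · intro H C hU hG hS
    exact ⟨fun Z hZ hB h3 => ((H C hU hG hS).1 Z hZ hB h3).elim, fun P hP hB h3 => ((H C hU hG hS).2 P hP hB h3).elim⟩

/-- **(FR) no «floor-rich» fully charged cell — PROVED for every `h > 0`, both levels**: under the core no fully charged cell has two charged FLOOR
letters and a ceiling letter.  Induction on `c₁`. -/
theorem no_two_floor {h : ℤ} {C : MConfig} (hU : C.InDiamond h) (hS : C.StaticH1) (_hpos : 0 < h)
    (noN : ∀ Z ∈ C.lower, BiAnchored h Z → ThreeCharged Z → False) (noP : ∀ P ∈ C.upper, BiAnchored h P → ThreeCharged P → False) (n : ℕ) :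
    (∀ Z ∈ C.lower, (∀ f, (Z f).2 ≠ (0, 0)) → ∀ {f₀ f₁ g k₀ k₁ : Fin 4} {c₀ c₁ : ℤ}, f₀ ≠ f₁ → 1 ≤ c₀ → 1 ≤ c₁ → c₁ ≤ n →
        Z f₀ = ray ((0, 0, 0) : BPoint) k₀ c₀ → Z f₁ = ray ((0, 0, 0) : BPoint) k₁ c₁ → OnCeiling h (Z g) → False) ∧
    (∀ P ∈ C.upper, (∀ f, (P f).2 ≠ (0, 0)) → ∀ {f₀ f₁ g k₀ k₁ : Fin 4} {c₀ c₁ : ℤ}, f₀ ≠ f₁ → 1 ≤ c₀ → 1 ≤ c₁ → c₁ ≤ n →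
        P f₀ = ray ((0, 0, 0) : BPoint) k₀ c₀ → P f₁ = ray ((0, 0, 0) : BPoint) k₁ c₁ → OnCeiling h (P g) → False) := by
  induction n with
  | zero => exact ⟨by intros; omega, by intros; omega⟩
  | succ n ih =>
    -- (1) N-cells, the ceiling witness off the pulled letter: pull `f₁` back toward the origin (`f₀` stuck)
    have pullN : ∀ Z ∈ C.lower, (∀ f, (Z f).2 ≠ (0, 0)) → ∀ {f₀ f₁ g k₀ k₁ : Fin 4} {c₀ c₁ : ℤ}, f₀ ≠ f₁ → g ≠ f₁ → 1 ≤ c₀ → 1 ≤ c₁ →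
        c₁ ≤ n + 1 → Z f₀ = ray ((0, 0, 0) : BPoint) k₀ c₀ → Z f₁ = ray ((0, 0, 0) : BPoint) k₁ c₁ → OnCeiling h (Z g) → False := by
      intro Z hZ hch f₀ f₁ g k₀ k₁ c₀ c₁ hf hg1 hc₀ hc₁ hn h0 h1 hg
      obtain ⟨e, he1, hle, hmem⟩ := upper_mem_of_two_floor' hU (hS.1.1 Z hZ) hf hc₀ hc₁ h0 h1
      by_cases hec : e = c₁
      · have hre : ray ((0, 0, 0) : BPoint) k₁ (c₁ - e) = ((0, 0, 0) : BPoint) := by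
          rw [show c₁ - e = 0 by omega]; simp [Prod.ext_iff]
        rw [hre] at hmem
        exact noP _ hmem ⟨⟨f₁, by simp [OnFloor, absCharge, chargeOf]⟩, ⟨g, onCeiling_update_of_ne hg1 _ hg⟩⟩
          (threeCharged_update_apex hch f₁ 0)
      · exact ih.2 _ hmem (allCharged_update hch f₁ (ray_charged 0 k₁ (by omega))) hf hc₀ (by omega) (by omega)
          (update_apply_of_ne_eq hf _ h0) (Function.update_self ..) (onCeiling_update_of_ne hg1 _ hg)
    -- (2) N-cells in general: if the ceiling witness IS `f₁`, then `f₁` is the corner, `c₀ ≤ c₁`, and the two floor letters swap rôles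
    have hN : ∀ Z ∈ C.lower, (∀ f, (Z f).2 ≠ (0, 0)) → ∀ {f₀ f₁ g k₀ k₁ : Fin 4} {c₀ c₁ : ℤ}, f₀ ≠ f₁ → 1 ≤ c₀ → 1 ≤ c₁ → c₁ ≤ n + 1 →
        Z f₀ = ray ((0, 0, 0) : BPoint) k₀ c₀ → Z f₁ = ray ((0, 0, 0) : BPoint) k₁ c₁ → OnCeiling h (Z g) → False := by
      intro Z hZ hch f₀ f₁ g k₀ k₁ c₀ c₁ hf hc₀ hc₁ hn h0 h1 hg
      by_cases hg1 : g = f₁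
      · subst hg1
        have hcorner : (0 : ℤ) + 2 * c₁ = h := line_eq_of_onCeiling (by omega) h1 hg
        have hl0 : (0 : ℤ) + 2 * c₀ ≤ h := line_le_of_eq (by omega) h0 (hU.1 Z hZ f₀)
        exact pullN Z hZ hch (Ne.symm hf) (Ne.symm hf) hc₁ hc₀ (by omega) h1 h0 hg
      · exact pullN Z hZ hch hf hg1 hc₀ hc₁ hn h0 h1 hg
    refine ⟨hN, ?_⟩
    -- (3) P-cells: push ANOTHER letter up, keeping both floor letters, and land in (2)
    intro P hP hch f₀ f₁ g k₀ k₁ c₀ c₁ hf hc₀ hc₁ hn h0 h1 hg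
    obtain ⟨tg, cg, kg, hcg, htg, -, hPg⟩ := exists_ray_of_charged (hU.2 P hP g) (hch g)
    have hhg : tg + 2 * cg = h := line_eq_of_onCeiling (by omega) hPg hg
    by_cases hA : 2 * c₀ = h
    · -- `f₀` is the corner letter: it is the stuck ceiling letter AND a surviving floor∕ceiling witness; push a third letter `y`
      have hfl0 : OnFloor (P f₀) := onFloor_of_eq (by omega) h0
      have hcl0 : OnCeiling h (P f₀) := onCeiling_of_eq (by omega) (by omega : (0 : ℤ) + 2 * c₀ = h) h0
      obtain ⟨y, hy0, hy1⟩ := exists_ne_ne f₀ f₁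
      obtain ⟨t, c, v, hc, ht, hlin, hPy⟩ := exists_ray_of_charged (hU.2 P hP y) (hch y)
      rcases lt_or_eq_of_le hlin with hlow | hceil
      · obtain ⟨e, he1, hle, hmem⟩ :=
          lower_mem_of_ceiling_line hU (hS.1.2 P hP) (Ne.symm hy0) hc₀ (by omega : (0 : ℤ) + 2 * c₀ = h) hc hlow h0 hPy
        exact hN _ hmem (allCharged_update hch y (ray_charged t v (by omega))) hf hc₀ hc₁ hn
          (update_apply_of_ne_eq (Ne.symm hy0) _ h0) (update_apply_of_ne_eq (Ne.symm hy1) _ h1) (onCeiling_update_of_ne (Ne.symm hy0) _ hcl0)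
      · obtain ⟨e, he1, hle, hmem⟩ :=
          lower_mem_of_two_ceiling' hU (hS.1.2 P hP) (Ne.symm hy0) hc₀ (by omega : (0 : ℤ) + 2 * c₀ = h) hc hceil h0 hPy
        by_cases hec : e = c
        · have hre : ray ((t + 2 * e, 0, 0) : BPoint) v (c - e) = ((t + 2 * e, 0, 0) : BPoint) := by
            rw [show c - e = 0 by omega]; simp [Prod.ext_iff]
          rw [hre] at hmem
          exact noN _ hmem ⟨⟨f₀, onFloor_update_of_ne (Ne.symm hy0) _ hfl0⟩, ⟨f₀, onCeiling_update_of_ne (Ne.symm hy0) _ hcl0⟩⟩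
            (threeCharged_update_apex hch y (t + 2 * e))
        · exact hN _ hmem (allCharged_update hch y (ray_charged (t + 2 * e) v (by omega))) hf hc₀ hc₁ hn
            (update_apply_of_ne_eq (Ne.symm hy0) _ h0) (update_apply_of_ne_eq (Ne.symm hy1) _ h1)
            (onCeiling_update_of_ne (Ne.symm hy0) _ hcl0)
    · -- `f₀` is not the corner: push it along the floor (the ceiling letter `g ≠ f₀` stuck)
      have hg0 : g ≠ f₀ := by
        rintro rfl
        have := line_eq_of_onCeiling (by omega : (0 : ℤ) ≤ c₀) h0 hg
        omega
      obtain ⟨e, he1, hle, hmem⟩ := lower_mem_of_ceiling_floor hU (hS.1.2 P hP) hg0 hcg hhg hc₀ hA hPg h0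
      exact hN _ hmem (allCharged_update hch f₀ (ray_charged 0 k₀ (by omega))) hf (by omega) hc₁ hn
        (Function.update_self ..) (update_apply_of_ne_eq (Ne.symm hf) _ h1) (onCeiling_update_of_ne hg0 _ hg)

/-- (FR), lower level, without the induction index. -/
theorem no_two_floor_lower {h : ℤ} {C : MConfig} (hU : C.InDiamond h) (hS : C.StaticH1) (hpos : 0 < h)
    (noN : ∀ Z ∈ C.lower, BiAnchored h Z → ThreeCharged Z → False) (noP : ∀ P ∈ C.upper, BiAnchored h P → ThreeCharged P → False)
    {Z : MCell} (hZ : Z ∈ C.lower) (hch : ∀ f, (Z f).2 ≠ (0, 0)) {f₀ f₁ g k₀ k₁ : Fin 4} {c₀ c₁ : ℤ} (hf : f₀ ≠ f₁) (hc₀ : 1 ≤ c₀) (hc₁ : 1 ≤ c₁)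
    (h0 : Z f₀ = ray ((0, 0, 0) : BPoint) k₀ c₀) (h1 : Z f₁ = ray ((0, 0, 0) : BPoint) k₁ c₁) (hg : OnCeiling h (Z g)) : False :=
  (no_two_floor hU hS hpos noN noP (Int.toNat c₁)).1 Z hZ hch hf hc₀ hc₁ (Int.self_le_toNat c₁) h0 h1 hg

/-- (FR), upper level, without the induction index. -/
theorem no_two_floor_upper {h : ℤ} {C : MConfig} (hU : C.InDiamond h) (hS : C.StaticH1) (hpos : 0 < h)
    (noN : ∀ Z ∈ C.lower, BiAnchored h Z → ThreeCharged Z → False) (noP : ∀ P ∈ C.upper, BiAnchored h P → ThreeCharged P → False)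
    {P : MCell} (hP : P ∈ C.upper) (hch : ∀ f, (P f).2 ≠ (0, 0)) {f₀ f₁ g k₀ k₁ : Fin 4} {c₀ c₁ : ℤ} (hf : f₀ ≠ f₁) (hc₀ : 1 ≤ c₀) (hc₁ : 1 ≤ c₁)
    (h0 : P f₀ = ray ((0, 0, 0) : BPoint) k₀ c₀) (h1 : P f₁ = ray ((0, 0, 0) : BPoint) k₁ c₁) (hg : OnCeiling h (P g)) : False :=
  (no_two_floor hU hS hpos noN noP (Int.toNat c₁)).2 P hP hch hf hc₀ hc₁ (Int.self_le_toNat c₁) h0 h1 hg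

/-- **(CR) no «ceiling-rich» fully charged cell — PROVED for every `h > 0`, both levels** (dual of FR, which it uses under a corner): no fully charged cell
has two charged CEILING letters `t₀·I + c₀·ℓ_u` (f₀), `t₁·I + c₁·ℓ_v` (f₁ ≠ f₀) together with a floor letter.  Induction on `c₁`. -/
theorem no_two_ceiling {h : ℤ} {C : MConfig} (hU : C.InDiamond h) (hS : C.StaticH1) (hpos : 0 < h)
    (noN : ∀ Z ∈ C.lower, BiAnchored h Z → ThreeCharged Z → False) (noP : ∀ P ∈ C.upper, BiAnchored h P → ThreeCharged P → False) (n : ℕ) :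
    (∀ P ∈ C.upper, (∀ f, (P f).2 ≠ (0, 0)) → ∀ {f₀ f₁ g k₀ k₁ : Fin 4} {t₀ c₀ t₁ c₁ : ℤ}, f₀ ≠ f₁ → 1 ≤ c₀ → t₀ + 2 * c₀ = h → 1 ≤ c₁ →
        t₁ + 2 * c₁ = h → c₁ ≤ n → P f₀ = ray ((t₀, 0, 0) : BPoint) k₀ c₀ → P f₁ = ray ((t₁, 0, 0) : BPoint) k₁ c₁ → OnFloor (P g) → False) ∧
    (∀ Z ∈ C.lower, (∀ f, (Z f).2 ≠ (0, 0)) → ∀ {f₀ f₁ g k₀ k₁ : Fin 4} {t₀ c₀ t₁ c₁ : ℤ}, f₀ ≠ f₁ → 1 ≤ c₀ → t₀ + 2 * c₀ = h → 1 ≤ c₁ →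
        t₁ + 2 * c₁ = h → c₁ ≤ n → Z f₀ = ray ((t₀, 0, 0) : BPoint) k₀ c₀ → Z f₁ = ray ((t₁, 0, 0) : BPoint) k₁ c₁ → OnFloor (Z g) → False) := by
  induction n with
  | zero => exact ⟨by intros; omega, by intros; omega⟩
  | succ n ih =>
    -- (1) P-cells, the floor witness off the discharged letter: discharge `f₁` (`f₀` stuck)
    have pullP : ∀ P ∈ C.upper, (∀ f, (P f).2 ≠ (0, 0)) → ∀ {f₀ f₁ g k₀ k₁ : Fin 4} {t₀ c₀ t₁ c₁ : ℤ}, f₀ ≠ f₁ → g ≠ f₁ → 1 ≤ c₀ →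
        t₀ + 2 * c₀ = h → 1 ≤ c₁ → t₁ + 2 * c₁ = h → c₁ ≤ n + 1 → P f₀ = ray ((t₀, 0, 0) : BPoint) k₀ c₀ →
        P f₁ = ray ((t₁, 0, 0) : BPoint) k₁ c₁ → OnFloor (P g) → False := by
      intro P hP hch f₀ f₁ g k₀ k₁ t₀ c₀ t₁ c₁ hf hg1 hc₀ hh₀ hc₁ hh₁ hn h0 h1 hg
      have hcl0 : OnCeiling h (P f₀) := onCeiling_of_eq (by omega) hh₀ h0
      obtain ⟨e, he1, hle, hmem⟩ := lower_mem_of_two_ceiling' hU (hS.1.2 P hP) hf hc₀ hh₀ hc₁ hh₁ h0 h1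
      by_cases hec : e = c₁
      · have hre : ray ((t₁ + 2 * e, 0, 0) : BPoint) k₁ (c₁ - e) = ((t₁ + 2 * e, 0, 0) : BPoint) := by
          rw [show c₁ - e = 0 by omega]; simp [Prod.ext_iff]
        rw [hre] at hmem
        exact noN _ hmem ⟨⟨g, onFloor_update_of_ne hg1 _ hg⟩, ⟨f₀, onCeiling_update_of_ne hf _ hcl0⟩⟩
          (threeCharged_update_apex hch f₁ (t₁ + 2 * e))
      · exact ih.2 _ hmem (allCharged_update hch f₁ (ray_charged (t₁ + 2 * e) k₁ (by omega))) hf hc₀ hh₀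
          (by omega : 1 ≤ c₁ - e) (by omega : (t₁ + 2 * e) + 2 * (c₁ - e) = h) (by omega)
          (update_apply_of_ne_eq hf _ h0) (Function.update_self ..) (onFloor_update_of_ne hg1 _ hg)
    -- (2) P-cells in general: a floor witness equal to `f₁` makes `f₁` the corner and `c₀ ≤ c₁`: swap
    have hP' : ∀ P ∈ C.upper, (∀ f, (P f).2 ≠ (0, 0)) → ∀ {f₀ f₁ g k₀ k₁ : Fin 4} {t₀ c₀ t₁ c₁ : ℤ}, f₀ ≠ f₁ → 1 ≤ c₀ → t₀ + 2 * c₀ = h →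
        1 ≤ c₁ → t₁ + 2 * c₁ = h → c₁ ≤ n + 1 → P f₀ = ray ((t₀, 0, 0) : BPoint) k₀ c₀ → P f₁ = ray ((t₁, 0, 0) : BPoint) k₁ c₁ →
        OnFloor (P g) → False := by
      intro P hP hch f₀ f₁ g k₀ k₁ t₀ c₀ t₁ c₁ hf hc₀ hh₀ hc₁ hh₁ hn h0 h1 hg
      by_cases hg1 : g = f₁
      · subst hg1
        have ht1 : t₁ = 0 := node_zero_of_onFloor (by omega) h1 hg
        have ht0 : 0 ≤ t₀ := node_nonneg_of_eq (by omega) h0 (hU.2 P hP f₀)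
        exact pullP P hP hch (Ne.symm hf) (Ne.symm hf) hc₁ hh₁ hc₀ hh₀ (by omega) h1 h0 hg
      · exact pullP P hP hch hf hg1 hc₀ hh₀ hc₁ hh₁ hn h0 h1 hg
    refine ⟨hP', ?_⟩
    -- (3) N-cells: charge ANOTHER letter down (node service), keeping both ceiling letters, and land in (2) — or in (FR)
    intro Z hZ hch f₀ f₁ g k₀ k₁ t₀ c₀ t₁ c₁ hf hc₀ hh₀ hc₁ hh₁ hn h0 h1 hg
    obtain ⟨tg, cg, kg, hcg, htg, -, hZg⟩ := exists_ray_of_charged (hU.1 Z hZ g) (hch g)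
    have htg0 : tg = 0 := node_zero_of_onFloor (by omega) hZg hg
    subst htg0
    have ht0 : 0 ≤ t₀ := node_nonneg_of_eq (by omega) h0 (hU.1 Z hZ f₀)
    have hcl1 : OnCeiling h (Z f₁) := onCeiling_of_eq (by omega) hh₁ h1
    rcases lt_or_eq_of_le ht0 with hA | hcorner
    · -- `f₀` is off the corner: charge it down its line (the floor letter `g ≠ f₀` stuck)
      have hg0 : g ≠ f₀ := by
        rintro rfl
        have := node_zero_of_onFloor (by omega : (0 : ℤ) ≤ c₀) h0 hg
        omega
      obtain ⟨d, hd1, hdt, hmem⟩ := upper_mem_of_floor_ceiling hU (hS.1.1 Z hZ) hg0 hcg hc₀ hA hZg h0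
      exact hP' _ hmem (allCharged_update hch f₀ (ray_charged (t₀ - 2 * d) k₀ (by omega))) hf (by omega : 1 ≤ c₀ + d)
        (by omega : (t₀ - 2 * d) + 2 * (c₀ + d) = h) hc₁ hh₁ hn
        (Function.update_self ..) (update_apply_of_ne_eq (Ne.symm hf) _ h1) (onFloor_update_of_ne hg0 _ hg)
    · -- `f₀` is the corner: stuck as a FLOOR letter; a third letter `y` is charged down (node service), or is a second floor letter (FR)
      subst hcorner
      have hfl0 : OnFloor (Z f₀) := onFloor_of_eq (by omega) h0
      obtain ⟨y, hy0, hy1⟩ := exists_ne_ne f₀ f₁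
      obtain ⟨t, c, v, hc, ht, hlin, hZy⟩ := exists_ray_of_charged (hU.1 Z hZ y) (hch y)
      rcases lt_or_eq_of_le ht with htpos | htzero
      · obtain ⟨d, hd1, hdt, hmem⟩ := upper_mem_of_floor_ceiling hU (hS.1.1 Z hZ) (Ne.symm hy0) hc₀ hc htpos h0 hZy
        exact hP' _ hmem (allCharged_update hch y (ray_charged (t - 2 * d) v (by omega))) hf hc₀ hh₀ hc₁ hh₁ hn
          (update_apply_of_ne_eq (Ne.symm hy0) _ h0) (update_apply_of_ne_eq (Ne.symm hy1) _ h1) (onFloor_update_of_ne (Ne.symm hy0) _ hfl0)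
      · subst htzero
        exact no_two_floor_lower hU hS hpos noN noP hZ hch (Ne.symm hy0) hc₀ hc h0 hZy hcl1

theorem no_two_ceiling_upper {h : ℤ} {C : MConfig} (hU : C.InDiamond h) (hS : C.StaticH1) (hpos : 0 < h)
    (noN : ∀ Z ∈ C.lower, BiAnchored h Z → ThreeCharged Z → False) (noP : ∀ P ∈ C.upper, BiAnchored h P → ThreeCharged P → False)
    {P : MCell} (hP : P ∈ C.upper) (hch : ∀ f, (P f).2 ≠ (0, 0)) {f₀ f₁ g k₀ k₁ : Fin 4} {t₀ c₀ t₁ c₁ : ℤ} (hf : f₀ ≠ f₁)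
    (hc₀ : 1 ≤ c₀) (hh₀ : t₀ + 2 * c₀ = h) (hc₁ : 1 ≤ c₁) (hh₁ : t₁ + 2 * c₁ = h)
    (h0 : P f₀ = ray ((t₀, 0, 0) : BPoint) k₀ c₀) (h1 : P f₁ = ray ((t₁, 0, 0) : BPoint) k₁ c₁) (hg : OnFloor (P g)) : False :=
  (no_two_ceiling hU hS hpos noN noP (Int.toNat c₁)).1 P hP hch hf hc₀ hh₀ hc₁ hh₁ (Int.self_le_toNat c₁) h0 h1 hg

theorem no_two_ceiling_lower {h : ℤ} {C : MConfig} (hU : C.InDiamond h) (hS : C.StaticH1) (hpos : 0 < h)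
    (noN : ∀ Z ∈ C.lower, BiAnchored h Z → ThreeCharged Z → False) (noP : ∀ P ∈ C.upper, BiAnchored h P → ThreeCharged P → False)
    {Z : MCell} (hZ : Z ∈ C.lower) (hch : ∀ f, (Z f).2 ≠ (0, 0)) {f₀ f₁ g k₀ k₁ : Fin 4} {t₀ c₀ t₁ c₁ : ℤ} (hf : f₀ ≠ f₁)
    (hc₀ : 1 ≤ c₀) (hh₀ : t₀ + 2 * c₀ = h) (hc₁ : 1 ≤ c₁) (hh₁ : t₁ + 2 * c₁ = h)
    (h0 : Z f₀ = ray ((t₀, 0, 0) : BPoint) k₀ c₀) (h1 : Z f₁ = ray ((t₁, 0, 0) : BPoint) k₁ c₁) (hg : OnFloor (Z g)) : False :=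
  (no_two_ceiling hU hS hpos noN noP (Int.toNat c₁)).2 Z hZ hch hf hc₀ hh₀ hc₁ hh₁ (Int.self_le_toNat c₁) h0 h1 hg

/-- **(IN) no fully charged cell with an INTERIOR letter — PROVED for every `h > 0`, both levels** (an interior charged letter is served at its node
coordinate; every service lands in a fully charged cell nearer the boundary: induction on the distance). -/
theorem no_interior {h : ℤ} {C : MConfig} (hU : C.InDiamond h) (hS : C.StaticH1) (hpos : 0 < h)
    (noN : ∀ Z ∈ C.lower, BiAnchored h Z → ThreeCharged Z → False) (noP : ∀ P ∈ C.upper, BiAnchored h P → ThreeCharged P → False) (n : ℕ) :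
    (∀ P ∈ C.upper, (∀ f, (P f).2 ≠ (0, 0)) → ∀ {y a b v : Fin 4} {t c : ℤ}, a ≠ y → b ≠ y → 1 ≤ c → 0 < t → t + 2 * c < h →
        h - 2 * c ≤ n → P y = ray ((t, 0, 0) : BPoint) v c → OnFloor (P a) → OnCeiling h (P b) → False) ∧
    (∀ Z ∈ C.lower, (∀ f, (Z f).2 ≠ (0, 0)) → ∀ {y a b v : Fin 4} {t c : ℤ}, a ≠ y → b ≠ y → 1 ≤ c → 0 < t → t + 2 * c < h →
        h - 2 * c ≤ n → Z y = ray ((t, 0, 0) : BPoint) v c → OnFloor (Z a) → OnCeiling h (Z b) → False) := by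
  induction n with
  | zero => exact ⟨by intros; omega, by intros; omega⟩
  | succ n ih =>
    refine ⟨?_, ?_⟩
    · intro P hP hch y a b v t c hay hby hc ht hlow hn hPy ha hb
      obtain ⟨tb, cb, kb, hcb, htb, -, hPb⟩ := exists_ray_of_charged (hU.2 P hP b) (hch b)
      have hhb : tb + 2 * cb = h := line_eq_of_onCeiling (by omega) hPb hb
      obtain ⟨e, he1, hle, hmem⟩ := lower_mem_of_ceiling_line hU (hS.1.2 P hP) hby hcb hhb hc hlow hPb hPy
      rcases lt_or_eq_of_le hle with hlow' | hceil
      · exact ih.2 _ hmem (allCharged_update hch y (ray_charged t v (by omega))) hay hby (by omega : 1 ≤ c + e) ht hlow' (by omega)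
          (Function.update_self ..) (onFloor_update_of_ne hay _ ha) (onCeiling_update_of_ne hby _ hb)
      · exact no_two_ceiling_lower hU hS hpos noN noP hmem (allCharged_update hch y (ray_charged t v (by omega))) hby hcb hhb
          (by omega : 1 ≤ c + e) hceil (update_apply_of_ne_eq hby _ hPb) (Function.update_self ..) (onFloor_update_of_ne hay _ ha)
    · intro Z hZ hch y a b v t c hay hby hc ht hlow hn hZy ha hb
      obtain ⟨ta, ca, ka, hca, hta, -, hZa⟩ := exists_ray_of_charged (hU.1 Z hZ a) (hch a)
      have hta0 : ta = 0 := node_zero_of_onFloor (by omega) hZa ha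
      subst hta0
      obtain ⟨d, hd1, hdt, hmem⟩ := upper_mem_of_floor_ceiling hU (hS.1.1 Z hZ) hay hca hc ht hZa hZy
      rcases lt_or_eq_of_le hdt with hint | hfloor
      · exact ih.1 _ hmem (allCharged_update hch y (ray_charged (t - 2 * d) v (by omega))) hay hby (by omega : 1 ≤ c + d)
          (by omega : 0 < t - 2 * d) (by omega) (by omega) (Function.update_self ..) (onFloor_update_of_ne hay _ ha)
          (onCeiling_update_of_ne hby _ hb)
      · have hy0 : Function.update Z y (ray ((t - 2 * d, 0, 0) : BPoint) v (c + d)) y = ray ((0, 0, 0) : BPoint) v (c + d) := by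
          rw [Function.update_self, show t - 2 * d = 0 by omega]
        exact no_two_floor_upper hU hS hpos noN noP hmem (allCharged_update hch y (ray_charged (t - 2 * d) v (by omega))) hay hca
          (by omega : 1 ≤ c + d) (update_apply_of_ne_eq hay _ hZa) hy0 (onCeiling_update_of_ne hby _ hb)

/-- **THE FULLY-CHARGED HALF OF `Saturation lawSS h`, lower level — PROVED for every `h > 0`**: under the no-three-charged core NO fully charged
bi-anchored `N`-cell exists in a static support in `◇_h`.  (Pigeonhole: two floor letters → FR, two ceiling letters → CR, else a third letter is interior → IN.) -/
theorem no_fullyCharged_lower {h : ℤ} {C : MConfig} (hU : C.InDiamond h) (hS : C.StaticH1) (hpos : 0 < h)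
    (noN : ∀ Z ∈ C.lower, BiAnchored h Z → ThreeCharged Z → False) (noP : ∀ P ∈ C.upper, BiAnchored h P → ThreeCharged P → False)
    {Z : MCell} (hZ : Z ∈ C.lower) (hch : ∀ f, (Z f).2 ≠ (0, 0)) (hB : BiAnchored h Z) : False := by
  obtain ⟨⟨a, ha⟩, ⟨b, hb⟩⟩ := hB
  obtain ⟨ta, ca, ka, hca, hta, -, hZa⟩ := exists_ray_of_charged (hU.1 Z hZ a) (hch a)
  obtain ⟨tb, cb, kb, hcb, htb, -, hZb⟩ := exists_ray_of_charged (hU.1 Z hZ b) (hch b)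
  have hta0 : ta = 0 := node_zero_of_onFloor (by omega) hZa ha
  subst hta0
  have hhb : tb + 2 * cb = h := line_eq_of_onCeiling (by omega) hZb hb
  by_cases hF : ∃ a', a' ≠ a ∧ OnFloor (Z a')
  · obtain ⟨a', ha', hfa'⟩ := hF
    obtain ⟨ta', ca', ka', hca', hta', -, hZa'⟩ := exists_ray_of_charged (hU.1 Z hZ a') (hch a')
    have hz : ta' = 0 := node_zero_of_onFloor (by omega) hZa' hfa'
    subst hz
    exact no_two_floor_lower hU hS hpos noN noP hZ hch (Ne.symm ha') hca hca' hZa hZa' hb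
  by_cases hCe : ∃ b', b' ≠ b ∧ OnCeiling h (Z b')
  · obtain ⟨b', hb', hcb'⟩ := hCe
    obtain ⟨tb', cb', kb', hcb'', htb', -, hZb'⟩ := exists_ray_of_charged (hU.1 Z hZ b') (hch b')
    have hhb' : tb' + 2 * cb' = h := line_eq_of_onCeiling (by omega) hZb' hcb'
    exact no_two_ceiling_lower hU hS hpos noN noP hZ hch (Ne.symm hb') hcb hhb hcb'' hhb' hZb hZb' ha
  push Not at hF hCe
  obtain ⟨y, hya, hyb⟩ := exists_ne_ne a b
  obtain ⟨t, c, v, hc, ht, hl, hZy⟩ := exists_ray_of_charged (hU.1 Z hZ y) (hch y)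
  have ht0 : t ≠ 0 := by
    intro e; subst e; exact hF y hya (onFloor_of_eq (by omega) hZy)
  have hlh : t + 2 * c ≠ h := fun e => hCe y hyb (onCeiling_of_eq (by omega) e hZy)
  exact (no_interior hU hS hpos noN noP (Int.toNat (h - 2 * c))).2 Z hZ hch (Ne.symm hya) (Ne.symm hyb) hc (by omega) (by omega)
    (Int.self_le_toNat _) hZy ha hb

/-- **THE FULLY-CHARGED HALF OF `Saturation lawSS h`, upper level — PROVED for every `h > 0`.** -/
theorem no_fullyCharged_upper {h : ℤ} {C : MConfig} (hU : C.InDiamond h) (hS : C.StaticH1) (hpos : 0 < h)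
    (noN : ∀ Z ∈ C.lower, BiAnchored h Z → ThreeCharged Z → False) (noP : ∀ P ∈ C.upper, BiAnchored h P → ThreeCharged P → False)
    {P : MCell} (hP : P ∈ C.upper) (hch : ∀ f, (P f).2 ≠ (0, 0)) (hB : BiAnchored h P) : False := by
  obtain ⟨⟨a, ha⟩, ⟨b, hb⟩⟩ := hB
  obtain ⟨ta, ca, ka, hca, hta, -, hPa⟩ := exists_ray_of_charged (hU.2 P hP a) (hch a)
  obtain ⟨tb, cb, kb, hcb, htb, -, hPb⟩ := exists_ray_of_charged (hU.2 P hP b) (hch b)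
  have hta0 : ta = 0 := node_zero_of_onFloor (by omega) hPa ha
  subst hta0
  have hhb : tb + 2 * cb = h := line_eq_of_onCeiling (by omega) hPb hb
  by_cases hF : ∃ a', a' ≠ a ∧ OnFloor (P a')
  · obtain ⟨a', ha', hfa'⟩ := hF
    obtain ⟨ta', ca', ka', hca', hta', -, hPa'⟩ := exists_ray_of_charged (hU.2 P hP a') (hch a')
    have hz : ta' = 0 := node_zero_of_onFloor (by omega) hPa' hfa'
    subst hz
    exact no_two_floor_upper hU hS hpos noN noP hP hch (Ne.symm ha') hca hca' hPa hPa' hb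
  by_cases hCe : ∃ b', b' ≠ b ∧ OnCeiling h (P b')
  · obtain ⟨b', hb', hcb'⟩ := hCe
    obtain ⟨tb', cb', kb', hcb'', htb', -, hPb'⟩ := exists_ray_of_charged (hU.2 P hP b') (hch b')
    have hhb' : tb' + 2 * cb' = h := line_eq_of_onCeiling (by omega) hPb' hcb'
    exact no_two_ceiling_upper hU hS hpos noN noP hP hch (Ne.symm hb') hcb hhb hcb'' hhb' hPb hPb' ha
  push Not at hF hCe
  obtain ⟨y, hya, hyb⟩ := exists_ne_ne a b
  obtain ⟨t, c, v, hc, ht, hl, hPy⟩ := exists_ray_of_charged (hU.2 P hP y) (hch y)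
  have ht0 : t ≠ 0 := by
    intro e; subst e; exact hF y hya (onFloor_of_eq (by omega) hPy)
  have hlh : t + 2 * c ≠ h := fun e => hCe y hyb (onCeiling_of_eq (by omega) e hPy)
  exact (no_interior hU hS hpos noN noP (Int.toNat (h - 2 * c))).1 P hP hch (Ne.symm hya) (Ne.symm hyb) hc (by omega) (by omega)
    (Int.self_le_toNat _) hPy ha hb

/-- **corollary in the language of `Saturation`**: under the `lawSS` core hypothesis of `Saturation lawSS h` (`h > 0`), every FULLY CHARGED bi-anchored
cell of either level obeys `lawSS` (indeed any law: there is no such cell). -/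
theorem saturation_lawSS_fullyCharged {h : ℤ} (hpos : 0 < h) {C : MConfig} (hU : C.InDiamond h) (hS : C.StaticH1)
    (H : (∀ Z ∈ C.lower, BiAnchored h Z → ThreeCharged Z → lawSS h false Z) ∧ ∀ P ∈ C.upper, BiAnchored h P → ThreeCharged P → lawSS h true P) :
    (∀ Z ∈ C.lower, BiAnchored h Z → (∀ f, (Z f).2 ≠ (0, 0)) → lawSS h false Z) ∧
    ∀ P ∈ C.upper, BiAnchored h P → (∀ f, (P f).2 ≠ (0, 0)) → lawSS h true P := by
  have noN : ∀ Z ∈ C.lower, BiAnchored h Z → ThreeCharged Z → False :=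
    fun Z hZ hB h3 => false_of_lawSS_three hpos hB h3 (H.1 Z hZ hB h3)
  have noP : ∀ P ∈ C.upper, BiAnchored h P → ThreeCharged P → False :=
    fun P hP hB h3 => false_of_lawSS_three hpos hB h3 (H.2 P hP hB h3)
  exact ⟨fun Z hZ hB hch => (no_fullyCharged_lower hU hS hpos noN noP hZ hch hB).elim,
    fun P hP hB hch => (no_fullyCharged_upper hU hS hpos noN noP hP hch hB).elim⟩

/-- **what is LEFT of `Saturation lawSS h` (v2.1), part 1 — the two-charged cells**: no bi-anchored cell with exactly two charged letters (NOT asserted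
as such; PROVED via §29–§31 for `lawS2`). -/
def SaturationTwo (h : ℤ) : Prop :=
  ∀ C : MConfig, C.InDiamond h → C.G1Closed → C.StaticH1 →
    ((∀ Z ∈ C.lower, BiAnchored h Z → ThreeCharged Z → False) ∧ ∀ P ∈ C.upper, BiAnchored h P → ThreeCharged P → False) →
    (∀ Z ∈ C.lower, BiAnchored h Z → chargedCount Z = 2 → False) ∧ ∀ P ∈ C.upper, BiAnchored h P → chargedCount P = 2 → False

/-- **what is LEFT of `Saturation lawSS h` (v2.1), part 2 — the thin cells**: … every bi-anchored THIN cell (`q ≤ 1`) obeys the thin-apex law.  NOT asserted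
(128 rows at `◇₆`). -/
def SaturationThin (h : ℤ) : Prop :=
  ∀ C : MConfig, C.InDiamond h → C.G1Closed → C.StaticH1 →
    ((∀ Z ∈ C.lower, BiAnchored h Z → ThreeCharged Z → False) ∧ ∀ P ∈ C.upper, BiAnchored h P → ThreeCharged P → False) →
    (∀ Z ∈ C.lower, BiAnchored h Z → ThinCell Z → thinApexLaw h false Z) ∧ ∀ P ∈ C.upper, BiAnchored h P → ThinCell P → thinApexLaw h true P

/-- the four values of the charged count of a bi-anchored cell, and what each part of v2.1 says about it. -/
theorem lawSS_of_parts_cell {h : ℤ} {b : Bool} {Z : MCell}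
    (h4 : (∀ f, (Z f).2 ≠ (0, 0)) → False) (h3 : ThreeCharged Z → lawSS h b Z) (h2 : chargedCount Z = 2 → False)
    (h1 : ThinCell Z → thinApexLaw h b Z) : lawSS h b Z := by
  have hle : chargedCount Z ≤ 4 := (card_le_univ _).trans (by simp)
  by_cases hq4 : chargedCount Z = 4
  · exact (h4 ((allCharged_iff_count_four Z).2 hq4)).elim
  by_cases hq3 : chargedCount Z = 3
  · exact h3 hq3
  by_cases hq2 : chargedCount Z = 2
  · exact (h2 hq2).elim
  have hthin : ThinCell Z := by dsimp only [ThinCell]; omega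
  have hlc : lcLaw h b Z := fun hnt => absurd hthin hnt
  have hlad : chargeLadderLaw h b Z := fun hnt => absurd hthin hnt
  exact ⟨hlc, hlad, h1 hthin⟩

/-- **`Saturation lawSS h` REDUCED (v2.1, PROVED for every `h > 0`)**: the two remaining typed parts imply it — the fully charged part is the theorem above
and the three-charged part is the hypothesis itself. -/
theorem saturation_lawSS_of_parts {h : ℤ} (hpos : 0 < h) (H2 : SaturationTwo h) (H1 : SaturationThin h) : Saturation lawSS h := by
  intro C hU hG hS H
  have noN : ∀ Z ∈ C.lower, BiAnchored h Z → ThreeCharged Z → False :=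
    fun Z hZ hB h3 => false_of_lawSS_three hpos hB h3 (H.1 Z hZ hB h3)
  have noP : ∀ P ∈ C.upper, BiAnchored h P → ThreeCharged P → False :=
    fun P hP hB h3 => false_of_lawSS_three hpos hB h3 (H.2 P hP hB h3)
  have h2 := H2 C hU hG hS ⟨noN, noP⟩
  have h1 := H1 C hU hG hS ⟨noN, noP⟩
  exact ⟨fun Z hZ hB => lawSS_of_parts_cell (fun hch => no_fullyCharged_lower hU hS hpos noN noP hZ hch hB) (H.1 Z hZ hB) (h2.1 Z hZ hB)
      (h1.1 Z hZ hB),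
    fun P hP hB => lawSS_of_parts_cell (fun hch => no_fullyCharged_upper hU hS hpos noN noP hP hch hB) (H.2 P hP hB) (h2.2 P hP hB)
      (h1.2 P hP hB)⟩

/-- **the cone assembly with the v2.1 reduction plugged in**: base case + `NoThree` (T1-core) + the two remaining saturation parts + transport, at every
even height `≥ 4`, give line confinement of the whole forward cone.  (Nothing here is asserted; the hypotheses are the typed open obligations.) -/
theorem coneLineConfinement_of_noThree (base : Confined lawSS 2)
    (core : ∀ k : ℕ, 2 ≤ k → NoThree (2 * (k : ℤ))) (two : ∀ k : ℕ, 2 ≤ k → SaturationTwo (2 * (k : ℤ)))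
    (thin : ∀ k : ℕ, 2 ≤ k → SaturationThin (2 * (k : ℤ))) (tr : ∀ k : ℕ, 2 ≤ k → Transport lawSS (2 * (k : ℤ))) : ConeLineConfinement :=
  coneLineConfinement_of_core_lawSS base
    (fun k hk => (coreStep_lawSS_iff_noThree (by omega)).2 (core k hk))
    (fun k hk => saturation_lawSS_of_parts (by omega) (two k hk) (thin k hk)) tr


/-! ## §29 (v2.2) The TWO-CHARGED half: every bi-anchored `q = 2` cell is a CORNER CELL; the programme law `L*₂ = lawS2` (PROVED ∀ h > 0)

(A1) `no_apex_of_two_lower ∕ _upper`: a bi-anchored two-charged cell has no apex off its anchor level (every service of the apex charges it into a core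
cell); (A2) `cornerN_of_two_lower ∕ cornerP_of_two_upper`: the survivors are `N = [(h∕2)·ℓ_u | c·ℓ_v | O | O]`, `P = [(h∕2)·ℓ_u | y_ceiling | hI | hI]`
(engines `upper_mem_of_origin_node`, `lower_mem_of_top_line`).  `lawS2 := lcLaw ∧ chargeLadderLaw` kills every bi-anchored thick cell and thin cells obey
it, so `saturation_lawS2_iff : Saturation lawS2 h ↔ (core ⇒ NoCorner h)`.  Rule D alone never kills a corner cell (instrument: residue 14 ∕ 22 ∕ 30 at
◇₄ ∕ ◇₆ ∕ ◇₈ = exactly the corner family; sketch §13 (M1)). -/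

/-- **node service downward forced by the ORIGIN (N side, PROVED, h-uniform)**: with `O` on `f₀` and `t₁·I + c₁·ℓ_v`, `t₁ > 0`, on `f₁`, the cell with
`f₁ ↦ (t₁-2d)·I + (c₁+d)·ℓ_v` lies in `C.upper` for some `d ≥ 1`, `2d ≤ t₁`. -/
theorem upper_mem_of_origin_node {h : ℤ} {C : MConfig} (hU : C.InDiamond h) {Z : MCell} (hD : RuleDMu4N C Z)
    {f₀ f₁ k₁ : Fin 4} (hf : f₀ ≠ f₁) {t₁ c₁ : ℤ} (hc₁ : 1 ≤ c₁) (ht₁ : 0 < t₁)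
    (h0 : Z f₀ = ((0, 0, 0) : BPoint)) (h1 : Z f₁ = ray ((t₁, 0, 0) : BPoint) k₁ c₁) :
    ∃ d, 1 ≤ d ∧ 2 * d ≤ t₁ ∧ Function.update Z f₁ (ray ((t₁ - 2 * d, 0, 0) : BPoint) k₁ (c₁ + d)) ∈ C.upper := by
  have hne : coord (Z f₁) (k₁ + 2) ≠ 0 := by rw [h1, coord_ray_apex_antip]; omega
  obtain ⟨r, hr, P, hP, hagree, hlt, hray⟩ :=
    settledBelow_of_origin hU hD h0 (Ne.symm hf) (by rw [h1]; exact adapted_ray_apex_antip t₁ c₁ k₁) hne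
  rw [h1] at hray hlt
  have hd : 0 < (ray ((t₁, 0, 0) : BPoint) k₁ c₁).1 - (P f₁).1 := by simp at hlt ⊢; omega
  have hrk : r ≠ k₁ := by
    intro hrk; apply hr; rw [hrk]; fin_cases k₁ <;> decide
  obtain ⟨-, hdt, hpt⟩ := ceiling_charge_premove hc₁ hd hrk hray (hU.2 P hP f₁)
  refine ⟨(ray ((t₁, 0, 0) : BPoint) k₁ c₁).1 - (P f₁).1, by omega, hdt, ?_⟩
  have hPeq : P = Function.update Z f₁ (ray ((t₁ - 2 * ((ray ((t₁, 0, 0) : BPoint) k₁ c₁).1 - (P f₁).1), 0, 0) : BPoint) k₁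
      (c₁ + ((ray ((t₁, 0, 0) : BPoint) k₁ c₁).1 - (P f₁).1))) := by
    funext g
    by_cases hg : g = f₁
    · subst hg; simp only [Function.update_self]; exact hpt
    · rw [Function.update_of_ne hg]; exact hagree g hg
  rw [← hPeq]; exact hP

/-- **line service upward forced by the TOP APEX (P side, PROVED, h-uniform)**: with `hI` on `f₀` and `t·I + c·ℓ_v` below the ceiling on `y`, the cell
with `y ↦ t·I + (c+e)·ℓ_v` lies in `C.lower` for some `e ≥ 1`, `t + 2(c+e) ≤ h`. -/
theorem lower_mem_of_top_line {h : ℤ} {C : MConfig} (hU : C.InDiamond h) {P : MCell} (hD : RuleDMu4P C P)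
    {f₀ y v : Fin 4} (hf : f₀ ≠ y) {t c : ℤ} (hc : 1 ≤ c) (hlow : t + 2 * c < h)
    (h0 : P f₀ = ((h, 0, 0) : BPoint)) (h1 : P y = ray ((t, 0, 0) : BPoint) v c) :
    ∃ e, 1 ≤ e ∧ t + 2 * (c + e) ≤ h ∧ Function.update P y (ray ((t, 0, 0) : BPoint) v (c + e)) ∈ C.lower := by
  have hne : coord (P y) v ≠ h := by rw [h1, coord_ray_apex_self]; omega
  obtain ⟨r, hr, N, hN, hagree, hlt, hray⟩ :=
    settledAbove_of_top hU hD h0 (Ne.symm hf) (by rw [h1]; exact adapted_ray_apex_self t c v) hne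
  rw [h1] at hray hlt
  have he : 0 < (N y).1 - (ray ((t, 0, 0) : BPoint) v c).1 := by simp at hlt ⊢; omega
  have hyD : InDiamond h (ray (ray ((t, 0, 0) : BPoint) v c) r ((N y).1 - (ray ((t, 0, 0) : BPoint) v c).1)) := by
    rw [← hray]; exact hU.1 N hN y
  obtain ⟨hrk, hline⟩ := charge_move hc he hr hyD
  subst hrk
  rw [ray_ray_self] at hray
  refine ⟨(N y).1 - (ray ((t, 0, 0) : BPoint) r c).1, by omega, hline, ?_⟩
  have hNeq : N = Function.update P y (ray ((t, 0, 0) : BPoint) r (c + ((N y).1 - (ray ((t, 0, 0) : BPoint) r c).1))) := by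
    funext g
    by_cases hg : g = y
    · subst hg; simp only [Function.update_self]; exact hray
    · rw [Function.update_of_ne hg]; exact (hagree g hg).symm
  rw [← hNeq]; exact hN

/-- an uncharged letter on the floor is the origin … -/
theorem eq_origin_of_onFloor {x : BPoint} (hx : x.2 = (0, 0)) (hf : OnFloor x) : x = ((0, 0, 0) : BPoint) := by
  obtain ⟨a, b1, b2⟩ := x
  simp only [Prod.ext_iff] at hx
  obtain ⟨rfl, rfl⟩ := hx
  have ha : a = 0 := by simpa [OnFloor, absCharge, chargeOf] using hf
  subst ha; rfl

/-- … and on the ceiling, the top apex. -/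
theorem eq_top_of_onCeiling {h : ℤ} {x : BPoint} (hx : x.2 = (0, 0)) (hc : OnCeiling h x) : x = ((h, 0, 0) : BPoint) := by
  obtain ⟨a, b1, b2⟩ := x
  simp only [Prod.ext_iff] at hx
  obtain ⟨rfl, rfl⟩ := hx
  have ha : a = h := by simpa [OnCeiling, absCharge, chargeOf] using hc
  subst ha; rfl

/-- an uncharged letter is an apex `t·I`. -/
theorem eq_apex_of_uncharged {x : BPoint} (hx : x.2 = (0, 0)) : x = ((x.1, 0, 0) : BPoint) := by
  obtain ⟨a, b1, b2⟩ := x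
  simp only [Prod.ext_iff] at hx
  obtain ⟨rfl, rfl⟩ := hx
  rfl

/-- replacing a charged letter by a charged letter keeps the charged count. -/
theorem chargedCount_update_of_charged {Z : MCell} {f₁ : Fin 4} (h1 : (Z f₁).2 ≠ (0, 0)) {x : BPoint} (hx : x.2 ≠ (0, 0)) :
    chargedCount (Function.update Z f₁ x) = chargedCount Z := by
  dsimp only [chargedCount]
  congr 1
  ext f
  simp only [mem_filter, mem_univ, true_and]
  by_cases hf : f = f₁
  · subst hf; rw [Function.update_self]; exact ⟨fun _ => h1, fun _ => hx⟩
  · rw [Function.update_of_ne hf]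

theorem chargedCount_le_four (Z : MCell) : chargedCount Z ≤ 4 := (card_le_univ _).trans (by simp)

/-- in a two-charged cell, next to a charged letter there is another charged letter … -/
theorem exists_charged_ne {Z : MCell} (hq : chargedCount Z = 2) (a : Fin 4) : ∃ b, b ≠ a ∧ (Z b).2 ≠ (0, 0) := by
  obtain ⟨x, y, hxy, hs⟩ := card_eq_two.1 hq
  have hx : (Z x).2 ≠ (0, 0) := by
    have : x ∈ (univ.filter fun f : Fin 4 => (Z f).2 ≠ (0, 0)) := by rw [hs]; simp
    simpa using this
  have hy : (Z y).2 ≠ (0, 0) := by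
    have : y ∈ (univ.filter fun f : Fin 4 => (Z f).2 ≠ (0, 0)) := by rw [hs]; simp
    simpa using this
  by_cases hxa : x = a
  · subst hxa; exact ⟨y, Ne.symm hxy, hy⟩
  · exact ⟨x, hxa, hx⟩

/-- … and the two other letters are uncharged. -/
theorem uncharged_of_two {Z : MCell} (hq : chargedCount Z = 2) {a b : Fin 4} (hab : a ≠ b) (ha : (Z a).2 ≠ (0, 0)) (hb : (Z b).2 ≠ (0, 0))
    (f : Fin 4) (hfa : f ≠ a) (hfb : f ≠ b) : (Z f).2 = (0, 0) := by
  by_contra hf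
  have hsub : ({a, b, f} : Finset (Fin 4)) ⊆ (univ.filter fun g : Fin 4 => (Z g).2 ≠ (0, 0)) := by
    intro x hx
    simp only [mem_insert, mem_singleton] at hx
    rcases hx with rfl | rfl | rfl <;> simpa
  have h3 : ({a, b, f} : Finset (Fin 4)).card = 3 := card_eq_three.2 ⟨a, b, f, hab, Ne.symm hfa, Ne.symm hfb, rfl⟩
  have := card_le_card hsub
  rw [h3] at this
  have hq' : (univ.filter fun g : Fin 4 => (Z g).2 ≠ (0, 0)).card = 2 := hq
  omega

/-- two distinct charged letters make a cell thick. -/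
theorem not_thin_of_two_charged {Z : MCell} {a b : Fin 4} (hab : a ≠ b) (ha : (Z a).2 ≠ (0, 0)) (hb : (Z b).2 ≠ (0, 0)) : ¬ ThinCell Z := by
  intro hth
  have hsub : ({a, b} : Finset (Fin 4)) ⊆ (univ.filter fun g : Fin 4 => (Z g).2 ≠ (0, 0)) := by
    intro x hx
    simp only [mem_insert, mem_singleton] at hx
    rcases hx with rfl | rfl <;> simpa
  have h2 : ({a, b} : Finset (Fin 4)).card = 2 := card_eq_two.2 ⟨a, b, hab, rfl⟩
  have := card_le_card hsub
  rw [h2] at this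
  have hq' : (univ.filter fun g : Fin 4 => (Z g).2 ≠ (0, 0)).card ≤ 1 := hth
  omega

/-- **(A1) N side — PROVED for every `h`**: under the no-three-charged core (P side), a bi-anchored two-charged `N`-cell has NO apex letter `t·I` with `t ≠ 0`. -/
theorem no_apex_of_two_lower {h : ℤ} {C : MConfig} (hU : C.InDiamond h) (hS : C.StaticH1)
    (noP : ∀ P ∈ C.upper, BiAnchored h P → ThreeCharged P → False)
    {Z : MCell} (hZ : Z ∈ C.lower) (hq : chargedCount Z = 2) (hB : BiAnchored h Z)
    {f₁ : Fin 4} {t : ℤ} (h1 : Z f₁ = ((t, 0, 0) : BPoint)) (ht : t ≠ 0) : False := by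
  obtain ⟨⟨f₀, hf0⟩, ⟨g, hg⟩⟩ := hB
  have hf : f₀ ≠ f₁ := by
    rintro rfl
    rw [h1] at hf0
    have : t = 0 := by simpa [OnFloor, absCharge, chargeOf] using hf0
    exact ht this
  obtain ⟨P, hP, r, d, hd, hagree, hray, hsum⟩ : ∃ P ∈ C.upper, ∃ r : Fin 4, ∃ d : ℤ, 1 ≤ d ∧ (∀ g, g ≠ f₁ → P g = Z g) ∧
      ray (P f₁) r d = (t, 0, 0) ∧ (P f₁).1 + d = t := by
    by_cases hch : (Z f₀).2 = (0, 0)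
    · exact upper_mem_of_origin_apex hU (hS.1.1 Z hZ) hf (eq_origin_of_onFloor hch hf0) h1 ht
    · obtain ⟨t₀, c₀, k₀, hc₀, -, -, h0⟩ := exists_ray_of_charged (hU.1 Z hZ f₀) hch
      have ht0 : t₀ = 0 := node_zero_of_onFloor (by omega) h0 hf0
      subst ht0
      exact upper_mem_of_floor_apex hU (hS.1.1 Z hZ) hf hc₀ h0 h1 ht
  have hzc : absCharge (P f₁) = d := absCharge_of_ray_eq_apex (by omega) hray
  have hPeq : P = Function.update Z f₁ (P f₁) := by
    funext g'
    by_cases hg' : g' = f₁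
    · subst hg'; simp
    · rw [Function.update_of_ne hg']; exact hagree g' hg'
  have hx : (P f₁).2 ≠ (0, 0) := by
    intro h0'
    have : absCharge (P f₁) = 0 := by simp [absCharge, chargeOf, h0']
    omega
  have h3 : ThreeCharged P := by
    show chargedCount P = 3
    rw [hPeq, chargedCount_update_charged (by rw [h1]) hx, hq]
  refine noP P hP ⟨⟨f₀, by rw [hagree f₀ hf]; exact hf0⟩, ?_⟩ h3
  by_cases hg1 : g = f₁
  · subst hg1
    have hth : t = h := by rw [h1] at hg; simpa [OnCeiling, absCharge, chargeOf] using hg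
    exact ⟨g, by show (P g).1 + absCharge (P g) = h; rw [hzc]; omega⟩
  · exact ⟨g, by rw [hagree g hg1]; exact hg⟩

/-- **(A1) P side — PROVED for every `h`**: under the core (N side), a bi-anchored two-charged `P`-cell has NO apex letter `t·I` with `t ≠ h`. -/
theorem no_apex_of_two_upper {h : ℤ} {C : MConfig} (hU : C.InDiamond h) (hS : C.StaticH1)
    (noN : ∀ Z ∈ C.lower, BiAnchored h Z → ThreeCharged Z → False)
    {P : MCell} (hP : P ∈ C.upper) (hq : chargedCount P = 2) (hB : BiAnchored h P)
    {f₁ : Fin 4} {t : ℤ} (h1 : P f₁ = ((t, 0, 0) : BPoint)) (ht : t ≠ h) : False := by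
  obtain ⟨⟨a, ha⟩, ⟨f₀, hf0⟩⟩ := hB
  have hf : f₀ ≠ f₁ := by
    rintro rfl
    rw [h1] at hf0
    have : t = h := by simpa [OnCeiling, absCharge, chargeOf] using hf0
    exact ht this
  obtain ⟨r, e, he, hmem⟩ : ∃ r : Fin 4, ∃ e : ℤ, 1 ≤ e ∧ Function.update P f₁ (ray ((t, 0, 0) : BPoint) r e) ∈ C.lower := by
    by_cases hch : (P f₀).2 = (0, 0)
    · exact lower_mem_of_top_apex hU (hS.1.2 P hP) hf (eq_top_of_onCeiling hch hf0) h1 ht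
    · obtain ⟨t₀, c₀, k₀, hc₀, -, -, h0⟩ := exists_ray_of_charged (hU.2 P hP f₀) hch
      exact lower_mem_of_ceiling_apex hU (hS.1.2 P hP) hf hc₀ (line_eq_of_onCeiling (by omega) h0 hf0) h0 h1 ht
  have h3 : ThreeCharged (Function.update P f₁ (ray ((t, 0, 0) : BPoint) r e)) := by
    show chargedCount _ = 3
    rw [chargedCount_update_charged (by rw [h1]) (ray_charged t r he), hq]
  refine noN _ hmem ⟨?_, ⟨f₀, onCeiling_update_of_ne hf _ hf0⟩⟩ h3
  by_cases ha1 : a = f₁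
  · subst ha1
    have ht0 : t = 0 := by rw [h1] at ha; simpa [OnFloor, absCharge, chargeOf] using ha
    subst ht0
    exact ⟨a, onFloor_of_eq (Z := Function.update P a (ray ((0, 0, 0) : BPoint) r e)) (f := a) (by omega) (Function.update_self ..)⟩
  · exact ⟨a, onFloor_update_of_ne ha1 _ ha⟩

/-- **THE CORNER `N`-CELLS** `[(h∕2)·ℓ_u | c·ℓ_v | O | O]` (`c ≥ 1`; at `◇₆`: `N[O|O|x|3ℓ]`, 11 directed classes). -/
def CornerN (h : ℤ) (Z : MCell) : Prop :=
  ∃ a b u v : Fin 4, ∃ m c : ℤ, a ≠ b ∧ 2 * m = h ∧ 1 ≤ c ∧ Z a = ray ((0, 0, 0) : BPoint) u m ∧ Z b = ray ((0, 0, 0) : BPoint) v c ∧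
    ∀ f, f ≠ a → f ≠ b → Z f = ((0, 0, 0) : BPoint)

/-- **THE CORNER `P`-CELLS** `[(h∕2)·ℓ_u | t·I + c·ℓ_v (ceiling: t + 2c = h) | hI | hI]` (at `◇₆`: `P[3ℓ|x|6I|6I]`, 11 directed classes). -/
def CornerP (h : ℤ) (P : MCell) : Prop :=
  ∃ a b u v : Fin 4, ∃ m t c : ℤ, a ≠ b ∧ 2 * m = h ∧ 1 ≤ c ∧ t + 2 * c = h ∧ P a = ray ((0, 0, 0) : BPoint) u m ∧
    P b = ray ((t, 0, 0) : BPoint) v c ∧ ∀ f, f ≠ a → f ≠ b → P f = ((h, 0, 0) : BPoint)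

/-- **`NoCorner h`**: no corner cell on either level (PROVED for static supports in §30–§31; NOT a rule-D fact). -/
def NoCorner (h : ℤ) : Prop :=
  ∀ C : MConfig, C.InDiamond h → C.G1Closed → C.StaticH1 → (∀ Z ∈ C.lower, ¬ CornerN h Z) ∧ ∀ P ∈ C.upper, ¬ CornerP h P

/-- **(A2) N side — every bi-anchored two-charged `N`-cell is a corner cell (PROVED for every `h > 0`).** -/
theorem cornerN_of_two_lower {h : ℤ} {C : MConfig} (hU : C.InDiamond h) (hS : C.StaticH1) (hpos : 0 < h)
    (noN : ∀ Z ∈ C.lower, BiAnchored h Z → ThreeCharged Z → False) (noP : ∀ P ∈ C.upper, BiAnchored h P → ThreeCharged P → False)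
    {Z : MCell} (hZ : Z ∈ C.lower) (hq : chargedCount Z = 2) (hB : BiAnchored h Z) : CornerN h Z := by
  -- (A1): every uncharged letter is the origin
  have hap : ∀ f, (Z f).2 = (0, 0) → Z f = ((0, 0, 0) : BPoint) := by
    intro f hf
    have e := eq_apex_of_uncharged hf
    by_cases ht : (Z f).1 = 0
    · rw [e, ht]
    · exact (no_apex_of_two_lower hU hS noP hZ hq hB e ht).elim
  obtain ⟨⟨f₀, hf0⟩, ⟨a, ha⟩⟩ := hB
  -- the ceiling anchor `a` is charged (else it is the origin on line `h > 0`)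
  have hach : (Z a).2 ≠ (0, 0) := by
    intro h0
    have e := hap a h0
    rw [e] at ha
    have : (0 : ℤ) = h := by simpa [OnCeiling, absCharge, chargeOf] using ha
    omega
  obtain ⟨ta, m, u, hm, hta, -, hZa⟩ := exists_ray_of_charged (hU.1 Z hZ a) hach
  have hha : ta + 2 * m = h := line_eq_of_onCeiling (by omega) hZa ha
  -- the other charged letter `b`, and an origin letter `o`
  obtain ⟨b, hba, hbch⟩ := exists_charged_ne hq a
  obtain ⟨tb, c, v, hc, htb, -, hZb⟩ := exists_ray_of_charged (hU.1 Z hZ b) hbch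
  have hoth : ∀ f, f ≠ a → f ≠ b → Z f = ((0, 0, 0) : BPoint) :=
    fun f hfa hfb => hap f (uncharged_of_two hq (Ne.symm hba) hach hbch f hfa hfb)
  obtain ⟨o, hoa, hob⟩ := exists_ne_ne a b
  have hZo : Z o = ((0, 0, 0) : BPoint) := hoth o hoa hob
  have hflo : OnFloor (Z o) := by rw [hZo]; simp [OnFloor, absCharge, chargeOf]
  -- `a` is the corner: otherwise the origin forces its node service down into a two-charged `P`-cell with the apex `O`
  have hta0 : ta = 0 := by
    by_contra hne
    obtain ⟨d, hd1, hdt, hmem⟩ := upper_mem_of_origin_node hU (hS.1.1 Z hZ) hoa hm (by omega) hZo hZa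
    refine no_apex_of_two_upper hU hS noN hmem ?_ ⟨⟨o, onFloor_update_of_ne hoa _ hflo⟩,
      ⟨a, onCeiling_of_eq (f := a) (by omega) (by omega : (ta - 2 * d) + 2 * (m + d) = h) (Function.update_self ..)⟩⟩
      (f₁ := o) (t := 0) (update_apply_of_ne_eq hoa _ hZo) (by omega)
    rw [chargedCount_update_of_charged hach (ray_charged _ _ (by omega)), hq]
  subst hta0
  -- `b` is a floor letter: otherwise the same move on `b`
  have htb0 : tb = 0 := by
    by_contra hne
    obtain ⟨d, hd1, hdt, hmem⟩ := upper_mem_of_origin_node hU (hS.1.1 Z hZ) hob hc (by omega) hZo hZb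
    refine no_apex_of_two_upper hU hS noN hmem ?_ ⟨⟨o, onFloor_update_of_ne hob _ hflo⟩,
      ⟨a, onCeiling_update_of_ne (Ne.symm hba) _ ha⟩⟩ (f₁ := o) (t := 0) (update_apply_of_ne_eq hob _ hZo) (by omega)
    rw [chargedCount_update_of_charged hbch (ray_charged _ _ (by omega)), hq]
  subst htb0
  exact ⟨a, b, u, v, m, c, Ne.symm hba, by omega, hc, hZa, hZb, hoth⟩

/-- **(A2) P side — every bi-anchored two-charged `P`-cell is a corner cell (PROVED for every `h > 0`).** -/
theorem cornerP_of_two_upper {h : ℤ} {C : MConfig} (hU : C.InDiamond h) (hS : C.StaticH1) (hpos : 0 < h)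
    (noN : ∀ Z ∈ C.lower, BiAnchored h Z → ThreeCharged Z → False) (noP : ∀ P ∈ C.upper, BiAnchored h P → ThreeCharged P → False)
    {P : MCell} (hP : P ∈ C.upper) (hq : chargedCount P = 2) (hB : BiAnchored h P) : CornerP h P := by
  -- (A1): every uncharged letter is the top apex
  have hap : ∀ f, (P f).2 = (0, 0) → P f = ((h, 0, 0) : BPoint) := by
    intro f hf
    have e := eq_apex_of_uncharged hf
    by_cases ht : (P f).1 = h
    · rw [e, ht]
    · exact (no_apex_of_two_upper hU hS noN hP hq hB e ht).elim
  obtain ⟨⟨a, ha⟩, ⟨g, hg⟩⟩ := hB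
  -- the floor anchor `a` is charged (else it is `hI` on the floor, `h = 0`)
  have hach : (P a).2 ≠ (0, 0) := by
    intro h0
    have e := hap a h0
    rw [e] at ha
    have : h = 0 := by simpa [OnFloor, absCharge, chargeOf] using ha
    omega
  obtain ⟨ta, m, u, hm, hta, hlin, hPa⟩ := exists_ray_of_charged (hU.2 P hP a) hach
  have hta0 : ta = 0 := node_zero_of_onFloor (by omega) hPa ha
  subst hta0
  obtain ⟨b, hba, hbch⟩ := exists_charged_ne hq a
  obtain ⟨tb, c, v, hc, htb, hlinb, hPb⟩ := exists_ray_of_charged (hU.2 P hP b) hbch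
  have hoth : ∀ f, f ≠ a → f ≠ b → P f = ((h, 0, 0) : BPoint) :=
    fun f hfa hfb => hap f (uncharged_of_two hq (Ne.symm hba) hach hbch f hfa hfb)
  obtain ⟨o, hoa, hob⟩ := exists_ne_ne a b
  have hPo : P o = ((h, 0, 0) : BPoint) := hoth o hoa hob
  have hclo : OnCeiling h (P o) := by rw [hPo]; simp [OnCeiling, absCharge, chargeOf]
  -- `a` is the corner: otherwise the top apex forces its line service up into a two-charged `N`-cell with the apex `hI`
  have hm2 : 0 + 2 * m = h := by
    by_contra hne
    obtain ⟨e, he1, hle, hmem⟩ := lower_mem_of_top_line hU (hS.1.2 P hP) hoa hm (by omega) hPo hPa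
    refine no_apex_of_two_lower hU hS noP hmem ?_
      ⟨⟨a, onFloor_of_eq (f := a) (by omega) (Function.update_self ..)⟩, ⟨o, onCeiling_update_of_ne hoa _ hclo⟩⟩
      (f₁ := o) (t := h) (update_apply_of_ne_eq hoa _ hPo) (by omega)
    rw [chargedCount_update_of_charged hach (ray_charged _ _ (by omega)), hq]
  -- `b` is a ceiling letter: otherwise the same move on `b`
  have hcb : tb + 2 * c = h := by
    by_contra hne
    obtain ⟨e, he1, hle, hmem⟩ := lower_mem_of_top_line hU (hS.1.2 P hP) hob hc (by omega) hPo hPb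
    refine no_apex_of_two_lower hU hS noP hmem ?_
      ⟨⟨a, onFloor_update_of_ne (Ne.symm hba) _ ha⟩, ⟨o, onCeiling_update_of_ne hob _ hclo⟩⟩
      (f₁ := o) (t := h) (update_apply_of_ne_eq hob _ hPo) (by omega)
    rw [chargedCount_update_of_charged hbch (ray_charged _ _ (by omega)), hq]
  exact ⟨a, b, u, v, m, tb, c, Ne.symm hba, by omega, hc, hcb, hPa, hPb, hoth⟩

/-- corner cells are bi-anchored … -/
theorem biAnchored_of_cornerN {h : ℤ} (hpos : 0 < h) {Z : MCell} (hZ : CornerN h Z) : BiAnchored h Z := by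
  obtain ⟨a, b, u, v, m, c, hab, hm, hc, hZa, hZb, -⟩ := hZ
  exact ⟨⟨b, onFloor_of_eq (by omega) hZb⟩, ⟨a, onCeiling_of_eq (by omega) (by omega : 0 + 2 * m = h) hZa⟩⟩

theorem biAnchored_of_cornerP {h : ℤ} (hpos : 0 < h) {P : MCell} (hP : CornerP h P) : BiAnchored h P := by
  obtain ⟨a, b, u, v, m, t, c, hab, hm, hc, ht, hPa, hPb, -⟩ := hP
  exact ⟨⟨a, onFloor_of_eq (by omega) hPa⟩, ⟨b, onCeiling_of_eq (by omega) ht hPb⟩⟩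

/-- … and thick (for `h > 0`). -/
theorem not_thin_of_cornerN {h : ℤ} (hpos : 0 < h) {Z : MCell} (hZ : CornerN h Z) : ¬ ThinCell Z := by
  obtain ⟨a, b, u, v, m, c, hab, hm, hc, hZa, hZb, -⟩ := hZ
  exact not_thin_of_two_charged hab (by rw [hZa]; exact ray_charged 0 u (by omega)) (by rw [hZb]; exact ray_charged 0 v hc)

theorem not_thin_of_cornerP {h : ℤ} (hpos : 0 < h) {P : MCell} (hP : CornerP h P) : ¬ ThinCell P := by
  obtain ⟨a, b, u, v, m, t, c, hab, hm, hc, ht, hPa, hPb, -⟩ := hP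
  exact not_thin_of_two_charged hab (by rw [hPa]; exact ray_charged 0 u (by omega)) (by rw [hPb]; exact ray_charged t v hc)

/-- **`SaturationTwo h` FROM `NoCorner h` (PROVED for every `h > 0`)**: the two-charged part of T1-sat is exactly the corner statement. -/
theorem saturationTwo_of_noCorner {h : ℤ} (hpos : 0 < h) (H : NoCorner h) : SaturationTwo h := by
  intro C hU hG hS core
  obtain ⟨hN, hP⟩ := H C hU hG hS
  exact ⟨fun Z hZ hB hq => hN Z hZ (cornerN_of_two_lower hU hS hpos core.1 core.2 hZ hq hB),
    fun P hP' hB hq => hP P hP' (cornerP_of_two_upper hU hS hpos core.1 core.2 hP' hq hB)⟩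

/-! ### the programme law `L*₂ = lawS2`: `Saturation lawS2 h ⇔ core ⇒ no corner` -/

/-- **`lawS2` kills every bi-anchored THICK cell (`h > 0`)**: line confinement puts all four letters on the ceiling line, so the floor anchor is the corner
letter (node `0`, charge `h∕2`) — against the ladder (`≥ 2` on `P`, `≥ 4` on `N` for `q ≥ 2`) — or the origin (line `0 ≠ h`). -/
theorem false_of_lawS2_biAnchored_thick {h : ℤ} (hpos : 0 < h) {b : Bool} {Z : MCell} (hB : BiAnchored h Z) (hth : ¬ ThinCell Z)
    (hl : lawS2 h b Z) : False := by
  obtain ⟨⟨a, ha⟩, ⟨g, hg⟩⟩ := hB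
  obtain ⟨hlc, hlad⟩ := hl
  have ha' : (Z a).1 = absCharge (Z a) := ha
  have hg' : (Z g).1 + absCharge (Z g) = h := hg
  have e1 := ((hlc hth) a).trans ((hlc hth) g).symm
  by_cases hch : (Z a).2 = (0, 0)
  · have h0 : absCharge (Z a) = 0 := by
      simp only [Prod.ext_iff] at hch
      simp only [absCharge, chargeOf, hch.1, hch.2, sub_zero, abs_zero]
    omega
  · have hq := hlad hth a hch
    have h2 : 2 ≤ chargedCount Z := by
      have : ¬ chargedCount Z ≤ 1 := hth
      omega
    cases b <;> simp at hq <;> omega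

theorem false_of_lawS2_three {h : ℤ} (hpos : 0 < h) {b : Bool} {Z : MCell} (hB : BiAnchored h Z) (h3 : ThreeCharged Z)
    (hl : lawS2 h b Z) : False :=
  false_of_lawS2_biAnchored_thick hpos hB (by dsimp only [ThinCell]; rw [h3]; decide) hl

/-- thin cells obey `lawS2` trivially. -/
theorem lawS2_of_thin {h : ℤ} {b : Bool} {Z : MCell} (hth : ThinCell Z) : lawS2 h b Z :=
  ⟨fun hnt => absurd hth hnt, fun hnt => absurd hth hnt⟩

/-- `CoreStep lawS2 h` is LITERALLY the absence of bi-anchored three-charged cells (as for `lawSS`). -/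
theorem coreStep_lawS2_iff_noThree {h : ℤ} (hpos : 0 < h) : CoreStep lawS2 h ↔ NoThree h := by
  constructor
  · intro H C hU hG hS
    exact ⟨fun Z hZ hB h3 => false_of_lawS2_three hpos hB h3 ((H C hU hG hS).1 Z hZ hB h3),
      fun P hP hB h3 => false_of_lawS2_three hpos hB h3 ((H C hU hG hS).2 P hP hB h3)⟩
  · intro H C hU hG hS
    exact ⟨fun Z hZ hB h3 => ((H C hU hG hS).1 Z hZ hB h3).elim, fun P hP hB h3 => ((H C hU hG hS).2 P hP hB h3).elim⟩

/-- **`Saturation lawS2 h` at one support, FROM «no corner cell» (PROVED for every `h > 0`)** — the four values of the charged count: thin ⇒ trivial,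
`2` ⇒ corner (A2), `3` ⇒ the core, `4` ⇒ §28. -/
theorem biAnchored_lawS2_of_noCorner {h : ℤ} (hpos : 0 < h) {C : MConfig} (hU : C.InDiamond h) (hS : C.StaticH1)
    (noN : ∀ Z ∈ C.lower, BiAnchored h Z → ThreeCharged Z → False) (noP : ∀ P ∈ C.upper, BiAnchored h P → ThreeCharged P → False)
    (hN : ∀ Z ∈ C.lower, ¬ CornerN h Z) (hP : ∀ P ∈ C.upper, ¬ CornerP h P) :
    (∀ Z ∈ C.lower, BiAnchored h Z → lawS2 h false Z) ∧ ∀ P ∈ C.upper, BiAnchored h P → lawS2 h true P := by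
  refine ⟨fun Z hZ hB => ?_, fun P hP' hB => ?_⟩
  · by_cases hth : ThinCell Z
    · exact lawS2_of_thin hth
    · exfalso
      have hle := chargedCount_le_four Z
      have h2 : 2 ≤ chargedCount Z := by
        have : ¬ chargedCount Z ≤ 1 := hth
        omega
      rcases (by omega : chargedCount Z = 2 ∨ chargedCount Z = 3 ∨ chargedCount Z = 4) with hq | hq | hq
      · exact hN Z hZ (cornerN_of_two_lower hU hS hpos noN noP hZ hq hB)
      · exact noN Z hZ hB hq
      · exact no_fullyCharged_lower hU hS hpos noN noP hZ ((allCharged_iff_count_four Z).2 hq) hB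
  · by_cases hth : ThinCell P
    · exact lawS2_of_thin hth
    · exfalso
      have hle := chargedCount_le_four P
      have h2 : 2 ≤ chargedCount P := by
        have : ¬ chargedCount P ≤ 1 := hth
        omega
      rcases (by omega : chargedCount P = 2 ∨ chargedCount P = 3 ∨ chargedCount P = 4) with hq | hq | hq
      · exact hP P hP' (cornerP_of_two_upper hU hS hpos noN noP hP' hq hB)
      · exact noP P hP' hB hq
      · exact no_fullyCharged_upper hU hS hpos noN noP hP' ((allCharged_iff_count_four P).2 hq) hB

/-- **`Saturation lawS2 h ⇔ (core ⇒ no corner cell)`, support by support — PROVED for every `h > 0`.**  T1-sat for the programme law IS the corner statement. -/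
theorem saturation_lawS2_iff {h : ℤ} (hpos : 0 < h) : Saturation lawS2 h ↔
    ∀ C : MConfig, C.InDiamond h → C.G1Closed → C.StaticH1 →
      (∀ Z ∈ C.lower, BiAnchored h Z → ThreeCharged Z → False) → (∀ P ∈ C.upper, BiAnchored h P → ThreeCharged P → False) →
      (∀ Z ∈ C.lower, ¬ CornerN h Z) ∧ ∀ P ∈ C.upper, ¬ CornerP h P := by
  constructor
  · intro H C hU hG hS noN noP
    have H' := H C hU hG hS ⟨fun Z hZ hB h3 => (noN Z hZ hB h3).elim, fun P hP hB h3 => (noP P hP hB h3).elim⟩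
    exact ⟨fun Z hZ hc => false_of_lawS2_biAnchored_thick hpos (biAnchored_of_cornerN hpos hc) (not_thin_of_cornerN hpos hc) (H'.1 Z hZ (biAnchored_of_cornerN hpos hc)),
      fun P hP hc => false_of_lawS2_biAnchored_thick hpos (biAnchored_of_cornerP hpos hc) (not_thin_of_cornerP hpos hc) (H'.2 P hP (biAnchored_of_cornerP hpos hc))⟩
  · intro H C hU hG hS core
    have noN : ∀ Z ∈ C.lower, BiAnchored h Z → ThreeCharged Z → False :=
      fun Z hZ hB h3 => false_of_lawS2_three hpos hB h3 (core.1 Z hZ hB h3)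
    have noP : ∀ P ∈ C.upper, BiAnchored h P → ThreeCharged P → False :=
      fun P hP hB h3 => false_of_lawS2_three hpos hB h3 (core.2 P hP hB h3)
    obtain ⟨hN, hP⟩ := H C hU hG hS noN noP
    exact biAnchored_lawS2_of_noCorner hpos hU hS noN noP hN hP

/-- in particular `NoCorner h → Saturation lawS2 h`. -/
theorem saturation_lawS2_of_noCorner {h : ℤ} (hpos : 0 < h) (H : NoCorner h) : Saturation lawS2 h :=
  (saturation_lawS2_iff hpos).2 fun C hU hG hS _ _ => H C hU hG hS

/-- **CONE ASSEMBLY FOR `L*₂` (v2.2)**: base + `NoThree` + `NoCorner` + transport at every even height `≥ 4` ⇒ `ConeLineConfinement` (superseded by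
`coneLineConfinement_of_core_lawS2'`, §32). -/
theorem coneLineConfinement_of_noCorner (base : Confined lawS2 2)
    (core : ∀ k : ℕ, 2 ≤ k → NoThree (2 * (k : ℤ))) (corner : ∀ k : ℕ, 2 ≤ k → NoCorner (2 * (k : ℤ)))
    (tr : ∀ k : ℕ, 2 ≤ k → Transport lawS2 (2 * (k : ℤ))) : ConeLineConfinement :=
  coneLineConfinement_of_biAnchored base
    (fun k hk => biAnchoredStep_of_core ((coreStep_lawS2_iff_noThree (by omega)).2 (core k hk))
      (saturation_lawS2_of_noCorner (by omega) (corner k hk))) tr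

/-- the same for `L**` with the thin clause kept as its own typed part. -/
theorem coneLineConfinement_of_noCorner_lawSS (base : Confined lawSS 2)
    (core : ∀ k : ℕ, 2 ≤ k → NoThree (2 * (k : ℤ))) (corner : ∀ k : ℕ, 2 ≤ k → NoCorner (2 * (k : ℤ)))
    (thin : ∀ k : ℕ, 2 ≤ k → SaturationThin (2 * (k : ℤ))) (tr : ∀ k : ℕ, 2 ≤ k → Transport lawSS (2 * (k : ℤ))) : ConeLineConfinement :=
  coneLineConfinement_of_noThree base core (fun k hk => saturationTwo_of_noCorner (by omega) (corner k hk)) thin tr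

/-! ## §30 (v2.3) THE `N`-HALF OF `NoCorner`: a corner `N`-cell fires ONE self-served `A2I⁻` clause (PROVED ∀ h > 0)

For `Z = [O, O, c·ℓ_v, m·ℓ_u]` (`2m = h`): (DN) `exists_partner_of_origin` — rule D serves the own coordinate of `c·ℓ_v` along `v` at full depth `c`
((A1) kills partial depths), so `q := Z(c·ℓ_v ↦ O) ∈ E₊`; (Am) `not_cornerN_of_static` — the `A2I⁻` instance `(Z; σ = slot of c·ℓ_v, u = v; q; f′ = an O-slot
o, v; N′ := Z ∘ swap(σ, o))` is SELF-SERVED (`PermClosed`) and has no escape inside `◇_h`.  ◇₄ anatomy (`corner4.py`): every corner `N`-class dies by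
`DN + Am + DP`, the `Am` server being the head with two slots swapped (sketch §13 (M1)). -/

/-- exactly two charged slots ⇒ `chargedCount = 2`. -/
theorem chargedCount_eq_two {Z : MCell} {a b : Fin 4} (hab : a ≠ b) (ha : (Z a).2 ≠ (0, 0)) (hb : (Z b).2 ≠ (0, 0))
    (hrest : ∀ f, f ≠ a → f ≠ b → (Z f).2 = (0, 0)) : chargedCount Z = 2 := by
  have hs : (univ.filter fun f : Fin 4 => (Z f).2 ≠ (0, 0)) = {a, b} := by
    ext f
    simp only [mem_filter, mem_univ, true_and, mem_insert, mem_singleton]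
    constructor
    · intro hf
      by_contra hne
      rw [not_or] at hne
      exact hf (hrest f hne.1 hne.2)
    · rintro (rfl | rfl)
      · exact ha
      · exact hb
  show (univ.filter fun f : Fin 4 => (Z f).2 ≠ (0, 0)).card = 2
  rw [hs, card_pair hab]

/-- the encoder charge `cabs` of a table letter `t·I + c·ℓ_{i^k}` is `c`. -/
theorem cabs_ray_apex (t c : ℤ) (k : Fin 4) (hc : 0 ≤ c) : cabs (ray ((t, 0, 0) : BPoint) k c) = c := by
  fin_cases k <;> simp [cabs, abs_of_nonneg hc, max_eq_left hc, max_eq_right hc]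

/-- no letter of `◇_h` is spacelike-separated from the origin (`|β| = |c| ≤ α` on an axis letter). -/
theorem not_spacelike_of_inDiamond {h : ℤ} {x : BPoint} (hx : InDiamond h x) : ¬ Spacelike (bsub x ((0, 0, 0) : BPoint)) := by
  obtain ⟨a, b1, b2⟩ := x
  obtain ⟨hax, hle, -, -⟩ := hx
  simp only [absCharge, chargeOf] at hle
  have hsq : (b1 - b2) * (b1 - b2) ≤ a * a := by
    have := mul_self_le_mul_self (abs_nonneg _) hle
    rwa [abs_mul_abs_self] at this
  have hprod : b1 * b2 = 0 := by
    rcases hax with h0 | ⟨-, h0⟩ | ⟨h0, -⟩ <;> simp_all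
  simp only [Spacelike, sub_zero, not_lt]
  nlinarith [hsq, hprod]

/-- **the (A1)-dead shape**: a `P`-cell carrying the corner letter `m·ℓ_u` (`2m = h`) on `a`, a floor charge `c·ℓ_w` on `x`, the origin on `y` and no other
charge is absent (bi-anchored, two-charged, apex `O ≠ hI`: `no_apex_of_two_upper`; `y ∉ {a, x}` follows). -/
theorem false_of_cornerlike_upper {h : ℤ} {C : MConfig} (hU : C.InDiamond h) (hS : C.StaticH1) (hpos : 0 < h)
    (noN : ∀ Z ∈ C.lower, BiAnchored h Z → ThreeCharged Z → False)
    {P : MCell} (hP : P ∈ C.upper) {a x y u w : Fin 4} {m c : ℤ} (hax : a ≠ x) (hm : 2 * m = h) (hc : 1 ≤ c) (hPa : P a = ray ((0, 0, 0) : BPoint) u m) (hPx : P x = ray ((0, 0, 0) : BPoint) w c)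
    (hPy : P y = ((0, 0, 0) : BPoint)) (hrest : ∀ f, f ≠ a → f ≠ x → (P f).2 = (0, 0)) : False :=
  no_apex_of_two_upper hU hS noN hP
    (chargedCount_eq_two hax (by rw [hPa]; exact ray_charged 0 u (by omega)) (by rw [hPx]; exact ray_charged 0 w hc) hrest)
    ⟨⟨y, by rw [hPy]; simp [OnFloor, absCharge, chargeOf]⟩, ⟨a, onCeiling_of_eq (by omega) (by omega : 0 + 2 * m = h) hPa⟩⟩ hPy (by omega)

/-- **(DN) rule D under the origin**: the floor letter `c·ℓ_v` of a RULE-D `N`-cell in `◇_h` with an `O` on another slot is served below ALONG `v`, at some depth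
`1 ≤ d ≤ c`: the `P`-cell `Z(b ↦ (c−d)·ℓ_v)` is present. -/
theorem exists_partner_of_origin {h : ℤ} {C : MConfig} (hU : C.InDiamond h) {Z : MCell} (hD : RuleDMu4N C Z)
    {o b v : Fin 4} {c : ℤ} (hob : o ≠ b) (hc : 1 ≤ c) (hZo : Z o = ((0, 0, 0) : BPoint)) (hZb : Z b = ray ((0, 0, 0) : BPoint) v c) :
    ∃ P ∈ C.upper, ∃ d : ℤ, 1 ≤ d ∧ d ≤ c ∧ (∀ g, g ≠ b → P g = Z g) ∧ P b = ray ((0, 0, 0) : BPoint) v (c - d) := by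
  obtain ⟨r, -, P, hP, hagree, hlt, hray⟩ := settledBelow_of_origin hU hD hZo hob.symm
    (by rw [hZb]; exact adapted_ray_apex_self 0 c v) (by rw [hZb, coord_ray_apex_self]; omega)
  obtain ⟨-, hle, hPb⟩ := floor_move hc (by omega) (hZb.symm.trans hray) (hU.2 P hP b)
  exact ⟨P, hP, (Z b).1 - (P b).1, by omega, hle, hagree, hPb⟩

/-- **(Am) NO CORNER `N`-CELL (PROVED ∀ h > 0, `N`-core only)**: see the §30 header. -/
theorem not_cornerN_of_static {h : ℤ} {C : MConfig} (hU : C.InDiamond h) (hG : C.G1Closed) (hS : C.StaticH1) (hpos : 0 < h)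
    (noN : ∀ Z ∈ C.lower, BiAnchored h Z → ThreeCharged Z → False) {Z : MCell} (hZ : Z ∈ C.lower) (hK : CornerN h Z) : False := by
  obtain ⟨a, b, u, v, m, c, hab, hm, hc, hZa, hZb, hrest⟩ := hK
  obtain ⟨o, hoa, hob⟩ := exists_ne_ne a b
  have hZo : Z o = ((0, 0, 0) : BPoint) := hrest o hoa hob
  have hZb1 : (Z b).1 = c := by rw [hZb]; simp
  have hα : ∀ P ∈ C.upper, ∀ f, 0 ≤ (P f).1 := fun P hP f => by
    have h1 := (hU.2 P hP f).2.1
    have h2 := abs_nonneg (chargeOf (P f))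
    simp only [absCharge] at h1
    omega
  -- (DN) the partner `q = Z(b ↦ O)` is present
  obtain ⟨q, hq, d, hd1, hdc, hagree, hqb⟩ := exists_partner_of_origin hU (hS.1.1 Z hZ) hob hc hZo hZb
  have hdc' : d = c := by
    by_contra hne
    exact false_of_cornerlike_upper hU hS hpos noN hq hab hm (by omega : 1 ≤ c - d)
      (by rw [hagree a hab, hZa]) hqb (by rw [hagree o hob, hZo]) fun f hfa hfb => by
        rw [hagree f hfb, hrest f hfa hfb]
  have hqb0 : q b = ((0, 0, 0) : BPoint) := by rw [hqb, hdc', sub_self]; simp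
  -- (Am) the server `N′ = Z ∘ swap(b, o)` is present by `G₁`-closure
  obtain ⟨N', hN'⟩ : ∃ N' : MCell, N' = Z.perm (Equiv.swap b o) := ⟨_, rfl⟩
  have hN'mem : N' ∈ C.lower := by rw [hN']; exact hG.1 _ Z hZ
  have hN'b : N' b = ((0, 0, 0) : BPoint) := by
    rw [hN']; show Z (Equiv.swap b o b) = _; rw [Equiv.swap_apply_left, hZo]
  have hN'o : N' o = ray ((0, 0, 0) : BPoint) v c := by
    rw [hN']; show Z (Equiv.swap b o o) = _; rw [Equiv.swap_apply_right, hZb]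
  have hN'g : ∀ g, g ≠ b → g ≠ o → N' g = Z g := fun g hgb hgo => by
    rw [hN']; show Z (Equiv.swap b o g) = _; rw [Equiv.swap_apply_of_ne_of_ne hgb hgo]
  refine hS.2.2 Z hZ q hq N' hN'mem b v o v ⟨?_, ?_, ?_, ?_, hob, ?_, ?_, ?_, ?_, ?_, ?_⟩
  · -- `Z_b = c·ℓ_v` is charged
    rw [hZb]; fin_cases v <;> simp [isApex] <;> omega
  · -- `EncDir`: the partner direction is the own phase `v`
    rw [hZb]
    left
    refine ⟨by simp; omega, ?_⟩
    rw [cabs_ray_apex 0 c v (by omega)]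
    simp
  · -- `q` is the `v`-partner at depth `c`
    exact ⟨hagree, by rw [hqb0, hZb]; simp; omega, by rw [hqb0, hZb]; simp⟩
  · -- the guard `d ≤ cabs`
    intro _
    rw [hqb0, hZb, cabs_ray_apex 0 c v (by omega)]
    simp
  · -- `N′ = q(o ↦ c·ℓ_v)` is the server along `v`
    refine ⟨fun g hgo => ?_, by rw [hagree o hob, hZo, hN'o]; simp; omega, by rw [hagree o hob, hZo, hN'o]; simp⟩
    by_cases hgb : g = b
    · subst hgb; rw [hqb0, hN'b]
    · rw [hagree g hgb, hN'g g hgb hgo]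
  · -- `A2IPRES`: a partner in another direction would have its letter outside `◇_h`
    rintro P hP w hw ⟨-, hlt, hray⟩
    exact hw (floor_move hc (by omega) (hZb.symm.trans hray) (hU.2 P hP b)).1
  · -- `inter`: a shallower `v`-partner is (A1)-dead
    rintro P hP ⟨hag, hlt, hray⟩
    obtain ⟨-, -, hPb⟩ := floor_move hc (by omega) (hZb.symm.trans hray) (hU.2 P hP b)
    rw [hqb0]
    by_contra hgt
    have hgt' : 0 < (P b).1 := by simp at hgt; omega
    exact false_of_cornerlike_upper hU hS hpos noN hP hab hm (by omega : 1 ≤ c - ((Z b).1 - (P b).1))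
      (by rw [hag a hab, hZa]) hPb (by rw [hag o hob, hZo]) fun f hfa hfb => by rw [hag f hfb, hrest f hfa hfb]
  · -- `deeper`: nothing lies below `O`
    rintro P hP ⟨-, hlt, -⟩
    have := hα P hP b
    rw [hqb0] at hlt
    simp at hlt
    omega
  · -- `A1W`: nothing is null-below `O`
    intro P hP hnb _
    have := hα P hP o
    have h2 := hnb.1
    rw [hZo] at h2
    simp at h2
    omega
  · -- polluters: species (3b) is (A1)-dead, species (3d) needs a spacelike offset from `O` inside `◇_h`
    intro P hP hag hul
    have hPb : P b = ((0, 0, 0) : BPoint) := by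
      obtain ⟨hle, heq⟩ := hul
      rw [hqb0] at hle heq
      have h0 : (P b).1 = 0 := by have := hα P hP b; simp at hle; omega
      have h1 : (P b).2.1 = 0 := by have := congrArg (fun p : BPoint => p.2.1) heq; simp [h0] at this; omega
      have h2 : (P b).2.2 = 0 := by have := congrArg (fun p : BPoint => p.2.2) heq; simp [h0] at this; omega
      exact Prod.ext h0 (Prod.ext h1 h2)
    refine ⟨?_, ?_⟩
    · rintro ⟨hlt, -, hray⟩
      rw [hZo] at hlt hray
      have hlt' : 0 < (P o).1 := by simpa using hlt
      exact false_of_cornerlike_upper hU hS hpos noN hP hoa.symm hm (by simp; omega) (by rw [hag a hab hoa.symm, hZa]) hray hPb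
        fun f hfa hfo => by
          by_cases hfb : f = b
          · subst hfb; rw [hPb]
          · rw [hag f hfb hfo, hrest f hfa hfb]
    · rintro ⟨-, hsp⟩
      rw [hZo] at hsp
      exact not_spacelike_of_inDiamond (hU.2 P hP o) hsp

/-- **the typed remainder of T1-sat for `lawS2` (v2.3)**: core ⇒ no corner `P`-cell `[m·ℓ_u, y, hI, hI]`. NOT asserted. -/
def NoCornerP (h : ℤ) : Prop :=
  ∀ C : MConfig, C.InDiamond h → C.G1Closed → C.StaticH1 →
    (∀ Z ∈ C.lower, BiAnchored h Z → ThreeCharged Z → False) → (∀ P ∈ C.upper, BiAnchored h P → ThreeCharged P → False) →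
      ∀ P ∈ C.upper, ¬ CornerP h P

/-- **`Saturation lawS2 h ⇔ NoCornerP h`** (PROVED ∀ h > 0): the `N`-half of the corner statement is discharged by `not_cornerN_of_static`. -/
theorem saturation_lawS2_iff_noCornerP {h : ℤ} (hpos : 0 < h) : Saturation lawS2 h ↔ NoCornerP h := by
  rw [saturation_lawS2_iff hpos]
  exact ⟨fun H C hU hG hS noN noP => (H C hU hG hS noN noP).2,
    fun H C hU hG hS noN noP => ⟨fun Z hZ hK => not_cornerN_of_static hU hG hS hpos noN hZ hK, H C hU hG hS noN noP⟩⟩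

/-- `NoCorner h → NoCornerP h` (the v2.2 hypothesis implies the v2.3 one). -/
theorem noCornerP_of_noCorner {h : ℤ} (H : NoCorner h) : NoCornerP h := fun C hU hG hS _ _ => (H C hU hG hS).2

/-- **THE CONE ASSEMBLY, v2.3**: base + `NoThree` (T1-core) + `NoCornerP` (the `P`-half of T1-sat) + transport at every even height `≥ 4` ⇒ line confinement of the
forward cone.  Typed obligations, nothing asserted. -/
theorem coneLineConfinement_of_noCornerP (base : Confined lawS2 2)
    (core : ∀ k : ℕ, 2 ≤ k → NoThree (2 * (k : ℤ))) (corner : ∀ k : ℕ, 2 ≤ k → NoCornerP (2 * (k : ℤ)))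
    (tr : ∀ k : ℕ, 2 ≤ k → Transport lawS2 (2 * (k : ℤ))) : ConeLineConfinement :=
  coneLineConfinement_of_biAnchored base
    (fun k hk => biAnchoredStep_of_core ((coreStep_lawS2_iff_noThree (by omega)).2 (core k hk))
      ((saturation_lawS2_iff_noCornerP (by omega)).2 (corner k hk))) tr


/-! ## §31 (v2.3) THE `P`-HALF: a corner `P`-cell fires ONE `X⁺` clause around `[m·ℓ_u, hI, hI, hI]` — `Saturation lawS2 h` PROVED ∀ h > 0

`P₀ = [m·ℓ_u, y, hI, hI]`: (DP) `N₀ := P₀(y ↦ hI) ∈ E₋` (`lower_mem_of_top_node`; intermediate discharges (A1)-dead); (DN) rule D below `N₀` gives a present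
`P₁ = N₀(hI ↦ y′)` in a direction `r ≠ v + 2`; (Xp) in the dual world (`uPartner_dual`) the `X` clause with head `P₀^∨`, partner `N₀^∨` (topmost,
`partner_above_eq_top`), sibling `P₁^∨`, no companion ((A1)), breakers automatic (`effective_dual_top`, `not_nullBelow_dual_top`) FIRES.  Hence
`not_cornerP_of_static`, `noCornerP_of_static`, **`saturation_lawS2`**, `coneLineConfinement_of_core_lawS2`. -/

/-- two antipodal null moves from a table letter: `(t·I + c·ℓ_k) + e·n_{k+2} = (t+2e)·I + (c−e)·ℓ_k`. -/
theorem ray_ray_antip (t c e : ℤ) (k : Fin 4) :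
    ray (ray ((t, 0, 0) : BPoint) k c) (k + 2) e = ray ((t + 2 * e, 0, 0) : BPoint) k (c - e) := by
  fin_cases k <;> refine Prod.ext ?_ (Prod.ext ?_ ?_) <;> simp <;> ring

/-- the zero move. -/
theorem ray_zero (x : BPoint) (k : Fin 4) : ray x k 0 = x := by
  obtain ⟨a, b, c⟩ := x
  simp

/-- a letter `d ≥ 1` null steps below an apex is charged. -/
theorem charged_of_ray_eq_apex {z : BPoint} {r : Fin 4} {d t : ℤ} (hd : 0 < d) (hz : ray z r d = ((t, 0, 0) : BPoint)) : z.2 ≠ (0, 0) := by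
  obtain ⟨z1, z2, z3⟩ := z
  fin_cases r <;> simp [Prod.ext_iff] at hz ⊢ <;> omega

/-- in the dual world every letter of `◇_h` lies in the closed future cone of the dual top apex: `(hI)^∨ ≤ x^∨` ((H-e′) is automatic at the partner `hI`). -/
theorem effective_dual_top {h : ℤ} {x : BPoint} (hx : InDiamond h x) : Effective (bsub (dualPt 0 x) (dualPt 0 ((h, 0, 0) : BPoint))) := by
  obtain ⟨a, b1, b2⟩ := x
  obtain ⟨hax, hle, -, hh⟩ := hx
  simp only [absCharge, chargeOf] at hle hh
  have h0 := abs_nonneg (b1 - b2)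
  have hsq : (b1 - b2) * (b1 - b2) ≤ (h - a) * (h - a) := by
    have := mul_self_le_mul_self (abs_nonneg _) (show |b1 - b2| ≤ h - a by omega)
    rwa [abs_mul_abs_self] at this
  have hprod : b1 * b2 = 0 := by
    rcases hax with h0 | ⟨-, h0⟩ | ⟨h0, -⟩ <;> simp_all
  refine ⟨by simp; omega, ?_⟩
  nlinarith [hsq, hprod]

/-- nothing of `◇_h` is null-below the dual top apex (it would have `α > h`): (H-b) and `W_f` are vacuous at an `hI`-slot. -/
theorem not_nullBelow_dual_top {h : ℤ} {x : BPoint} (hx : InDiamond h x) : ¬ NullBelow (dualPt 0 x) (dualPt 0 ((h, 0, 0) : BPoint)) := by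
  intro hnb
  have h1 := hnb.1
  have h2 := hx.2.2.2
  have h3 := abs_nonneg (chargeOf x)
  simp only [absCharge] at h2
  simp at h1
  omega

/-- **the (A1)-dead shape, `N` side**: an `N`-cell carrying the corner letter `m·ℓ_u` (`2m = h`) on `a`, a charged letter on `x`, the top apex `hI` on `y` and no other
charge is absent (`no_apex_of_two_lower`). -/
theorem false_of_cornerlike_lower {h : ℤ} {C : MConfig} (hU : C.InDiamond h) (hS : C.StaticH1) (hpos : 0 < h)
    (noP : ∀ P ∈ C.upper, BiAnchored h P → ThreeCharged P → False)
    {N : MCell} (hN : N ∈ C.lower) {a x y u : Fin 4} {m : ℤ} (hax : a ≠ x) (hm : 2 * m = h)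
    (hNa : N a = ray ((0, 0, 0) : BPoint) u m) (hNx : (N x).2 ≠ (0, 0)) (hNy : N y = ((h, 0, 0) : BPoint))
    (hrest : ∀ f, f ≠ a → f ≠ x → (N f).2 = (0, 0)) : False :=
  no_apex_of_two_lower hU hS noP hN (chargedCount_eq_two hax (by rw [hNa]; exact ray_charged 0 u (by omega)) hNx hrest)
    ⟨⟨a, onFloor_of_eq (by omega) hNa⟩, ⟨a, onCeiling_of_eq (by omega) (by omega : 0 + 2 * m = h) hNa⟩⟩ hNy (by omega)

/-- **every partner ABOVE a corner `P`-cell on the slot of `y` is the thin cell `P₀(y ↦ hI)`**: the move is antipodal (`ceiling_move`) and a shorter one leaves an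
(A1)-dead `N`-cell. -/
theorem partner_above_eq_top {h : ℤ} {C : MConfig} (hU : C.InDiamond h) (hS : C.StaticH1) (hpos : 0 < h)
    (noP : ∀ P ∈ C.upper, BiAnchored h P → ThreeCharged P → False)
    {P N : MCell} (hN : N ∈ C.lower) {a b g₁ u v r : Fin 4} {m t c : ℤ} (hab : a ≠ b) (hg₁b : g₁ ≠ b)
    (hm : 2 * m = h) (hc : 1 ≤ c) (hh : t + 2 * c = h) (hPa : P a = ray ((0, 0, 0) : BPoint) u m)
    (hPb : P b = ray ((t, 0, 0) : BPoint) v c) (hPg : P g₁ = ((h, 0, 0) : BPoint)) (hrest : ∀ f, f ≠ a → f ≠ b → (P f).2 = (0, 0))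
    (hup : UPartner N P b r) : N b = ((h, 0, 0) : BPoint) := by
  obtain ⟨hagree, hlt, hray⟩ := hup
  obtain ⟨e, he⟩ : ∃ e : ℤ, e = (N b).1 - (P b).1 := ⟨_, rfl⟩
  rw [← he] at hray
  have he0 : 0 < e := by omega
  have hyD : InDiamond h (ray (ray ((t, 0, 0) : BPoint) v c) r e) := by
    have := hU.1 N hN b
    rwa [hray, hPb] at this
  obtain ⟨-, hle, heq⟩ := ceiling_move hc hh he0 hyD
  have hNb : N b = ray ((t + 2 * e, 0, 0) : BPoint) v (c - e) := by rw [hray, hPb, heq]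
  by_cases hec : e < c
  · exact (false_of_cornerlike_lower hU hS hpos noP hN hab hm (by rw [← hagree a hab, hPa])
      (by rw [hNb]; exact ray_charged _ v (by omega)) (by rw [← hagree g₁ hg₁b, hPg])
      (fun f hfa hfb => by rw [← hagree f hfb]; exact hrest f hfa hfb)).elim
  · rw [hNb, show c - e = 0 by omega, ray_zero, show t + 2 * e = h by omega]

/-- **(DP) the thin cell above a corner `P`-cell is present**: `P₀(y ↦ hI) ∈ E₋`. -/
theorem lower_mem_of_top_node {h : ℤ} {C : MConfig} (hU : C.InDiamond h) (hS : C.StaticH1) (hpos : 0 < h)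
    (noP : ∀ P ∈ C.upper, BiAnchored h P → ThreeCharged P → False)
    {P : MCell} (hP : P ∈ C.upper) {a b g₁ u v : Fin 4} {m t c : ℤ} (hab : a ≠ b) (hg₁b : g₁ ≠ b)
    (hm : 2 * m = h) (hc : 1 ≤ c) (hh : t + 2 * c = h) (hPa : P a = ray ((0, 0, 0) : BPoint) u m)
    (hPb : P b = ray ((t, 0, 0) : BPoint) v c) (hPg : P g₁ = ((h, 0, 0) : BPoint)) (hrest : ∀ f, f ≠ a → f ≠ b → (P f).2 = (0, 0)) :
    Function.update P b ((h, 0, 0) : BPoint) ∈ C.lower := by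
  obtain ⟨r, -, N, hN, hup⟩ := settledAbove_of_top hU (hS.1.2 P hP) hPg hg₁b.symm
    (by rw [hPb]; exact adapted_ray_apex_antip t c v) (by rw [hPb, coord_ray_apex_antip]; omega)
  have hNb := partner_above_eq_top hU hS hpos noP hN hab hg₁b hm hc hh hPa hPb hPg hrest hup
  have hNeq : Function.update P b ((h, 0, 0) : BPoint) = N := by
    funext g
    by_cases hg : g = b
    · subst hg; rw [Function.update_self, hNb]
    · rw [Function.update_of_ne hg]; exact hup.1 g hg
  rw [hNeq]; exact hN

/-- **(Xp) NO CORNER `P`-CELL (PROVED ∀ h > 0, `P`-core only)**: see the §31 header. -/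
theorem not_cornerP_of_static {h : ℤ} {C : MConfig} (hU : C.InDiamond h) (hS : C.StaticH1) (hpos : 0 < h)
    (noP : ∀ P ∈ C.upper, BiAnchored h P → ThreeCharged P → False) {P : MCell} (hP : P ∈ C.upper) (hK : CornerP h P) : False := by
  obtain ⟨a, b, u, v, m, t, c, hab, hm, hc, hh, hPa, hPb, hrest⟩ := hK
  obtain ⟨g₁, hg₁a, hg₁b⟩ := exists_ne_ne a b
  have hPg : P g₁ = ((h, 0, 0) : BPoint) := hrest g₁ hg₁a hg₁b
  have hrest2 : ∀ f, f ≠ a → f ≠ b → (P f).2 = (0, 0) := fun f hfa hfb => by rw [hrest f hfa hfb]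
  -- (DP) the thin partner N₀ = P(b ↦ hI)
  have hN₀ := lower_mem_of_top_node hU hS hpos noP hP hab hg₁b hm hc hh hPa hPb hPg hrest2
  set N₀ : MCell := Function.update P b ((h, 0, 0) : BPoint) with hN₀def
  have hN₀b : N₀ b = ((h, 0, 0) : BPoint) := Function.update_self ..
  have hN₀g : ∀ g, g ≠ b → N₀ g = P g := fun g hg => Function.update_of_ne hg ..
  have hN₀a : N₀ a = ray ((0, 0, 0) : BPoint) u m := by rw [hN₀g a hab, hPa]
  -- (DN) rule D below the thin cell at the coordinate `v` of its `hI` on `b`: a sibling `P₁`, served along `r ≠ v + 2`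
  obtain ⟨r, hr, P₁, hP₁, hsib⟩ := settledBelow_of_floor (g := b) (k := v) hU (hS.1.1 N₀ hN₀) (by omega : 1 ≤ m) hN₀a (Ne.symm hab)
    (by rw [hN₀b]; fin_cases v <;> simp [Adapted]) (by rw [hN₀b]; fin_cases v <;> simp [coord] <;> omega)
  -- (Xp) the X clause in the dual world fires
  refine hS.2.1 (dualCell 0 P) (dualCell_mem_dual_lower hP) (dualCell 0 N₀) (dualCell_mem_dual_upper hN₀)
    (dualCell 0 P₁) (dualCell_mem_dual_lower hP₁) b (v + 2) r g₁ ⟨?_, hg₁b, ?_, ?_, hr, ?_, ?_, ?_, ?_, ?_⟩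
  · -- `y` is charged
    change ¬ isApex (dualPt 0 (P b))
    rw [isApex_dual, hPb]
    fin_cases v <;> simp [isApex] <;> omega
  · -- `N₀^∨` is a `(v+2)`-partner of the head
    refine (uPartner_dual 0 N₀ P b (v + 2)).mpr ⟨fun g hg => (hN₀g g hg).symm, by rw [hPb, hN₀b]; simp; omega, ?_⟩
    have h1 : ((h, 0, 0) : BPoint).1 - (ray ((t, 0, 0) : BPoint) v c).1 = c := by simp; omega
    rw [hN₀b, hPb, h1, ray_ray_antip, sub_self, ray_zero, show t + 2 * c = h by omega]
  · -- … and the topmost one: a closer partner above `P` on `b` is (A1)-dead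
    intro Q hQ hup
    obtain ⟨N, hN, rfl⟩ : ∃ N ∈ C.lower, dualCell 0 N = Q := ⟨_, mem_dual_upper.mp hQ, dualCell_dualCell 0 Q⟩
    have hNb := partner_above_eq_top hU hS hpos noP hN hab hg₁b hm hc hh hPa hPb hPg hrest2 ((uPartner_dual 0 N P b (v + 2)).mp hup)
    change 0 - (N b).1 ≤ 0 - (N₀ b).1
    exact le_of_eq (by rw [hNb, hN₀b])
  · -- the sibling `P₁^∨`
    obtain ⟨hag', hlt', hray'⟩ := (uPartner_dual 0 N₀ P₁ b r).mpr hsib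
    exact ⟨fun g hg => (hag' g hg).symm, hlt', hray'⟩
  · -- no companion: each would be an (A1)-dead `N`-cell `N₀(b ↦ z)`
    intro Q hQ hag hlt1 _ heq
    obtain ⟨N, hN, rfl⟩ : ∃ N ∈ C.lower, dualCell 0 N = Q := ⟨_, mem_dual_upper.mp hQ, dualCell_dualCell 0 Q⟩
    obtain ⟨hagN, hltN, hrayN⟩ := (uPartner_dual 0 N₀ N b r).mp ⟨fun g hg => (hag g hg).symm, hlt1, heq⟩
    rw [hN₀b] at hrayN hltN
    exact false_of_cornerlike_lower hU hS hpos noP hN hab hm (by rw [hagN a hab, hN₀a])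
      (charged_of_ray_eq_apex (by simp at hltN ⊢; omega) hrayN.symm) (by rw [hagN g₁ hg₁b, hN₀g g₁ hg₁b, hPg])
      fun f hfa hfb => by rw [hagN f hfb, hN₀g f hfb, hrest f hfa hfb]
  · -- (H-e′) is automatic: every letter of `◇_h` is causally below `hI`
    intro Q hQ _ _ _ _
    obtain ⟨N, hN, rfl⟩ : ∃ N ∈ C.lower, dualCell 0 N = Q := ⟨_, mem_dual_upper.mp hQ, dualCell_dualCell 0 Q⟩
    change Effective (bsub (dualPt 0 (N b)) (dualPt 0 (N₀ b)))
    rw [hN₀b]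
    exact effective_dual_top (hU.1 N hN b)
  · -- (H-b) is vacuous at the `hI`-slot `g₁`
    intro Q hQ _ hnb _
    obtain ⟨N, hN, rfl⟩ : ∃ N ∈ C.lower, dualCell 0 N = Q := ⟨_, mem_dual_upper.mp hQ, dualCell_dualCell 0 Q⟩
    change NullBelow (dualPt 0 (N g₁)) (dualPt 0 (P g₁)) at hnb
    rw [hPg] at hnb
    exact absurd hnb (not_nullBelow_dual_top (hU.1 N hN g₁))
  · -- `W_f = ∅` is vacuous at `g₁`
    intro Q hQ hnb
    obtain ⟨N, hN, rfl⟩ : ∃ N ∈ C.lower, dualCell 0 N = Q := ⟨_, mem_dual_upper.mp hQ, dualCell_dualCell 0 Q⟩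
    change NullBelow (dualPt 0 (N g₁)) (dualPt 0 (P g₁)) at hnb
    rw [hPg] at hnb
    exact absurd hnb (not_nullBelow_dual_top (hU.1 N hN g₁))

/-- **`NoCornerP h` PROVED** for every `h > 0`. -/
theorem noCornerP_of_static {h : ℤ} (hpos : 0 < h) : NoCornerP h :=
  fun _ hU _ hS _ noP _ hP hK => not_cornerP_of_static hU hS hpos noP hP hK

/-- **`NoCorner h` PROVED** for every `h > 0` under the core (the v2.2 remainder of T1-sat, now a theorem support by support). -/
theorem noCorner_of_core {h : ℤ} (hpos : 0 < h) {C : MConfig} (hU : C.InDiamond h) (hG : C.G1Closed) (hS : C.StaticH1)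
    (noN : ∀ Z ∈ C.lower, BiAnchored h Z → ThreeCharged Z → False) (noP : ∀ P ∈ C.upper, BiAnchored h P → ThreeCharged P → False) :
    (∀ Z ∈ C.lower, ¬ CornerN h Z) ∧ ∀ P ∈ C.upper, ¬ CornerP h P :=
  ⟨fun _ hZ hK => not_cornerN_of_static hU hG hS hpos noN hZ hK, fun _ hP hK => not_cornerP_of_static hU hS hpos noP hP hK⟩

/-- **T1-sat CLOSED: `Saturation lawS2 h` holds for every `h > 0`** (the bi-anchored step for the programme law IS its three-charge core). -/
theorem saturation_lawS2 {h : ℤ} (hpos : 0 < h) : Saturation lawS2 h :=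
  (saturation_lawS2_iff_noCornerP hpos).2 (noCornerP_of_static hpos)

/-- hence `BiAnchoredStep lawS2 h ↔ CoreStep lawS2 h ↔ NoThree h` (`h > 0`). -/
theorem biAnchoredStep_lawS2_iff_noThree {h : ℤ} (hpos : 0 < h) : BiAnchoredStep lawS2 h ↔ NoThree h := by
  rw [biAnchoredStep_iff_core, coreStep_lawS2_iff_noThree hpos]
  exact ⟨fun H => H.1, fun H => ⟨H, saturation_lawS2 hpos⟩⟩

/-- **THE CONE ASSEMBLY, v2.3 (two typed obligations per height + the base)**: base + `NoThree` (T1-core) + transport at every even height `≥ 4` ⇒ line confinement of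
the forward cone.  Nothing asserted. -/
theorem coneLineConfinement_of_core_lawS2 (base : Confined lawS2 2)
    (core : ∀ k : ℕ, 2 ≤ k → NoThree (2 * (k : ℤ))) (tr : ∀ k : ℕ, 2 ≤ k → Transport lawS2 (2 * (k : ℤ))) : ConeLineConfinement :=
  coneLineConfinement_of_biAnchored base (fun k hk => (biAnchoredStep_lawS2_iff_noThree (by omega)).2 (core k hk)) tr


/-! ## §32 (v2.4–v2.5) THE BASE RUNG: `NoThree 2` and `Confined lawS2 2` PROVED — the cone assembly has NO base hypothesis left

◇₂ anatomy (sketch §13 (M2)): alive = `{[O⁴], [2I⁴]}`; every thick orbit dies in ONE round by two killers proved here for EVERY `h` — the TOP-SLOT `X⁺` KILL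
(`not_upper_unit_top_depth` ∕ `not_upper_unit_top`: unit ceiling letter beside `hI`) and the SELF-SERVED `A2I⁻` KILL (`not_lower_unit_origin`: unit floor letter
beside `O`) — composed along the ◇₂ chains (C1)(C3)(C4): **`noThree_two`**, **`confined_lawS2_two`**, **`coneLineConfinement_of_core_lawS2'`**. -/

/-- the top apex is one antipodal unit step above a unit ceiling letter: `hI = ((h-2)·I + ℓ_v) + n_{v+2}`. -/
theorem top_eq_ray_unit (h : ℤ) (v : Fin 4) : ((h, 0, 0) : BPoint) = ray (ray ((h - 2, 0, 0) : BPoint) v 1) (v + 2) 1 := by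
  fin_cases v <;> refine Prod.ext ?_ (Prod.ext ?_ ?_) <;> simp <;> ring

/-- (DP) `P f₀ = hI`, `P f₁ = (h-2)·I + ℓ_v` force `P(f₁ ↦ hI) ∈ E₋` (h-uniform). -/
theorem lower_mem_of_unit_top {h : ℤ} {C : MConfig} (hU : C.InDiamond h) {P : MCell} (hD : RuleDMu4P C P)
    {f₀ f₁ k₁ : Fin 4} (hf : f₀ ≠ f₁) (h0 : P f₀ = ((h, 0, 0) : BPoint)) (h1 : P f₁ = ray ((h - 2, 0, 0) : BPoint) k₁ 1) :
    Function.update P f₁ ((h, 0, 0) : BPoint) ∈ C.lower := by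
  have hne : coord (P f₁) (k₁ + 2) ≠ h := by rw [h1, coord_ray_apex_antip]; omega
  obtain ⟨r, -, N, hN, hagree, hlt, hray⟩ :=
    settledAbove_of_top hU hD h0 (Ne.symm hf) (by rw [h1]; exact adapted_ray_apex_antip (h - 2) 1 k₁) hne
  have hy : InDiamond h (ray (P f₁) r ((N f₁).1 - (P f₁).1)) := by rw [← hray]; exact hU.1 N hN f₁
  rw [h1] at hy hlt
  obtain ⟨-, -, hpt⟩ := ceiling_unit_move (by rw [h1] at hray; simp at hlt ⊢; omega) hy
  have hNf : N f₁ = (h, 0, 0) := by rw [hray, h1]; exact hpt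
  have hNeq : N = Function.update P f₁ ((h, 0, 0) : BPoint) := by
    funext g
    by_cases hg : g = f₁
    · subst hg; simp [hNf]
    · rw [Function.update_of_ne hg]; exact (hagree g hg).symm
  rw [← hNeq]; exact hN

/-- (DN) `Z f₀ = O`, `Z f₁ = ℓ_v` force `Z(f₁ ↦ O) ∈ E₊` (h-uniform). -/
theorem upper_mem_of_unit_origin {h : ℤ} {C : MConfig} (hU : C.InDiamond h) {Z : MCell} (hD : RuleDMu4N C Z)
    {f₀ f₁ k₁ : Fin 4} (hf : f₀ ≠ f₁) (h0 : Z f₀ = ((0, 0, 0) : BPoint)) (h1 : Z f₁ = ray ((0, 0, 0) : BPoint) k₁ 1) :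
    Function.update Z f₁ ((0, 0, 0) : BPoint) ∈ C.upper := by
  have hne : coord (Z f₁) k₁ ≠ 0 := by rw [h1, coord_ray_apex_self]; omega
  obtain ⟨r, -, P, hP, hagree, hlt, hray⟩ :=
    settledBelow_of_origin hU hD h0 (Ne.symm hf) (by rw [h1]; exact adapted_ray_apex_self 0 1 k₁) hne
  rw [h1] at hray hlt
  obtain ⟨hpt, -, -⟩ := floor_unit_move (by simp at hlt ⊢; omega) hray (hU.2 P hP f₁)
  have hPeq : P = Function.update Z f₁ ((0, 0, 0) : BPoint) := by
    funext g
    by_cases hg : g = f₁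
    · subst hg; simp [hpt]
    · rw [Function.update_of_ne hg]; exact hagree g hg
  rw [← hPeq]; exact hP

/-- **(Xp_d) THE TOP-SLOT `X⁺` KILL AT SIBLING DEPTH `d` (PROVED, h-uniform)**: a `P`-cell with `(h-2)I+ℓ_v` on `b` and `hI` on `g₁ ≠ b` is absent
once `N₀ = P(b ↦ hI)` has a present server `P₁` on `b` in a direction `r ≠ v + 2` with NO COMPANION: no present `N` agreeing with `P` off `b` whose
`b`-letter lies on the ray from `P₁ b` to `hI` strictly between (the `X⁺` clause in the dual world; breakers automatic at the `hI`-slot). -/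
theorem not_upper_unit_top_depth {h : ℤ} {C : MConfig} (hU : C.InDiamond h) (hS : C.StaticH1)
    {P : MCell} (hP : P ∈ C.upper) {b g₁ v : Fin 4} (hg₁b : g₁ ≠ b)
    (hPb : P b = ray ((h - 2, 0, 0) : BPoint) v 1) (hPg : P g₁ = ((h, 0, 0) : BPoint))
    {P₁ : MCell} (hP₁ : P₁ ∈ C.upper) {r : Fin 4} (hr : r ≠ v + 2)
    (hsib : UPartner (Function.update P b ((h, 0, 0) : BPoint)) P₁ b r)
    (hcomp : ∀ N ∈ C.lower, (∀ g, g ≠ b → N g = P g) → (P₁ b).1 < (N b).1 → (N b).1 < h →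
      N b ≠ ray (P₁ b) r ((N b).1 - (P₁ b).1)) : False := by
  have hN₀ := lower_mem_of_unit_top hU (hS.1.2 P hP) hg₁b hPg hPb
  set N₀ : MCell := Function.update P b ((h, 0, 0) : BPoint) with hN₀def
  have hN₀b : N₀ b = ((h, 0, 0) : BPoint) := Function.update_self ..
  have hN₀g : ∀ g, g ≠ b → N₀ g = P g := fun g hg => Function.update_of_ne hg ..
  -- every partner above the unit ceiling letter sits at the top apex
  have htop : ∀ N ∈ C.lower, ∀ w : Fin 4, UPartner N P b w → N b = ((h, 0, 0) : BPoint) := by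
    rintro N hN w ⟨-, hlt, hray⟩
    have hy : InDiamond h (ray (P b) w ((N b).1 - (P b).1)) := by rw [← hray]; exact hU.1 N hN b
    rw [hPb] at hy hlt
    obtain ⟨-, -, hpt⟩ := ceiling_unit_move (by rw [hPb] at hray; simp at hlt ⊢; omega) hy
    rw [hray, hPb]; exact hpt
  refine hS.2.1 (dualCell 0 P) (dualCell_mem_dual_lower hP) (dualCell 0 N₀) (dualCell_mem_dual_upper hN₀)
    (dualCell 0 P₁) (dualCell_mem_dual_lower hP₁) b (v + 2) r g₁ ⟨?_, hg₁b, ?_, ?_, hr, ?_, ?_, ?_, ?_, ?_⟩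
  · -- the unit letter is charged
    change ¬ isApex (dualPt 0 (P b))
    rw [isApex_dual, hPb]
    fin_cases v <;> simp [isApex]
  · -- `N₀^∨` is a `(v+2)`-partner of the head
    refine (uPartner_dual 0 N₀ P b (v + 2)).mpr ⟨fun g hg => (hN₀g g hg).symm, by rw [hPb, hN₀b]; simp; omega, ?_⟩
    have h1 : ((h, 0, 0) : BPoint).1 - (ray ((h - 2, 0, 0) : BPoint) v 1).1 = 1 := by simp; omega
    rw [hN₀b, hPb, h1]
    exact top_eq_ray_unit h v
  · -- … and the topmost one
    intro Q hQ hup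
    obtain ⟨N, hN, rfl⟩ : ∃ N ∈ C.lower, dualCell 0 N = Q := ⟨_, mem_dual_upper.mp hQ, dualCell_dualCell 0 Q⟩
    have hNb := htop N hN (v + 2) ((uPartner_dual 0 N P b (v + 2)).mp hup)
    change 0 - (N b).1 ≤ 0 - (N₀ b).1
    exact le_of_eq (by rw [hNb, hN₀b])
  · -- the sibling `P₁^∨`
    obtain ⟨hag', hlt', hray'⟩ := (uPartner_dual 0 N₀ P₁ b r).mpr hsib
    exact ⟨fun g hg => (hag' g hg).symm, hlt', hray'⟩
  · -- no companion strictly between `P₁ b` and `hI` on the ray (hypothesis `hcomp`, read in the dual world)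
    intro Q hQ hag hlt1 hlt2 hray
    obtain ⟨N, hN, rfl⟩ : ∃ N ∈ C.lower, dualCell 0 N = Q := ⟨_, mem_dual_upper.mp hQ, dualCell_dualCell 0 Q⟩
    have h1 : (0 : ℤ) - (N₀ b).1 < 0 - (N b).1 := hlt1
    have h2 : (0 : ℤ) - (N b).1 < 0 - (P₁ b).1 := hlt2
    rw [hN₀b] at h1
    simp at h1
    have hNg : ∀ g, g ≠ b → N g = P g := fun g hg => by
      have e := hag g hg
      change dualPt 0 (N g) = dualPt 0 (N₀ g) at e
      rw [hN₀g g hg] at e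
      have e' := congrArg (dualPt 0) e
      simpa [dualPt] using e'
    refine hcomp N hN hNg (by omega) h1 ?_
    -- the ray equation: from `Q_σ = q_σ + c′·n_r` (dual) and `hI = P₁ b + d·n_r`
    obtain ⟨-, -, hsray⟩ := hsib
    rw [hN₀b] at hsray
    change dualPt 0 (N b) = ray (dualPt 0 (N₀ b)) r ((dualPt 0 (N b)).1 - (dualPt 0 (N₀ b)).1) at hray
    rw [hN₀b] at hray
    generalize N b = nb at hray h1 ⊢
    generalize P₁ b = pb at hsray ⊢
    obtain ⟨n1, n2, n3⟩ := nb
    obtain ⟨p1, p2, p3⟩ := pb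
    simp only [dualPt, ray, Prod.mk.injEq] at hray hsray ⊢
    obtain ⟨-, hr2, hr3⟩ := hray
    obtain ⟨hs1, hs2, hs3⟩ := hsray
    exact ⟨by ring, by linear_combination hs2 - hr2, by linear_combination hs3 - hr3⟩
  · -- (H-e′) is automatic: every letter of `◇_h` is causally below `hI`
    intro Q hQ _ _ _ _
    obtain ⟨N, hN, rfl⟩ : ∃ N ∈ C.lower, dualCell 0 N = Q := ⟨_, mem_dual_upper.mp hQ, dualCell_dualCell 0 Q⟩
    change Effective (bsub (dualPt 0 (N b)) (dualPt 0 (N₀ b)))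
    rw [hN₀b]
    exact effective_dual_top (hU.1 N hN b)
  · -- (H-b) is vacuous at the `hI`-slot `g₁`
    intro Q hQ _ hnb _
    obtain ⟨N, hN, rfl⟩ : ∃ N ∈ C.lower, dualCell 0 N = Q := ⟨_, mem_dual_upper.mp hQ, dualCell_dualCell 0 Q⟩
    change NullBelow (dualPt 0 (N g₁)) (dualPt 0 (P g₁)) at hnb
    rw [hPg] at hnb
    exact absurd hnb (not_nullBelow_dual_top (hU.1 N hN g₁))
  · -- `W_f = ∅` is vacuous at `g₁`
    intro Q hQ hnb
    obtain ⟨N, hN, rfl⟩ : ∃ N ∈ C.lower, dualCell 0 N = Q := ⟨_, mem_dual_upper.mp hQ, dualCell_dualCell 0 Q⟩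
    change NullBelow (dualPt 0 (N g₁)) (dualPt 0 (P g₁)) at hnb
    rw [hPg] at hnb
    exact absurd hnb (not_nullBelow_dual_top (hU.1 N hN g₁))

/-- **(Xp) the depth-one case (PROVED, h-uniform)**: the sibling `P₁` sits one level below the top, so the companion clause is vacuous. -/
theorem not_upper_unit_top {h : ℤ} {C : MConfig} (hU : C.InDiamond h) (hS : C.StaticH1)
    {P : MCell} (hP : P ∈ C.upper) {b g₁ v : Fin 4} (hg₁b : g₁ ≠ b)
    (hPb : P b = ray ((h - 2, 0, 0) : BPoint) v 1) (hPg : P g₁ = ((h, 0, 0) : BPoint))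
    {P₁ : MCell} (hP₁ : P₁ ∈ C.upper) {r : Fin 4} (hr : r ≠ v + 2)
    (hsib : UPartner (Function.update P b ((h, 0, 0) : BPoint)) P₁ b r) (hlev : (P₁ b).1 = h - 1) : False :=
  not_upper_unit_top_depth hU hS hP hg₁b hPb hPg hP₁ hr hsib fun N _ _ hlt1 hlt2 _ => by omega

/-- **(Am) THE SELF-SERVED `A2I⁻` KILL AT A UNIT FLOOR LETTER (PROVED, h-uniform)**: an `N`-cell with `ℓ_a` on `b` and `O` on `o ≠ b` is absent as soon as its
polluter `Z ∘ swap(b, o)` (read as a `P`-cell) is: the clause `(σ = b, u = a, q = Z(b ↦ O), f′ = o, v = a, N′ = Z ∘ swap(b, o))` fires (cf. §30). -/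
theorem not_lower_unit_origin {h : ℤ} {C : MConfig} (hU : C.InDiamond h) (hG : C.G1Closed) (hS : C.StaticH1)
    {Z : MCell} (hZ : Z ∈ C.lower) {b o a : Fin 4} (hob : o ≠ b)
    (hZb : Z b = ray ((0, 0, 0) : BPoint) a 1) (hZo : Z o = ((0, 0, 0) : BPoint))
    (hkill : ∀ P ∈ C.upper, P o = ray ((0, 0, 0) : BPoint) a 1 → P b = ((0, 0, 0) : BPoint) →
      (∀ g, g ≠ b → g ≠ o → P g = Z g) → False) : False := by
  have hα : ∀ P ∈ C.upper, ∀ f, 0 ≤ (P f).1 := fun P hP f => by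
    have h1 := (hU.2 P hP f).2.1
    have h2 := abs_nonneg (chargeOf (P f))
    simp only [absCharge] at h1
    omega
  -- (DN) the partner `q = Z(b ↦ O)` is present
  have hq := upper_mem_of_unit_origin hU (hS.1.1 Z hZ) hob hZo hZb
  set q : MCell := Function.update Z b ((0, 0, 0) : BPoint) with hqdef
  have hqb0 : q b = ((0, 0, 0) : BPoint) := Function.update_self ..
  have hagree : ∀ g, g ≠ b → q g = Z g := fun g hg => Function.update_of_ne hg ..
  -- (Am) the server `N′ = Z ∘ swap(b, o)` is present by `G₁`-closure
  obtain ⟨N', hN'⟩ : ∃ N' : MCell, N' = Z.perm (Equiv.swap b o) := ⟨_, rfl⟩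
  have hN'mem : N' ∈ C.lower := by rw [hN']; exact hG.1 _ Z hZ
  have hN'b : N' b = ((0, 0, 0) : BPoint) := by
    rw [hN']; show Z (Equiv.swap b o b) = _; rw [Equiv.swap_apply_left, hZo]
  have hN'o : N' o = ray ((0, 0, 0) : BPoint) a 1 := by
    rw [hN']; show Z (Equiv.swap b o o) = _; rw [Equiv.swap_apply_right, hZb]
  have hN'g : ∀ g, g ≠ b → g ≠ o → N' g = Z g := fun g hgb hgo => by
    rw [hN']; show Z (Equiv.swap b o g) = _; rw [Equiv.swap_apply_of_ne_of_ne hgb hgo]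
  refine hS.2.2 Z hZ q hq N' hN'mem b a o a ⟨?_, ?_, ?_, ?_, hob, ?_, ?_, ?_, ?_, ?_, ?_⟩
  · -- `Z_b = ℓ_a` is charged
    rw [hZb]; fin_cases a <;> simp [isApex]
  · -- `EncDir`: the partner direction is the own phase `a`
    rw [hZb]
    left
    refine ⟨by simp, ?_⟩
    rw [cabs_ray_apex 0 1 a (by omega)]
    simp
  · -- `q` is the `a`-partner at depth `1`
    exact ⟨hagree, by rw [hqb0, hZb]; simp, by rw [hqb0, hZb]; simp⟩
  · -- the guard `d ≤ cabs`
    intro _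
    rw [hqb0, hZb, cabs_ray_apex 0 1 a (by omega)]
    simp
  · -- `N′ = q(o ↦ ℓ_a)` is the server along `a`
    refine ⟨fun g hgo => ?_, by rw [hagree o hob, hZo, hN'o]; simp, by rw [hagree o hob, hZo, hN'o]; simp⟩
    by_cases hgb : g = b
    · subst hgb; rw [hqb0, hN'b]
    · rw [hagree g hgb, hN'g g hgb hgo]
  · -- `A2IPRES`: a partner in another direction would have its letter outside `◇_h`
    rintro P hP w hw ⟨-, hlt, hray⟩
    exact hw (floor_unit_move (by omega) (hZb.symm.trans hray) (hU.2 P hP b)).2.2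
  · -- `inter`: every `a`-partner is `q` itself (one step to the origin)
    rintro P hP ⟨-, hlt, hray⟩
    obtain ⟨hPb, -, -⟩ := floor_unit_move (by omega) (hZb.symm.trans hray) (hU.2 P hP b)
    rw [hqb0, hPb]
  · -- `deeper`: nothing lies below `O`
    rintro P hP ⟨-, hlt, -⟩
    have := hα P hP b
    rw [hqb0] at hlt
    simp at hlt
    omega
  · -- `A1W`: nothing is null-below `O`
    intro P hP hnb _
    have := hα P hP o
    have h2 := hnb.1
    rw [hZo] at h2
    simp at h2
    omega
  · -- polluters: species (3b) is the killed `P`-cell `Z ∘ swap(b, o)`, species (3d) needs a spacelike offset from `O` inside `◇_h`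
    intro P hP hag hul
    have hPb : P b = ((0, 0, 0) : BPoint) := by
      obtain ⟨hle, heq⟩ := hul
      rw [hqb0] at hle heq
      have h0 : (P b).1 = 0 := by have := hα P hP b; simp at hle; omega
      have h1 : (P b).2.1 = 0 := by have := congrArg (fun p : BPoint => p.2.1) heq; simp [h0] at this; omega
      have h2 : (P b).2.2 = 0 := by have := congrArg (fun p : BPoint => p.2.2) heq; simp [h0] at this; omega
      exact Prod.ext h0 (Prod.ext h1 h2)
    refine ⟨?_, ?_⟩
    · rintro ⟨hlt, hle, hray⟩
      rw [hZo] at hlt hray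
      rw [hN'o] at hle
      have h1 : (P o).1 = 1 := by simp at hlt hle; omega
      have hPo : P o = ray ((0, 0, 0) : BPoint) a 1 := by
        rw [hray]
        fin_cases a <;> refine Prod.ext ?_ (Prod.ext ?_ ?_) <;> simp [h1]
      exact hkill P hP hPo hPb hag
    · rintro ⟨-, hsp⟩
      rw [hZo] at hsp
      exact not_spacelike_of_inDiamond (hU.2 P hP o) hsp

/-! ### The ◇₂ letters and chains -/

/-- at `h = 2` a charged letter is a unit letter `ℓ_v` (floor AND ceiling). -/
theorem h2_eq_unit {x : BPoint} (hx : InDiamond 2 x) (hch : x.2 ≠ (0, 0)) : ∃ v : Fin 4, x = ray ((0, 0, 0) : BPoint) v 1 := by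
  obtain ⟨t, c, k, hc, ht, hh, rfl⟩ := exists_ray_of_charged hx hch
  obtain rfl : c = 1 := by omega
  obtain rfl : t = 0 := by omega
  exact ⟨k, rfl⟩

/-- at `h = 2` an uncharged letter is `O` or the top apex `2I` (node levels are even). -/
theorem h2_eq_apex {x : BPoint} (hx : InDiamond 2 x) (h0 : x.2 = (0, 0)) : x = ((0, 0, 0) : BPoint) ∨ x = ((2, 0, 0) : BPoint) := by
  obtain ⟨a, b⟩ := x
  simp only at h0
  subst h0
  obtain ⟨-, hle, hpar, hh⟩ := hx
  simp [absCharge, chargeOf] at hle hpar hh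
  have : a = 0 ∨ a = 2 := by omega
  rcases this with rfl | rfl <;> simp

/-- at `h = 2` a letter strictly below the top apex along a ray is one step below it. -/
theorem h2_level_below_top {x : BPoint} {r : Fin 4} {e : ℤ} (hx : InDiamond 2 x) (he : 0 < e)
    (hray : ((2, 0, 0) : BPoint) = ray x r e) : x.1 = 1 ∧ e = 1 := by
  obtain ⟨a, b1, b2⟩ := x
  obtain ⟨-, hle, -, -⟩ := hx
  have hle' := abs_le.mp hle
  fin_cases r <;> simp [Prod.ext_iff, chargeOf] at hray hle' ⊢ <;> omega

theorem exists_ne_three (a b c : Fin 4) : ∃ d : Fin 4, d ≠ a ∧ d ≠ b ∧ d ≠ c := by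
  revert a b c; decide

/-- a three-charged cell: one uncharged slot, the other three charged. -/
theorem exists_uncharged_of_three {Z : MCell} (h3 : ThreeCharged Z) :
    ∃ e : Fin 4, (Z e).2 = (0, 0) ∧ ∀ f, f ≠ e → (Z f).2 ≠ (0, 0) := by
  classical
  have hS : (univ.filter fun f : Fin 4 => (Z f).2 ≠ (0, 0)).card = 3 := h3
  obtain ⟨e, he⟩ : ∃ e : Fin 4, e ∉ univ.filter fun f : Fin 4 => (Z f).2 ≠ (0, 0) := by
    by_contra hall
    push Not at hall
    have : (univ.filter fun f : Fin 4 => (Z f).2 ≠ (0, 0)) = univ := eq_univ_of_forall hall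
    rw [this, card_univ, Fintype.card_fin] at hS
    omega
  have he0 : (Z e).2 = (0, 0) := by simpa using he
  refine ⟨e, he0, fun f hfe hf0 => ?_⟩
  have hsub : (univ.filter fun f : Fin 4 => (Z f).2 ≠ (0, 0)) ⊆ (univ.erase e).erase f := by
    intro g hg
    have hg' : (Z g).2 ≠ (0, 0) := (mem_filter.1 hg).2
    refine mem_erase.2 ⟨?_, mem_erase.2 ⟨?_, mem_univ _⟩⟩
    · rintro rfl; exact hg' hf0
    · rintro rfl; exact hg' he0
  have hle := card_le_card hsub
  rw [hS, card_erase_of_mem (mem_erase.2 ⟨hfe, mem_univ _⟩), card_erase_of_mem (mem_univ _), card_univ, Fintype.card_fin] at hle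
  omega

/-- **◇₂ chain (C1)**: a `P`-cell with a unit letter on `b`, the top apex `2I` on `g₁` and a floor letter (`O` or a unit) on a third slot `f₀` is absent — the sibling of
the top-slot `X⁺` kill is the rule-D server of `N₀ = P(b ↦ 2I)` at the stuck floor letter, one step below the top. -/
theorem h2_no_upper_unit_top {C : MConfig} (hU : C.InDiamond 2) (hS : C.StaticH1) {P : MCell} (hP : P ∈ C.upper)
    {b g₁ f₀ v : Fin 4} (hg₁b : g₁ ≠ b) (hf₀b : f₀ ≠ b) (hPb : P b = ray ((0, 0, 0) : BPoint) v 1)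
    (hPg : P g₁ = ((2, 0, 0) : BPoint)) (hfl : P f₀ = ((0, 0, 0) : BPoint) ∨ ∃ w : Fin 4, P f₀ = ray ((0, 0, 0) : BPoint) w 1) : False := by
  have hPb' : P b = ray ((2 - 2, 0, 0) : BPoint) v 1 := by rw [hPb]; norm_num
  have hN₀ := lower_mem_of_unit_top hU (hS.1.2 P hP) hg₁b hPg hPb'
  set N₀ : MCell := Function.update P b ((2, 0, 0) : BPoint) with hN₀def
  have hN₀b : N₀ b = ((2, 0, 0) : BPoint) := Function.update_self ..
  have hN₀f : N₀ f₀ = P f₀ := Function.update_of_ne hf₀b ..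
  have hadk : Adapted (N₀ b) v := by rw [hN₀b]; fin_cases v <;> simp [Adapted]
  have hne : coord (N₀ b) v ≠ 0 := by rw [hN₀b]; fin_cases v <;> simp [coord]
  obtain ⟨r, hr, P₁, hP₁, hsib⟩ : SettledBelow C N₀ b v := by
    rcases hfl with h0 | ⟨w, h0⟩
    · exact settledBelow_of_origin hU (hS.1.1 N₀ hN₀) (by rw [hN₀f, h0]) hf₀b.symm hadk hne
    · exact settledBelow_of_floor hU (hS.1.1 N₀ hN₀) (by norm_num : (1 : ℤ) ≤ 1) (by rw [hN₀f, h0]) hf₀b.symm hadk hne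
  have hlev : (P₁ b).1 = 1 := by
    obtain ⟨-, hlt, hray⟩ := hsib
    rw [hN₀b] at hlt hray
    exact (h2_level_below_top (hU.2 P₁ hP₁ b) (by simp at hlt ⊢; omega) hray).1
  exact not_upper_unit_top hU hS hP hg₁b hPb' hPg hP₁ hr hsib (by rw [hlev]; norm_num)

/-- **◇₂ chain (C3)**: an `N`-cell with `O` on `o`, a unit letter on `b` and the top apex `2I` on `t` is absent (`A2I⁻` kill; its polluter is (C1)-dead). -/
theorem h2_no_lower_origin_unit_top {C : MConfig} (hU : C.InDiamond 2) (hG : C.G1Closed) (hS : C.StaticH1) {Z : MCell} (hZ : Z ∈ C.lower)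
    {o b t a : Fin 4} (hob : o ≠ b) (hot : o ≠ t) (hbt : b ≠ t) (hZo : Z o = ((0, 0, 0) : BPoint))
    (hZb : Z b = ray ((0, 0, 0) : BPoint) a 1) (hZt : Z t = ((2, 0, 0) : BPoint)) : False :=
  not_lower_unit_origin hU hG hS hZ hob hZb hZo fun P hP hPo hPb hag =>
    h2_no_upper_unit_top hU hS hP hot.symm hob.symm hPo (by rw [hag t hbt.symm hot.symm, hZt]) (Or.inl hPb)

/-- **◇₂ chain (C4)**: a `P`-cell with `O` on `o` and unit letters on `b ≠ c` is absent ((DP) `lower_mem_of_unit_ceiling` gives the (C3)-dead `P(c ↦ 2I)`). -/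
theorem h2_no_upper_origin_two_units {C : MConfig} (hU : C.InDiamond 2) (hG : C.G1Closed) (hS : C.StaticH1) {P : MCell} (hP : P ∈ C.upper)
    {o b c vb vc : Fin 4} (hob : o ≠ b) (hoc : o ≠ c) (hbc : b ≠ c) (hPo : P o = ((0, 0, 0) : BPoint))
    (hPb : P b = ray ((0, 0, 0) : BPoint) vb 1) (hPc : P c = ray ((0, 0, 0) : BPoint) vc 1) : False := by
  have hN := lower_mem_of_unit_ceiling hU (hS.1.2 P hP) hbc (by norm_num : (1 : ℤ) ≤ 1) (by norm_num : (0 : ℤ) + 2 * 1 = 2) hPb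
    (show P c = ray ((2 - 2, 0, 0) : BPoint) vc 1 by rw [hPc]; norm_num)
  exact h2_no_lower_origin_unit_top hU hG hS hN hob hoc hbc (by rw [Function.update_of_ne hoc, hPo]) (by rw [Function.update_of_ne hbc, hPb])
    (Function.update_self ..)

/-- **`NoThree 2` — T1-core DECIDED AT ITS FIRST RUNG (PROVED)**: in a `G₁`-closed `H₁`-static support in `◇₂` no three-charged cell is present
(◇₂ chains (C1)(C3)(C4) of the two killers; sketch §13 (M2)). -/
theorem noThree_two : NoThree 2 := by
  intro C hU hG hS
  refine ⟨fun Z hZ _ h3 => ?_, fun P hP _ h3 => ?_⟩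
  · obtain ⟨e, he0, hch⟩ := exists_uncharged_of_three h3
    obtain ⟨b, hbe, -⟩ := exists_ne_ne e e
    obtain ⟨c, hce, hcb⟩ := exists_ne_ne e b
    obtain ⟨d, hde, hdb, hdc⟩ := exists_ne_three e b c
    obtain ⟨vb, hZb⟩ := h2_eq_unit (hU.1 Z hZ b) (hch b hbe)
    obtain ⟨vc, hZc⟩ := h2_eq_unit (hU.1 Z hZ c) (hch c hce)
    obtain ⟨vd, hZd⟩ := h2_eq_unit (hU.1 Z hZ d) (hch d hde)
    -- (DN) discharge the unit on `b` against the stuck floor unit on `c`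
    have hP' := upper_mem_of_unit_floor hU (hS.1.1 Z hZ) hcb (by norm_num : (1 : ℤ) ≤ 1) hZc hZb
    rcases h2_eq_apex (hU.1 Z hZ e) he0 with hZe | hZe
    · exact h2_no_upper_origin_two_units hU hG hS hP' (o := b) (b := c) (c := d) hcb.symm hdb.symm (fun h => hdc h.symm)
        (Function.update_self ..) (by rw [Function.update_of_ne hcb, hZc]) (by rw [Function.update_of_ne hdb, hZd])
    · exact h2_no_upper_unit_top hU hS hP' (b := c) (g₁ := e) (f₀ := b) hce.symm hcb.symm (by rw [Function.update_of_ne hcb, hZc])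
        (by rw [Function.update_of_ne (Ne.symm hbe), hZe]) (Or.inl (Function.update_self ..))
  · obtain ⟨e, he0, hch⟩ := exists_uncharged_of_three h3
    obtain ⟨b, hbe, -⟩ := exists_ne_ne e e
    obtain ⟨c, hce, hcb⟩ := exists_ne_ne e b
    obtain ⟨vb, hPb⟩ := h2_eq_unit (hU.2 P hP b) (hch b hbe)
    obtain ⟨vc, hPc⟩ := h2_eq_unit (hU.2 P hP c) (hch c hce)
    rcases h2_eq_apex (hU.2 P hP e) he0 with hPe | hPe
    · exact h2_no_upper_origin_two_units hU hG hS hP (Ne.symm hbe) (Ne.symm hce) (Ne.symm hcb) hPe hPb hPc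
    · exact h2_no_upper_unit_top hU hS hP (Ne.symm hbe) hcb hPb hPe (Or.inr ⟨vc, hPc⟩)

/-- **`Confined lawS2 2` — THE BASE OF THE STEP TOWER (PROVED).**  At `h = 2` a thick cell carries a unit letter, which is floor AND ceiling, so the cell is bi-anchored and
§31's `BiAnchoredStep lawS2 2` (= `NoThree 2`, now a theorem) applies; thin cells obey `lawS2` vacuously. -/
theorem confined_lawS2_two : Confined lawS2 2 := by
  intro C hU hG hS
  have hB := (biAnchoredStep_lawS2_iff_noThree (by norm_num : (0 : ℤ) < 2)).2 noThree_two C hU hG hS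
  have key : ∀ Z : MCell, MCell.InDiamond 2 Z → ¬ ThinCell Z → BiAnchored 2 Z := fun Z hZD hth => by
    obtain ⟨f, hf⟩ : ∃ f, (Z f).2 ≠ (0, 0) := by
      by_contra hnone
      push Not at hnone
      apply hth
      have h0 : (univ.filter fun f : Fin 4 => (Z f).2 ≠ (0, 0)) = ∅ :=
        filter_eq_empty_iff.2 fun f _ => by simpa using hnone f
      show chargedCount Z ≤ 1
      simp only [chargedCount, h0, card_empty]
      omega
    obtain ⟨v, hv⟩ := h2_eq_unit (hZD f) hf
    exact ⟨⟨f, onFloor_of_eq (by norm_num) hv⟩, ⟨f, onCeiling_of_eq (by norm_num) (by norm_num : (0 : ℤ) + 2 * 1 = 2) hv⟩⟩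
  refine ⟨fun Z hZ => ?_, fun P hP => ?_⟩
  · by_cases hth : ThinCell Z
    · exact lawS2_of_thin hth
    · exact hB.1 Z hZ (key Z (hU.1 Z hZ) hth)
  · by_cases hth : ThinCell P
    · exact lawS2_of_thin hth
    · exact hB.2 P hP (key P (hU.2 P hP) hth)

/-- **THE CONE ASSEMBLY, v2.4 (two typed obligations per height `≥ 4`, NO base hypothesis)**: `NoThree (2k)` (T1-core) and `Transport lawS2 (2k)` (T2∕T3) for every
`k ≥ 2` ⇒ line confinement of the forward cone.  Nothing asserted about `k ≥ 2`. -/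
theorem coneLineConfinement_of_core_lawS2' (core : ∀ k : ℕ, 2 ≤ k → NoThree (2 * (k : ℤ)))
    (tr : ∀ k : ℕ, 2 ≤ k → Transport lawS2 (2 * (k : ℤ))) : ConeLineConfinement :=
  coneLineConfinement_of_core_lawS2 confined_lawS2_two core tr


/-! ## §33 (v2.5) `G₁` AS AN ENGINE (PROVED, h-uniform): PHASE UNIQUENESS at a unit ceiling letter and `δ`-ROTATED siblings

`not_upper_unit_top_pair`: if `P = [… | (h-2)I+ℓ_v (slot b) | … hI …]` and the same cell with phase `w ≠ v` at `b` are both present, the second IS the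
`X⁺` sibling of depth one (direction `w + 2 ≠ v + 2`) and (Xp) fires.  The second copy is supplied by `G₁`: `δ` (`DeltaClosed`) rotates phases about
apexes (`deltaPt_ray_apex`), slot swaps (`PermClosed`) realign.  Killed ∀ h (◇₄ instrument `q2g10/cones4b.py`, round 1 of the F₃ layering):
(K1′) apex letters off `b`; (R1-P) `P[O|ℓ|(h-2)I+ℓ|(h-2)I+ℓ′]`; (R1-N₀) `N[O|ℓ|(h-2)I+ℓ|(h-2)I+ℓ′]`; (R1-N) `N[ℓ_a|ℓ_b|(h-2)I+ℓ_v|hI]`, `a ≠ b`;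
(R1-P′) `P[ℓ_a|ℓ_{a+2}|(h-2)I+ℓ_v|hI]`.  HC ∕ HC_AV ∕ HC_CM ∕ H2 ∕ 18881 NOT proved; `NoThree (2k)`, `k ≥ 2`, NOT proved. -/

/-- `δ` fixes apexes. -/
theorem deltaPt_apex (t : ℤ) : deltaPt ((t, 0, 0) : BPoint) = (t, 0, 0) := by simp [deltaPt]

/-- `δ` rotates a ray about an apex by one phase step: `δ(t·I + c·n_k) = t·I + c·n_{k+3}`. -/
theorem deltaPt_ray_apex (t c : ℤ) (k : Fin 4) :
    deltaPt (ray ((t, 0, 0) : BPoint) k c) = ray ((t, 0, 0) : BPoint) (k + 3) c := by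
  fin_cases k <;> simp [deltaPt, ray]

/-- iterated: `δ^m (t·I + c·n_k) = t·I + c·n_{k+3m}` (`m` read in `Fin 4`). -/
theorem deltaPt_iter_ray_apex (t c : ℤ) (k m : Fin 4) :
    deltaPt^[m.val] (ray ((t, 0, 0) : BPoint) k c) = ray ((t, 0, 0) : BPoint) (k + 3 * m) c := by
  fin_cases m <;> fin_cases k <;> simp [deltaPt, ray]

theorem deltaPt_iter_apex (t : ℤ) (m : Fin 4) : deltaPt^[m.val] ((t, 0, 0) : BPoint) = (t, 0, 0) := by
  fin_cases m <;> simp [deltaPt]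

/-- iterated `Δ`-closure of `E₋`. -/
theorem delta_iter_mem_lower {C : MConfig} (hG : C.G1Closed) :
    ∀ (n : ℕ) {Z : MCell}, Z ∈ C.lower → (fun f => deltaPt^[n] (Z f)) ∈ C.lower
  | 0, Z, hZ => by simpa using hZ
  | n + 1, Z, hZ => by
      have e : (fun f => deltaPt^[n + 1] (Z f)) = MCell.delta (fun f => deltaPt^[n] (Z f)) := by
        funext f; simp only [MCell.delta, Function.iterate_succ_apply']
      rw [e]; exact hG.2.2.1 _ (delta_iter_mem_lower hG n hZ)

/-- phase bookkeeping (`decide`): the rotation count `3(b - a)` carries `ℓ_a` to `ℓ_b` and moves every phase when `a ≠ b`. -/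
theorem rot_phase (a b : Fin 4) : a + 3 * (3 * (b - a)) = b := by revert a b; decide

theorem rot_ne {a b : Fin 4} (hab : a ≠ b) (v : Fin 4) : v + 3 * (3 * (b - a)) ≠ v := by revert hab; revert a b v; decide

theorem phase_d1_ne (v : Fin 4) : v + 3 ≠ v := by revert v; decide

theorem phase_d2_ne (v : Fin 4) : v + 3 + 3 ≠ v := by revert v; decide

theorem phase_d2_antip (a : Fin 4) : a + 2 + 3 + 3 = a := by revert a; decide

theorem phase_d2 (a : Fin 4) : a + 3 + 3 = a + 2 := by revert a; decide

/-- four pairwise distinct slots exhaust `Fin 4` (`decide`). -/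
theorem fin4_cover {s₀ s₁ s₂ s₃ : Fin 4} (h01 : s₀ ≠ s₁) (h02 : s₀ ≠ s₂) (h03 : s₀ ≠ s₃) (h12 : s₁ ≠ s₂) (h13 : s₁ ≠ s₃)
    (h23 : s₂ ≠ s₃) (g : Fin 4) : g = s₀ ∨ g = s₁ ∨ g = s₂ ∨ g = s₃ := by
  revert g s₀ s₁ s₂ s₃; decide

/-- **PHASE UNIQUENESS AT A UNIT CEILING LETTER (PROVED, h-uniform)** — §32's top-slot kill with the sibling given as a cell: two `P`-cells that agree
off `b`, carry `hI` on `g₁ ≠ b` and unit ceiling letters `(h-2)I+ℓ_v ≠ (h-2)I+ℓ_w` on `b` are not both present. -/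
theorem not_upper_unit_top_pair {h : ℤ} {C : MConfig} (hU : C.InDiamond h) (hS : C.StaticH1)
    {P : MCell} (hP : P ∈ C.upper) {b g₁ v w : Fin 4} (hg₁b : g₁ ≠ b)
    (hPb : P b = ray ((h - 2, 0, 0) : BPoint) v 1) (hPg : P g₁ = ((h, 0, 0) : BPoint))
    {Q : MCell} (hQ : Q ∈ C.upper) (hwv : w ≠ v) (hQb : Q b = ray ((h - 2, 0, 0) : BPoint) w 1)
    (hQg : ∀ g, g ≠ b → Q g = P g) : False := by
  have h1 : ((h, 0, 0) : BPoint).1 - (ray ((h - 2, 0, 0) : BPoint) w 1).1 = 1 := by simp; omega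
  refine not_upper_unit_top hU hS hP hg₁b hPb hPg hQ (r := w + 2) (fun heq => hwv (add_right_cancel heq)) ⟨?_, ?_, ?_⟩
    (by rw [hQb]; simp; omega)
  · intro g hg; rw [Function.update_of_ne hg]; exact hQg g hg
  · rw [hQb, Function.update_self]; simp; omega
  · rw [Function.update_self, hQb, h1]; exact top_eq_ray_unit h w

/-- **(K1′) (PROVED, h-uniform)**: a `P`-cell whose letters off `b` are apexes, with `(h-2)I+ℓ_v` on `b` and `hI` on `g₁ ≠ b`, is absent — the second
phase is its own `δ`-rotate (apexes are `δ`-fixed). A thin cell; the last link of (R1-P). -/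
theorem not_upper_apex_unit_top {h : ℤ} {C : MConfig} (hU : C.InDiamond h) (hG : C.G1Closed) (hS : C.StaticH1)
    {P : MCell} (hP : P ∈ C.upper) {b g₁ v : Fin 4} (hg₁b : g₁ ≠ b)
    (hPb : P b = ray ((h - 2, 0, 0) : BPoint) v 1) (hPg : P g₁ = ((h, 0, 0) : BPoint))
    (hapex : ∀ g, g ≠ b → (P g).2 = (0, 0)) : False := by
  refine not_upper_unit_top_pair hU hS hP hg₁b hPb hPg (hG.2.2.2 P hP) (phase_d1_ne v)
    (show deltaPt (P b) = _ by rw [hPb, deltaPt_ray_apex]) fun g hg => ?_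
  show deltaPt (P g) = P g
  have h2 := hapex g hg
  rcases hx : P g with ⟨x1, x2, x3⟩
  rw [hx] at h2
  simp only [Prod.mk.injEq] at h2
  obtain ⟨rfl, rfl⟩ := h2
  simp [deltaPt]

/-- **(R1-P) (PROVED, h-uniform)**: `P = [O | ℓ_a | (h-2)I+ℓ_v | (h-2)I+ℓ_w]` is absent: (DP) `N = P(ℓ_w-slot ↦ hI) ∈ E₋`, (DN) `P′ = N(ℓ_a ↦ O) ∈ E₊`
has apexes off the `ℓ_v`-slot: (K1′).  (◇₄: all 10 orbits `P[C1,C1,F1,O]`, round 1.) -/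
theorem no_upper_origin_unit_two_unit_ceilings {h : ℤ} {C : MConfig} (hU : C.InDiamond h) (hG : C.G1Closed) (hS : C.StaticH1)
    {P : MCell} (hP : P ∈ C.upper) {s₀ s₁ s₂ s₃ : Fin 4} (h01 : s₀ ≠ s₁) (h02 : s₀ ≠ s₂) (h03 : s₀ ≠ s₃)
    (h12 : s₁ ≠ s₂) (h13 : s₁ ≠ s₃) (h23 : s₂ ≠ s₃) {a v w : Fin 4}
    (hP0 : P s₀ = ((0, 0, 0) : BPoint)) (hP1 : P s₁ = ray ((0, 0, 0) : BPoint) a 1)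
    (hP2 : P s₂ = ray ((h - 2, 0, 0) : BPoint) v 1) (hP3 : P s₃ = ray ((h - 2, 0, 0) : BPoint) w 1) : False := by
  have hN₁ := lower_mem_of_unit_ceiling hU (hS.1.2 P hP) h23 (t₀ := h - 2) (c₀ := 1) le_rfl (by ring) hP2 hP3
  set N₁ := Function.update P s₃ ((h, 0, 0) : BPoint) with hN₁def
  have hN₁0 : N₁ s₀ = ((0, 0, 0) : BPoint) := by rw [hN₁def, Function.update_of_ne h03, hP0]
  have hN₁1 : N₁ s₁ = ray ((0, 0, 0) : BPoint) a 1 := by rw [hN₁def, Function.update_of_ne h13, hP1]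
  have hP₂ := upper_mem_of_unit_origin hU (hS.1.1 N₁ hN₁) h01 hN₁0 hN₁1
  set P₂ := Function.update N₁ s₁ ((0, 0, 0) : BPoint) with hP₂def
  have hP₂3 : P₂ s₃ = ((h, 0, 0) : BPoint) := by
    rw [hP₂def, Function.update_of_ne h13.symm, hN₁def, Function.update_self]
  refine not_upper_apex_unit_top hU hG hS hP₂ h23.symm
    (by rw [hP₂def, Function.update_of_ne h12.symm, hN₁def, Function.update_of_ne h23, hP2]) hP₂3 fun g hg => ?_
  rcases fin4_cover h01 h02 h03 h12 h13 h23 g with rfl | rfl | rfl | rfl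
  · rw [hP₂def, Function.update_of_ne h01, hN₁0]
  · rw [hP₂def, Function.update_self]
  · exact absurd rfl hg
  · rw [hP₂3]

/-- **(R1-N₀) (PROVED, h-uniform)**: `N = [O | ℓ_a | (h-2)I+ℓ_v | (h-2)I+ℓ_w]` is absent: the self-served `A2I⁻` kill (Am) at `ℓ_a`, whose escape
cell is an (R1-P) cell.  (◇₄: all 10 orbits `N[C1,C1,F1,O]`.) -/
theorem no_lower_origin_unit_two_unit_ceilings {h : ℤ} {C : MConfig} (hU : C.InDiamond h) (hG : C.G1Closed) (hS : C.StaticH1)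
    {Z : MCell} (hZ : Z ∈ C.lower) {s₀ s₁ s₂ s₃ : Fin 4} (h01 : s₀ ≠ s₁) (h02 : s₀ ≠ s₂) (h03 : s₀ ≠ s₃)
    (h12 : s₁ ≠ s₂) (h13 : s₁ ≠ s₃) (h23 : s₂ ≠ s₃) {a v w : Fin 4}
    (hZ0 : Z s₀ = ((0, 0, 0) : BPoint)) (hZ1 : Z s₁ = ray ((0, 0, 0) : BPoint) a 1)
    (hZ2 : Z s₂ = ray ((h - 2, 0, 0) : BPoint) v 1) (hZ3 : Z s₃ = ray ((h - 2, 0, 0) : BPoint) w 1) : False := by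
  refine not_lower_unit_origin hU hG hS hZ h01 hZ1 hZ0 fun P hP hPo hPb hPg => ?_
  exact no_upper_origin_unit_two_unit_ceilings hU hG hS hP h01.symm h12 h13 h02 h03 h23 hPb hPo
    (by rw [hPg s₂ h12.symm h02.symm, hZ2]) (by rw [hPg s₃ h13.symm h03.symm, hZ3])

/-- **(R1-N) (PROVED, h-uniform)**: `N = [ℓ_a | ℓ_b | (h-2)I+ℓ_v | hI]` with `a ≠ b` is absent: (DN) `P = N(ℓ_a ↦ O) ∈ E₊`; the rotated copy
`δ^{3(b-a)} N ∘ swap` gives (DN) `P′ = [O | ℓ_b | (h-2)I+ℓ_{v+3(b-a)} | hI] ∈ E₊`, phase `≠ v`: `not_upper_unit_top_pair`.  (◇₄: 6 of the 10 orbits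
`N[C1,F1,F1′,4I]`; the equal-phase orbits `a = b` need longer cones.) -/
theorem no_lower_two_units_unit_ceiling_top {h : ℤ} {C : MConfig} (hU : C.InDiamond h) (hG : C.G1Closed) (hS : C.StaticH1)
    {Z : MCell} (hZ : Z ∈ C.lower) {s₀ s₁ s₂ s₃ : Fin 4} (h01 : s₀ ≠ s₁) (h02 : s₀ ≠ s₂) (h03 : s₀ ≠ s₃)
    (h12 : s₁ ≠ s₂) (h13 : s₁ ≠ s₃) (h23 : s₂ ≠ s₃) {a b v : Fin 4} (hab : a ≠ b)
    (hZ0 : Z s₀ = ray ((0, 0, 0) : BPoint) a 1) (hZ1 : Z s₁ = ray ((0, 0, 0) : BPoint) b 1)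
    (hZ2 : Z s₂ = ray ((h - 2, 0, 0) : BPoint) v 1) (hZ3 : Z s₃ = ((h, 0, 0) : BPoint)) : False := by
  -- (DN) P = N(s₀ ↦ O) ∈ E₊ (the floor letter on s₁ is stuck)
  have hP := upper_mem_of_unit_floor hU (hS.1.1 Z hZ) h01.symm (c₀ := 1) le_rfl hZ1 hZ0
  -- the rotate N′ = δ^m N, m = 3(b - a)
  set m : Fin 4 := 3 * (b - a) with hmdef
  have hZ' := delta_iter_mem_lower hG m.val hZ
  set Z' : MCell := fun f => deltaPt^[m.val] (Z f) with hZ'def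
  have hZ'0 : Z' s₀ = ray ((0, 0, 0) : BPoint) b 1 := by
    show deltaPt^[m.val] (Z s₀) = _; rw [hZ0, deltaPt_iter_ray_apex, hmdef, rot_phase]
  have hZ'1 : Z' s₁ = ray ((0, 0, 0) : BPoint) (b + 3 * m) 1 := by
    show deltaPt^[m.val] (Z s₁) = _; rw [hZ1, deltaPt_iter_ray_apex]
  -- (DN) at N′: discharge the floor letter on s₁ (`ℓ_b` on s₀ is stuck); then swap the two floor slots
  have hP' := upper_mem_of_unit_floor hU (hS.1.1 Z' hZ') h01 (c₀ := 1) le_rfl hZ'0 hZ'1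
  obtain ⟨P₁, hP₁⟩ : ∃ P₁ : MCell, P₁ = MCell.perm (Equiv.swap s₀ s₁) (Function.update Z' s₁ ((0, 0, 0) : BPoint)) :=
    ⟨_, rfl⟩
  have hev : ∀ g, P₁ g = Function.update Z' s₁ ((0, 0, 0) : BPoint) (Equiv.swap s₀ s₁ g) := fun g => by rw [hP₁]; rfl
  refine not_upper_unit_top_pair hU hS hP h23.symm (by rw [Function.update_of_ne h02.symm, hZ2])
    (by rw [Function.update_of_ne h03.symm, hZ3]) (Q := P₁) (by rw [hP₁]; exact hG.2.1 _ _ hP') (rot_ne hab v)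
    (by rw [hev, Equiv.swap_apply_of_ne_of_ne h02.symm h12.symm, Function.update_of_ne h12.symm]
        show deltaPt^[m.val] (Z s₂) = _; rw [hZ2, deltaPt_iter_ray_apex]) fun g hg => ?_
  rcases fin4_cover h01 h02 h03 h12 h13 h23 g with rfl | rfl | rfl | rfl
  · rw [hev, Equiv.swap_apply_left, Function.update_self, Function.update_self]
  · rw [hev, Equiv.swap_apply_right, Function.update_of_ne h01, hZ'0, Function.update_of_ne h01.symm, hZ1]
  · exact absurd rfl hg
  · rw [hev, Equiv.swap_apply_of_ne_of_ne h03.symm h13.symm, Function.update_of_ne h13.symm, Function.update_of_ne h03.symm,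
      hZ3]
    show deltaPt^[m.val] (Z _) = _; rw [hZ3, deltaPt_iter_apex]

/-- **(R1-P′) (PROVED, h-uniform)**: `P = [ℓ_a | ℓ_{a+2} | (h-2)I+ℓ_v | hI]` (two ANTIPODAL unit floor letters) is absent: the second phase is `δ²P`
with its floor slots swapped (`δ²` exchanges `ℓ_a`, `ℓ_{a+2}` and carries `ℓ_v` to `ℓ_{v+2}`). ◇₄: `P[C1,F1,−F1,4I]`, 2 orbits, round 1, 2 clauses. -/
theorem no_upper_antipodal_units_unit_ceiling_top {h : ℤ} {C : MConfig} (hU : C.InDiamond h) (hG : C.G1Closed) (hS : C.StaticH1)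
    {P : MCell} (hP : P ∈ C.upper) {s₀ s₁ s₂ s₃ : Fin 4} (h01 : s₀ ≠ s₁) (h02 : s₀ ≠ s₂) (h03 : s₀ ≠ s₃)
    (h12 : s₁ ≠ s₂) (h13 : s₁ ≠ s₃) (h23 : s₂ ≠ s₃) {a v : Fin 4}
    (hP0 : P s₀ = ray ((0, 0, 0) : BPoint) a 1) (hP1 : P s₁ = ray ((0, 0, 0) : BPoint) (a + 2) 1)
    (hP2 : P s₂ = ray ((h - 2, 0, 0) : BPoint) v 1) (hP3 : P s₃ = ((h, 0, 0) : BPoint)) : False := by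
  obtain ⟨P₁, hP₁⟩ : ∃ P₁ : MCell, P₁ = MCell.perm (Equiv.swap s₀ s₁) P.delta.delta := ⟨_, rfl⟩
  have hev : ∀ g, P₁ g = deltaPt (deltaPt (P (Equiv.swap s₀ s₁ g))) := fun g => by rw [hP₁]; rfl
  refine not_upper_unit_top_pair hU hS hP h23.symm hP2 hP3 (Q := P₁)
    (by rw [hP₁]; exact hG.2.1 _ _ (hG.2.2.2 _ (hG.2.2.2 P hP)))
    (phase_d2_ne v) (by rw [hev, Equiv.swap_apply_of_ne_of_ne h02.symm h12.symm, hP2, deltaPt_ray_apex, deltaPt_ray_apex])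
    fun g hg => ?_
  rcases fin4_cover h01 h02 h03 h12 h13 h23 g with rfl | rfl | rfl | rfl
  · rw [hev, Equiv.swap_apply_left, hP1, deltaPt_ray_apex, deltaPt_ray_apex, phase_d2_antip, hP0]
  · rw [hev, Equiv.swap_apply_right, hP0, deltaPt_ray_apex, deltaPt_ray_apex, phase_d2, hP1]
  · exact absurd rfl hg
  · rw [hev, Equiv.swap_apply_of_ne_of_ne h03.symm h13.symm, hP3, deltaPt_apex, deltaPt_apex]

end LawSpan

end AnomalyLens

end Summit.Ventures.HSemireg.Pad4Tower
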